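import Summits.AtomisticToContinuum.BoseEinsteinCondensation.Theses.BECConjugateDomination
import Literature.MathematicalPhysics.QuantumManyBody.TorusFockSectorDictionary
import Literature.MathematicalPhysics.QuantumManyBody.PeriodicBoseGasMomentumSector
import Literature.MathematicalPhysics.QuantumManyBody.PeriodicFormDomain
import Literature.MathematicalPhysics.QuantumManyBody.BoseGasDirichletWall
import Literature.MathematicalPhysics.QuantumManyBody.GroundStateDirichletForm
import Literature.MathematicalPhysics.QuantumManyBody.LiebYngvasonBoxBound
import Literature.MathematicalPhysics.QuantumManyBody.LiebYngvasonCellMethod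
import Literature.MathematicalPhysics.QuantumManyBody.BoseGasThermodynamicLimitProofs
import Literature.Barriers.AtomisticToContinuum.KineticGapLengthScalesThermodynamicWindow
import Literature.MathematicalPhysics.QuantumManyBody.PeriodicBoseGasThm31
import Literature.MathematicalPhysics.QuantumManyBody.PeriodicBoseGasImpurityTranslation
import Literature.MathematicalPhysics.QuantumManyBody.PeriodicBoseGasJastrow

/-!
# Disproof workfile for crux `PuffFloor` (stmt-AtomisticToContinuum-11785, route `BECConjugateDomination`)

Standing adversary's Lean record (cdisprove seats `refuter-cdisprove-stmt-AtomisticToContinuum-11785-0`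
(cycle 1, v1–v4), `…-11785-g2-0` (cycle 2, v5), `…-11785-g3-0` (cycle 3, v6 series) and `…-11785-g4-0`
(cycle 4, v7 series), opened 2026-08-16). Everything below is `lean check`ed (rc 0, axioms propext/Classical.choice/Quot.sound);
`sorry` appears only in a `Near-misses` section (none at present). Provers: import nothing from here —
the conclusive parts are landed under `Theorems/PuffFloor/Negative/` (namespace
`…Theorems.PuffFloor.Negative`, same declaration names as here): cycle 1 chain
`{PairCorrelationToolkit (p73350), AntiCorrelatedWitness (p73830), PuffFloorFalseWithoutMinimality
(p74257), PuffFloorFalseForNearMinimisers (p74773), FreeGasModel (p74494)}.lean` — ALL ACCEPTED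
2026-08-16; cycle 2 files `{FiniteEnergyDecoration, MomentMethodTightness, HardCoreVacuity}.lean` —
p76044, p76047, p76052, ALL ACCEPTED 2026-08-16; cycle 3 files `{SmoothClassInhabitants (p81225),
CorePairDominationConstState (p81898), LatticeCosine (p81912), CorePairDominationKinetic (p82498)}.lean`
— ALL ACCEPTED 2026-08-16 (reviewed: glue constants 8/480/960B² re-derived by the reviewer;
`nearestLat`/`reduce` of `PeriodicBoseGasJastrow` reused; shell-state model checked); cycle 4 file
`PocketInstability.lean` (pocket lemma + coreless instability; proposal id in the seat's evidence note).
THIS IS v7 (cycle 4): `-- Targets` RE-INDEXED to the REGISTERED skeleton of the picked line (lead reshape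
v2, sha b2ebe54f1b59, SEVEN stubs S1 `stub_pocketClassicalStability` … S7 `stub_corelessPairMoment`; the
cycle-3 block below used the gen-2 planner cut with five stubs and the names `stub_corePairDomination` /
`stub_pocketNoBinding_of_domination` / `stub_minimiserRegularity` — read its S1/S2/S4 paragraphs as
background for today's S1+S2 / S2 / S4a+S5+S6), plus the formal load-bearing analysis of the new S1/S2:
see `## Cycle 4` at the end of the file. CYCLE 4 IN ONE LINE: no stub of the registered skeleton is
misstated; `exists_pocket` (EVERY non-zero finite-range `C²` potential has, for every `t > 0`, a point
where `v < tW`, `W = r²‖D²ṽ‖` — a unique-continuation lemma at the edge of the support) and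
`pocket_unstable_of_coreless` make the positive core `0 < v 0` of S1/S2 FORMALLY load-bearing:
S1 minus the core is FALSE (`pocketClassicalStability_false_without_core`, hollow shell) and S2's
classical-stability hypothesis is UNSATISFIABLE for every coreless non-zero member and every coupling
(`noBindingOfStability_hypothesis_false_of_coreless`) — the line's case split is sharp and no
strengthening of Lee's lever reaches the residual S7. Ideators / planners / the lead may
`import Summits.AtomisticToContinuum.BoseEinsteinCondensation.Theorems.PuffFloor.Negative.PuffFloorFalseForNearMinimisers`
(pulls the cycle-1 chain) instead of this workfile. Cycle-2 and cycle-3 additions are grouped at the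
end of the file under `## Cycle 2` / `## Cycle 3` / `## Cycle 4`; the index below covers all cycles.
CYCLE 3 IN ONE LINE: line `coupling-slope-pocket` picked (02:34Z) — its five stubs are the `-- Targets`; none is
misstated (S3's constants 12 and 2 re-derived independently; S1 passes the constant-state, cluster,
Jastrow and annulus tests), two formal by-products landed-to-be: S1's constant is necessarily
`≥ (R/r₀)³/c₀` and S1 is FALSE at `c₀ = 0` (positive core load-bearing), and the smooth class is
INHABITED on both branches of `PuffFloor_of` (solid bump with `0 < v 0`; hollow shell with `v 0 = 0`,
`v ≠ 0`), so neither the crux nor the residual stub S5 is settled by the free-gas model.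

## The crux, read back

`PuffFloor`: for every smooth-class `v` (repulsive finite range, finite, `C²` as `x ↦ v(|x|)`, edge
condition `‖D²ṽ‖ ≤ Cₑ√ṽ`) `∃ C ≥ 0 ∃ ρ₀ > 0 ∀ ρ ∈ (0,ρ₀) ∀ᶠ n ∀ Ψ : PeriodicTrialState (n+1) L`,
`L = sideLength ρ (n+1)`: if `Ψ` is an exact minimiser (`periodicEnergy v Ψ = E₀^per`), of finite
energy, real (`Ψ = |Ψ|`) and pointwise non-zero, then for every `m ≠ 0`
`kn m / √(kn m² + Cρ) ≤ S m`, `kn m = ‖(2π/L)•m‖ = |k|`, `S m = N⁻¹ ∫_{Λᴺ} |∑ⱼ e_m(xⱼ)|² |Ψ|²`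
(uncentred static structure factor; `= 1` for the constant state). No junk: `kn m > 0` for
`m ≠ 0`, the Bochner integrand is bounded by `N²|Ψ|²` hence integrable, `PeriodicTrialState` is
normalised on the cell.

## Findings (index of this file)

* `### Word products …`, `### The pair-correlation polynomial` — toolkit: `∫_{Λᴺ} e_m(xᵢ)ē_m(xⱼ) = 0`
  (`i ≠ j`), `∫_{Λᴺ} (e_m(xᵢ)ē_m(xⱼ))(e_m(x_a)ē_m(x_b)) = [i=b ∧ a=j] L^{3N}`, whence for
  `T_m = |ρ_m|² - N = ∑_{i≠j} e_m(xᵢ)ē_m(xⱼ)`: `∫ T_m = 0`, `∫ T_m² = N(N-1)L^{3N}`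
  (`integral_cellN_pairCorr`, `integral_cellN_pairCorr_sq`).
* `### The anti-correlated witness` — for `0 ≤ ε`, `ε(N²-N) ≤ ½` the state
  `Ψ_ε ∝ √(1 - ε T_m)` is an admissible periodic trial state (real, `> 0`, `C¹`), and
  **`S_m(Ψ_ε) = 1 - ε(N-1)`** exactly (`structureFactor_witnessState`). `ε = 0` is the constant state.
* (a) LOAD-BEARING ANALYSIS.
  - **Minimality is load-bearing** — `puffFloor_false_without_minimality : ¬ PuffFloorWithoutMinimality`
    (the crux with `periodicEnergy v Ψ = E₀^per` dropped, all else verbatim, is FALSE): `v ≡ 0` is in the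
    smooth class (`smoothClass_zero`), `Ψ_{1/(2N²)}` has `S_m = 1 - (N-1)/(2N²)` at EVERY `N ≥ 2`,
    and at a high mode `m = (M,0,0)` the floor `|k|/√(|k|²+Cρ) > 1 - (N-1)/(2N²)` for every
    `C ≥ 0`, every `ρ`. So the floor is NOT a kinematic property of positive finite-energy states:
    any proof must use the Euler–Lagrange / spectral information of the EXACT minimiser (as the
    intended sum-rule proof does: the moments of `H - E₀ ≥ 0` in `ρ_k†Ψ₀`).
  - `m ≠ 0` is decoration — `puffFloorAllModes_iff : PuffFloorAllModes ↔ PuffFloor` (at `m = 0`,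
    `kn 0 = 0 ≤ S 0`).
  - `periodicEnergy v Ψ ≠ ⊤` is decoration — FORMAL (cycle 2): `puffFloorWithoutFiniteEnergy_iff :
    PuffFloorWithoutFiniteEnergy ↔ PuffFloor`; the non-trivial direction uses
    `exists_eventually_periodicGroundStateEnergy_lt_top` (E₀^per < ⊤ eventually in `N` at small `ρ`,
    for EVERY repulsive finite-range `v`, hard cores included), so after shrinking `ρ₀` an exact
    minimiser has finite energy automatically. Planners may drop the hypothesis.
  - `Ψ = |Ψ|`, `Ψ ≠ 0`: `S` depends on `|Ψ|²` only; for the bosonic = absolute ground state these are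
    normalisations modulo uniqueness (PositiveMinimiser, stmt-11787) — decoration modulo 11787, not
    load-bearing for truth; NOT dropped-and-refuted here because without them AND with minimality the
    statement is still expected true.
  - `(∀ r, v r ≠ ⊤)`, `C²`, edge condition: load-bearing for the INTENDED PROOF only (Puff's `m₃ = +∞`
    for a hard core; `D²ṽ` enters `m₃`), not for truth: for hard spheres `g₂ ∈ C¹` with a jump in
    `g₂''` at contact gives `1 - S(k) = O(ρ a² (ka)⁻⁴)`-type UV decay and the phonon IR law is
    unchanged, so the floor is still expected with `C → 16πa` (`Δ(f₀²) = 2a²r⁻⁴ 1_{r>a} ≥ 0`, see (e)).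
    No refutation available (no solvable interacting 3D model); recorded as opinion. BUT, FORMAL
    (cycle 2, (h) below): for a hard-core `v` the crux's inner hypotheses `periodicEnergy ≠ ⊤` and
    `∀ X, Ψ X ≠ 0` are CONTRADICTORY, so any verbatim extension of `PuffFloor` to hard cores is
    vacuously true — the finiteness of `v` is what keeps the statement honest, and hard cores must go
    through `HardCoreExtension` (or a restatement asking positivity only off the core).
* (b) TIGHTNESS — `puffFloor_tight_at_freeGas`: for `v ≡ 0` the constant minimiser gives EQUALITY at
  `C = 0` and every mode (`S_m = 1 = kn/√(kn²+0)`); with `periodicEnergy_witnessState_zero` (the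
  constant state IS a free-gas minimiser). Bogoliubov saturates the floor at EVERY `k` with
  `C = 16πa` (`S_B = |k|/√(|k|²+16πaρ)`), so the functional form `|k|/√(|k|²+Cρ)` is the sharp one;
  LHY raises the IR requirement to `C ≥ 16πa(1+O(√(ρ₀a³)))` (absorbed by `∃ C`).
  TIGHTNESS OF THE METHOD — FORMAL (cycle 2): `lintegral_pow_three_le_measure_sq_mul` is the
  Lyapunov–Hölder step `m₁³ ≤ m₀² m₃` of the intended proof for an arbitrary measure (one Hölder
  application with exponents `(3, 3/2)`; with `m₀ = NS`, `m₁ = N|k|²`, `m₃ ≤ N|k|⁴(|k|²+Θ)` it IS the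
  floor `S ≥ |k|/√(|k|²+Θ)`), and `moment_method_tight_single_mode` shows a one-atom (single-mode,
  Feynman/Bogoliubov) spectral measure gives EQUALITY: the three moments `m₀, m₁, m₃` can never yield
  more than `|k|/√(|k|²+Θ)`, so `Θ = O(ρ)` UNIFORMLY IN `N` is necessary for the method (not for the
  statement) — the whole difficulty of the sum-rule line is the constant in Puff's `M₃`.
* (c) NATURAL STRENGTHENINGS REFUTED — `PuffFloorWithoutMinimality` above, and
  **`puffFloor_false_for_nearMinimisers : ¬ PuffFloorNearMinimisers`** (minimality weakened to
  `periodicEnergy ≤ E₀^per + δ'` with `∃ δ' > 0` AFTER `n` — the weakest near-minimiser form, the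
  energy window of the target `SmoothPeriodicBEC`): for `v ≡ 0` the witness `Ψ_ε`, `ε = η/N²`, at the
  mode `k = (2π/L)(j,0,0)`, `j = ⌊√(Cρ/(εn))/(2π/L)⌋+1`, has `periodicEnergy ≤ 2ε²N³k²`
  (`periodicEnergy_witnessState_le`, from the pointwise bound `|∂_{i,a}Ψ_ε|² ≤ 2(L³)^{-N}ε²N²(2πmₐ/L)²`)
  `≤ η(8Cρ + 4(2π/L)²) < δ'` for `η` small, yet `S_m = 1 - εn` lies below the floor. The energy cost
  of violating the floor decays like `1/k²` along high modes: the floor is violated by states of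
  ARBITRARILY SMALL excitation energy, so it is a property of the EXACT minimiser only and admits no
  proof by energy-closeness/compactness. Consequence for the route: PuffFloor can only be used for the
  exact minimiser (as IMUChainGlue does — near-minimisers enter through NearMinimiserStability on
  `n₀`, not through `S`).
* (d) TARGETS — CYCLE 4 (current): the seven stubs of the REGISTERED skeleton (lead reshape v2):
  S1 `stub_pocketClassicalStability` PROVED by the lead (`Theorems/BECConjugateDominationPuffFloorPocketClassicalStability.lean`);
  S2 `stub_noBindingOfStability`, S4a `stub_eulerLagrange`, S4b `stub_puffFeynmanFloor`, S5
  `stub_positiveMinimiser` (= item 11787), S6 `stub_positiveMinimiserUnique` SURVIVE the audit (none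
  misstated; per-stub briefing in `## Cycle 4 — Targets`); S7 `stub_corelessPairMoment` open residual.
  FORMAL this cycle: `exists_pocket`, `pocket_unstable_of_coreless`,
  `pocketClassicalStability_false_without_core` (S1 minus `0 < v 0` is FALSE),
  `noBindingOfStability_hypothesis_false_of_coreless` (S2 vacuous on the coreless class).
  TARGETS — cycle 3 (superseded indexing): line `coupling-slope-pocket` PICKED (lead `PICKED.md` 02:34Z; gen-2 skeleton
  `Lines/coupling-slope-pocket.lean` 02:41Z, 5 registered stubs; `stuck_stubs = []` at this seat's
  start). Full attack log per stub in `## Cycle 3 — Targets` at the end of this file; verdicts: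
  S1 `stub_corePairDomination` SURVIVES (no cheap violating family; FORMAL by-products
  `corePairDomination_ratio_le` — every admissible constant has `(R/r₀)³ ≤ C·c₀`, both sides of S1
  computed exactly at the constant two-body state —, `corePairDomination_false_without_core` —
  S1 with `0 < c₀` weakened to `0 ≤ c₀` is FALSE — and `corePairDomination_false_without_kinetic` —
  S1 with the kinetic energy deleted is FALSE (shell state): BOTH terms of Lee's energy are
  load-bearing); S2 SURVIVES (bookkeeping verified); S3
  `stub_puffFeynmanFloor` SURVIVES (Puff's `m₃` constants `12`, `4 → 2` re-derived from `[A†,[H,A]]`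
  this cycle, kinetic normalisation `kineticDensity = Σ|∂_{j,a}Ψ|²` checked; the imaginary cross term
  dies by translation invariance); S4 SURVIVES (Schauder / uniqueness by convexity); S5
  `stub_corelessPairMoment` OPEN residual, now shown NON-VACUOUS (`hollowShell_mem_smoothClass`).
  Pre-registered (cycle 2) hollow-core target — operator domination `Σ 1{|xᵢ-xⱼ|<r} ≤ C(H_N + N)` is
  false for potentials vanishing on a ball — is NOT stated by the picked skeleton (S1 asks a positive
  core, S5 keeps exact minimality), so it stays unformalised; the hollow-shell inhabitant (k) is the
  `v` it would use.
* (f) SMALL MODEL `v ≡ 0` (positive): `puffFloor_holds_at_freeGas` — the crux's conclusion at the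
  free gas HOLDS with `C = 0`, every `ρ₀`, EVERY `n` and every minimiser: zero kinetic energy forces
  `Ψ` constant on the cell (`exists_eq_const_of_kinetic_zero`: partials vanish on the open box by
  `lintegral_cellN_pos`, mean value theorem on the convex open box, continuity along the inward
  diagonal), so `S_m = 1 ≥ kn/√(kn² + Cρ)` (`structureFactor_eq_one_of_freeMinimiser`,
  `floor_le_one`). Contrast with (a)/(c): at the same `v ≡ 0` the minimality-free and near-minimiser
  variants FAIL — the whole content of the crux at the free gas is carried by exact minimality.
* (e) WHY THE CRUX RESISTS REFUTATION (no `sorry`s, prose; sharpened in cycle 2): `PuffFloor ⟺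
  sup_{k≠0} Q(k) ≤ C` with `Q(k) := |k|²(S(k)⁻² - 1)/ρ`, uniformly in `n` large and `ρ < ρ₀`; a kill
  needs an interacting smooth-class `v` with `Q` unbounded along exact torus minimisers. Every regime is
  bounded, BY THE SAME NUMBER: (IR, `|k| ≲ √(aρ)`) phonon saturation `S → |k|/c'` gives
  `Q(0⁺) = c'²/ρ = 16πa(1+O(√(ρa³)))` (LHY compressibility; slightly ABOVE `16πa`, so `C = 16πa`
  exactly fails at every `ρ > 0` while `C = 16πa(1+ε)` works below `ρ₀(ε)` — the `∃C ∃ρ₀` order is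
  exactly right); (Bogoliubov, all `k`) `Q_B ≡ 16πa`; (UV, `|k|ξ ≫ 1`) `S = 1 + ρĥ`, `h = g₂ - 1 ≈
  f₀² - 1` (`-2Δf₀ + vf₀ = 0`, `f₀ → 1 - a/r`), so `Q ≈ -2|k|²ĥ(k) = 2·FT[Δ(f₀²)](k)` where
  `Δ(f₀²) = v f₀² + 2|∇f₀|² ≥ 0` POINTWISE and `∫Δ(f₀²) = 8πa` (flux of the `1 - a/r` tail): the
  Fourier transform of a non-negative function is maximal at `k = 0`, hence `Q_UV(k) ≤ 16πa` for EVERY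
  potential shape (solid or hollow core, hard spheres included), with equality only as `k → 0` where it
  matches Bogoliubov (toy `kit j010386`: `f₀`, `a`, `Q_UV(k)/16πa` curves for `A(1-r²)⁴₊` and
  `Ar⁴(1-r²)⁴₊`, and the `N = 2` exact torus minimiser — numbers in (g)). So `sup_k Q = 16πa(1+o(1))`
  as `ρ → 0`, shape-independently: a refutation needs the exact minimiser's `g₂` to deviate from
  `f₀²(1+o(1))` at ORDER ONE on the scale `R₀` (e.g. three-body clustering making `Δg₂` strongly
  signed) or the phonon to disappear — no mechanism known at `ρ → 0`, `d = 3`. The one ordering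
  phenomenon known for BOUNDED repulsive potentials, cluster crystals / supersolids of "ultrasoft"
  bosons, needs `v̂` with a negative minimum AND interparticle distance below the range (`ρR₀³ ≳ 1`;
  Mendoza-Coto–de Souza Caetano–Díaz-Méndez, PRA 104, 013301 (2021), §II, QMC refs [1–5] there) —
  outside `ρ < ρ₀(v)` — and keeps acoustic phonons (`S` linear) anyway.
  PROOF OBLIGATIONS this exposes: the floor splits into an IR half (`|k| ≤ K√ρ`: only the sum-rule
  chain with `Θ = O(ρ)` reaches it — integration by parts gains nothing at small `k`) and a UV half
  (`|k| ≥ K√ρ`: `1 - S_m ≤ Cρ/(2|k|²)` ⟸ an `N`-uniform bound `‖∂²_r G_N‖_{L¹(cell)} ≤ C'ρN` on the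
  translation-averaged pair density `G_N = Σ_{i≠j}⟨δ(xᵢ-xⱼ-r)⟩ ≈ ρN g₂`, by two integrations by parts
  in `r`); both halves are "no clustering at scale R₀, uniformly in N" statements about the EXACT
  minimiser, neither follows from the energy value (¬PuffFloorNearMinimisers), and the naive by-parts
  bound `1 - S_m ≤ (N-1)·O(ρ)/|k|²` carries a factor `N` (it ignores correlation decay).
  The minimiser is not constructible in Lean and no exactly solvable 3D instance exists;
  `d = 1` analogues (Lieb–Liniger/Girardeau) satisfy the floor. The ONLY gap is in the intended PROOF:
  Puff's `m₃` potential term needs `E[#{i<j : |xᵢ-xⱼ| < R₀}] ≤ C N ρ R₀³` for the minimiser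
  (PairCountBound; energy controls `∫ v g₂` only, the edge zone `D²ṽ ~ √ṽ ≫ ṽ` is not energy-
  controlled) — a proof risk, not a falsity mechanism: clustering in the soft edge would make `Θ ≫ ρ`
  in Puff's bound but would NOT make `S` small (clustering RAISES `S` at `k ~ 1/R₀`).
  Barrier catalogue (`Literature/Barriers/AtomisticToContinuum/`): PitaevskiiStringariOneDimension(‑Narrow),
  OneDimensionalHardCore(‑Narrow), BogoliubovPerturbationInfrared, KineticGapLengthScales do not bite a
  LOWER bound on `S` (dimension-blind, true in `d = 1`); negatives index (12 in summit; BEC: stmt-3980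
  sign at `N = 1`, stmt-14490) shares no signature with this crux.
* (g) `N = 2` EXACT TORUS MINIMISER (toy `kit j010386`, the only computable interacting minimiser;
  irrelevant to the crux's `∀ᶠ n` but a probe of the all-`N` strengthening): job queued behind a
  saturated farm at v5 (1872 jobs, p95 wait 3.8 h); expectation `sup_m Q_m ≈ 16πa(N-1)/N = 8πa`
  (two-body depletion hole `∫|φ|²cos(k·r) ≈ -8πa/(|k|²L³)` at `|k|R₀ ≪ 1`); numbers folded in at v6.
* (h) HARD CORES — FORMAL (cycle 2): `periodicEnergy_eq_top_of_hardCore` (if `v = ⊤` on `[0,R₀)`,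
  every pointwise non-zero periodic trial state of `N ≥ 2` particles has infinite energy: the pair
  `(0,1)` sits in the core on the box `(0,δ)^{3N}`, `δ = min L (R₀/2)`, of positive volume) and
  `puffFloor_conclusion_vacuous_for_hardCore` (the crux's whole inner statement then holds with
  `C = 0`, vacuously). Dropping `∀ r, v r ≠ ⊤` therefore cannot be refuted and proves nothing: the
  smooth class's finiteness is a non-vacuity guard, not an analytic convenience.
* (i) PRE-READ OF THE THREE LINE SKELETONS (`Lines/{coupling-slope-pocket, pair-subsolution-removal-energy,
  sacrificial-edge-layer}.lean`, written 02:17–02:19Z; none picked yet, so no `-- Targets`): no misstated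
  stub found on a first adversarial pass. Checked in detail: `stub_puffFeynmanFloor` / `CubicMomentFloor` /
  `PuffFromPairDensity` (Puff's `M₃ = N|k|⁶ + 12|k|²Σ‖(k·∇ⱼ)Ψ‖² + 4E[Σ_{i<j}(1-cos k·xᵢⱼ)(k·∇)²ṽ^per]`
  re-derived here from `[H,[H,ρ_k]]`, including the vanishing of the `4i|k|²⟨k·∇ⱼV⟩` term by the
  eigen-equation and the real-`Ψ` identity `Re⟨ρ_kΨ, A_kΨ⟩ = N|k|²` for EVERY real state; all three
  keep exact minimality, so the anti-correlated witness of (a) does not bite); `PairSubsolution` (the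
  gradient step needs `|∇G|² ≤ 2G·K_a`, which holds WITHOUT inversion symmetry because
  `|∇G|² ≤ 4G·min(A(r), A(-r))` with `K_a = A(r) + A(-r)`, computing `∇_rG` through either particle);
  `RemovalEnergyBound` (`n = 0`: the constant pair state gives exactly `‖ṽ‖₁/L³`); `EdgeLayerStability`
  / `stub_noBindingOfStability` (dimers in the edge pocket gain `O(μ²)` against a localisation cost
  `O(1/μ)`: no cheap violating family). RESIDUAL STUBS (`stub_corelessPairMoment`, `ClusterTail`,
  `PairMomentBoundCoreless`) are claims about EXACT minimisers of coreless `v` — expected true, not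
  attackable without the minimiser; but their near-minimiser weakenings are FALSE already at `v ≡ 0`
  (ready witness, formalisation deferred until a line is picked: a product state `⊗φ` compressed into a
  sub-box of volume `θL³` has kinetic energy `≍ N θ^{-2/3} L⁻² → 0` along `L = sideLength ρ (n+1)`, yet
  cell second moment `Σ_c E n_c² ≈ N n̄/θ` and, for a hollow core `v = 0` on `B(0,r₁)`, pair moment /
  pair count `≍ N²` inside one core at kinetic cost `≍ N/r₁²`) — so, exactly as for the crux itself
  ((c) above), no energy-window argument can deliver the residuals; they need the eigen-equation twice.
* (k) NON-VACUITY OF THE INTERFACE — FORMAL (cycle 3): the crux quantifies over the "smooth class"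
  and holds trivially on `{0}` (f); `solidBump_mem_smoothClass` (`v(r) = g(R₀² - r²)`,
  `g = expNegInvGlue`, `0 < v 0`, `v ≠ 0`) and `hollowShell_mem_smoothClass`
  (`v(r) = g((r² - r₁²)(R₀² - r²))`, `v = 0` on `[0, r₁]`, `v ≠ 0`) are genuine members — all four
  class hypotheses proved, the edge condition through `|g^{(i)}| ≤ 480 √g` (`i ≤ 2`) and the Faà di
  Bruno bound `norm_iteratedFDeriv_comp_le` (`exists_edgeConst_expNegInvGlue_comp`: ANY `C²` shape
  function non-positive off a ball glues into the class). So (1) the crux is contentful (interacting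
  members with `a > 0` exist; not settled by `FreeGasModel`), (2) BOTH branches of the line's case split
  `0 < v 0` / `v 0 = 0` are inhabited by interacting potentials: the residual S5 is a claim about exact
  minimisers of genuinely interacting coreless `v` (particles closer than `r₁` are free), not an
  artefact removable by class-emptiness, and the planner's recommended restatement `0 < v 0` prunes a
  non-empty admissible family (physically immaterial, to be absorbed by `HardCoreExtension`).
-/
noncomputable section

namespace Summit.AtomisticToContinuum.BoseEinsteinCondensation.Cruxes.PuffFloor.Disproof

open Literature.MathematicalPhysics.QuantumManyBody.BoseGas MeasureTheory Complex Finset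
open scoped ComplexConjugate BigOperators ENNReal NNReal

variable {N : ℕ} {L : ℝ}

/-! ### Word products of plane waves and their cell integrals -/

/-- `∏ₗ e_{(w+w')ₗ}(xₗ) = ∏ₗ e_{wₗ}(xₗ) · ∏ₗ e_{w'ₗ}(xₗ)`. [folklore] -/
theorem prod_cellWave_add (w w' : Fin N → (Fin 3 → ℤ)) (X : Config N) :
    ∏ l, cellWave L ((w + w') l) (X l) =
      (∏ l, cellWave L (w l) (X l)) * ∏ l, cellWave L (w' l) (X l) := by
  rw [← Finset.prod_mul_distrib]
  refine Finset.prod_congr rfl fun l _ => ?_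
  rw [Pi.add_apply, cellWave_add_index]

/-- `∏ₗ e_{-wₗ}(xₗ) = conj ∏ₗ e_{wₗ}(xₗ)`. [folklore] -/
theorem prod_cellWave_neg (w : Fin N → (Fin 3 → ℤ)) (X : Config N) :
    ∏ l, cellWave L ((-w) l) (X l) = conj (∏ l, cellWave L (w l) (X l)) := by
  rw [map_prod]
  refine Finset.prod_congr rfl fun l _ => ?_
  rw [Pi.neg_apply, conj_cellWave]

/-- `∏ₗ e_{(δᵢm)ₗ}(xₗ) = e_m(xᵢ)`. [folklore] -/
theorem prod_cellWave_single (i : Fin N) (m : Fin 3 → ℤ) (X : Config N) :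
    ∏ l, cellWave L ((Pi.single i m : Fin N → (Fin 3 → ℤ)) l) (X l) = cellWave L m (X i) := by
  rw [Finset.prod_eq_single i]
  · rw [Pi.single_eq_same]
  · intro l _ hl; rw [Pi.single_eq_of_ne hl, cellWave_zero]
  · intro h; exact absurd (Finset.mem_univ i) h

/-- The pair wave `e_m(xᵢ) conj e_m(xⱼ)` is the word product of `δᵢ m - δⱼ m`. [folklore] -/
theorem pairWave_eq_prod (i j : Fin N) (m : Fin 3 → ℤ) (X : Config N) :
    cellWave L m (X i) * conj (cellWave L m (X j)) =
      ∏ l, cellWave L ((Pi.single i m - Pi.single j m : Fin N → (Fin 3 → ℤ)) l) (X l) := by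
  rw [sub_eq_add_neg, prod_cellWave_add, prod_cellWave_neg, prod_cellWave_single,
    prod_cellWave_single]

/-- `∫_{Λᴺ} e_m(xᵢ) conj e_m(xⱼ) dX = 0` for `i ≠ j`, `m ≠ 0`. [folklore] -/
theorem integral_cellN_pairWave (hL : 0 < L) {m : Fin 3 → ℤ} (hm : m ≠ 0) {i j : Fin N}
    (hij : i ≠ j) :
    ∫ X in cellN N L, cellWave L m (X i) * conj (cellWave L m (X j)) = 0 := by
  simp_rw [pairWave_eq_prod]
  rw [integral_cellN_prod_cellWave hL, if_neg]
  intro h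
  have h' := congr_fun h i
  rw [Pi.sub_apply, Pi.single_eq_same, Pi.single_eq_of_ne hij, sub_zero, Pi.zero_apply] at h'
  exact hm h'

/-- `∫_{Λᴺ} (e_m(xᵢ)ē_m(xⱼ))(e_m(x_a)ē_m(x_b)) dX = [i = b ∧ a = j] L^{3N}` (`i ≠ j`, `m ≠ 0`,
so `2m ≠ 0`: the word `δᵢ+δ_a-δⱼ-δ_b` vanishes iff `{i,a} = {j,b}`). [folklore] -/
theorem integral_cellN_pairWave_mul_pairWave (hL : 0 < L) {m : Fin 3 → ℤ} (hm : m ≠ 0)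
    {i j : Fin N} (hij : i ≠ j) (a b : Fin N) :
    ∫ X in cellN N L, (cellWave L m (X i) * conj (cellWave L m (X j))) *
        (cellWave L m (X a) * conj (cellWave L m (X b))) =
      if i = b ∧ a = j then ((L : ℂ) ^ 3) ^ N else 0 := by
  simp_rw [pairWave_eq_prod, ← prod_cellWave_add]
  rw [integral_cellN_prod_cellWave hL]
  have hmm : m + m ≠ 0 := by
    intro h
    apply hm
    have h2 : (2 : ℤ) • m = 0 := by rw [two_smul]; exact h
    exact (smul_eq_zero.1 h2).resolve_left (by norm_num)
  have key : (Pi.single i m - Pi.single j m + (Pi.single a m - Pi.single b m) :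
      Fin N → (Fin 3 → ℤ)) = 0 ↔ (i = b ∧ a = j) := by
    rw [show (Pi.single i m - Pi.single j m + (Pi.single a m - Pi.single b m) :
        Fin N → (Fin 3 → ℤ)) = (Pi.single i m + Pi.single a m) - (Pi.single j m + Pi.single b m)
        by abel, sub_eq_zero, Pi.single_add_single_eq_single_add_single hm hm]
    constructor
    · rintro (⟨rfl, -⟩ | ⟨-, h1, h2⟩ | ⟨h, -, -⟩)
      · exact absurd rfl hij
      · exact ⟨h1, h2⟩
      · exact absurd h hmm
    · rintro ⟨h1, h2⟩
      exact Or.inr (Or.inl ⟨rfl, h1, h2⟩)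
  by_cases h : i = b ∧ a = j
  · rw [if_pos (key.2 h), if_pos h]
  · rw [if_neg (fun h' => h (key.1 h')), if_neg h]

/-! ### The pair-correlation polynomial `T_m = |ρ_m|² - N` -/

/-- `T_m(X) = ∑_{i ≠ j} e_m(xᵢ) conj e_m(xⱼ)` (`= |∑ⱼ e_m(xⱼ)|² - N`). [folklore] -/
def pairSum (L : ℝ) (m : Fin 3 → ℤ) (X : Config N) : ℂ :=
  ∑ p ∈ (Finset.univ : Finset (Fin N)).offDiag,
    cellWave L m (X p.1) * conj (cellWave L m (X p.2))

/-- Pair waves are continuous. [folklore] -/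
theorem continuous_pairWave (L : ℝ) (m : Fin 3 → ℤ) (i j : Fin N) :
    Continuous fun X : Config N => cellWave L m (X i) * conj (cellWave L m (X j)) :=
  ((continuous_cellWave L m).comp (continuous_apply i)).mul
    (Complex.continuous_conj.comp ((continuous_cellWave L m).comp (continuous_apply j)))

/-- Pair waves have modulus `1`. [folklore] -/
theorem norm_pairWave (L : ℝ) (m : Fin 3 → ℤ) (i j : Fin N) (X : Config N) :
    ‖cellWave L m (X i) * conj (cellWave L m (X j))‖ = 1 := by
  rw [norm_mul, Complex.norm_conj, norm_cellWave, norm_cellWave, mul_one]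

/-- `∫_{Λᴺ} T_m = 0` (`m ≠ 0`). [folklore] -/
theorem integral_cellN_pairSum (hL : 0 < L) {m : Fin 3 → ℤ} (hm : m ≠ 0) :
    ∫ X in cellN N L, pairSum L m X = 0 := by
  unfold pairSum
  rw [integral_finsetSum _ fun p _ => integrableOn_cellN_of_bounded L
    (continuous_pairWave L m p.1 p.2) (fun X => (norm_pairWave L m p.1 p.2 X).le)]
  refine Finset.sum_eq_zero fun p hp => ?_
  exact integral_cellN_pairWave hL hm (Finset.mem_offDiag.1 hp).2.2

/-- `∫_{Λᴺ} T_m² = #offDiag · L^{3N} = N(N-1) L^{3N}` (`m ≠ 0`). [folklore] -/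
theorem integral_cellN_pairSum_sq (hL : 0 < L) {m : Fin 3 → ℤ} (hm : m ≠ 0) :
    ∫ X in cellN N L, pairSum L m X ^ 2 =
      ((Finset.univ : Finset (Fin N)).offDiag.card : ℂ) * ((L : ℂ) ^ 3) ^ N := by
  have hexp : ∀ X : Config N, pairSum L m X ^ 2 =
      ∑ p ∈ (Finset.univ : Finset (Fin N)).offDiag, ∑ q ∈ (Finset.univ : Finset (Fin N)).offDiag,
        (cellWave L m (X p.1) * conj (cellWave L m (X p.2))) *
          (cellWave L m (X q.1) * conj (cellWave L m (X q.2))) := by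
    intro X
    rw [sq, pairSum, Finset.sum_mul_sum]
  simp_rw [hexp]
  have hint : ∀ p q : Fin N × Fin N, IntegrableOn (fun X : Config N =>
      (cellWave L m (X p.1) * conj (cellWave L m (X p.2))) *
        (cellWave L m (X q.1) * conj (cellWave L m (X q.2)))) (cellN N L) := by
    intro p q
    refine integrableOn_cellN_of_bounded L ((continuous_pairWave L m p.1 p.2).mul
      (continuous_pairWave L m q.1 q.2)) (M := 1) fun X => ?_
    rw [norm_mul, norm_pairWave, norm_pairWave, mul_one]
  rw [integral_finsetSum _ fun p _ => integrable_finsetSum _ fun q _ => hint p q]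
  simp_rw [integral_finsetSum _ fun q _ => hint _ q]
  have hinner : ∀ p ∈ (Finset.univ : Finset (Fin N)).offDiag,
      ∑ q ∈ (Finset.univ : Finset (Fin N)).offDiag,
        ∫ X in cellN N L, (cellWave L m (X p.1) * conj (cellWave L m (X p.2))) *
          (cellWave L m (X q.1) * conj (cellWave L m (X q.2))) = ((L : ℂ) ^ 3) ^ N := by
    intro p hp
    have hp' := (Finset.mem_offDiag.1 hp).2.2
    simp_rw [integral_cellN_pairWave_mul_pairWave hL hm hp']
    have hiff : ∀ q : Fin N × Fin N, (p.1 = q.2 ∧ q.1 = p.2) ↔ q = p.swap := by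
      rintro ⟨q1, q2⟩
      simp only [Prod.swap, Prod.mk.injEq]
      constructor
      · rintro ⟨h1, h2⟩; exact ⟨h2, h1.symm⟩
      · rintro ⟨h1, h2⟩; exact ⟨h2.symm, h1⟩
    simp_rw [hiff]
    rw [Finset.sum_ite_eq']
    rw [if_pos]
    rw [Finset.mem_offDiag]
    exact ⟨Finset.mem_univ _, Finset.mem_univ _, fun h => hp' h.symm⟩
  rw [Finset.sum_congr rfl hinner, Finset.sum_const, nsmul_eq_mul]

/-- `#offDiag(Fin N) = N(N-1)` as a real number. [folklore] -/
theorem card_offDiag_fin (N : ℕ) :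
    (((Finset.univ : Finset (Fin N)).offDiag.card : ℕ) : ℝ) = (N : ℝ) * ((N : ℝ) - 1) := by
  rw [Finset.offDiag_card, Finset.card_univ, Fintype.card_fin,
    Nat.cast_sub (Nat.le_mul_self N), Nat.cast_mul]
  ring

/-- `|ρ_m(X)|² = N + T_m(X)` with `ρ_m = planeWaveSum`. [folklore] -/
theorem normSq_planeWaveSum (L : ℝ) (m : Fin 3 → ℤ) (X : Config N) :
    ((‖planeWaveSum L m X‖ ^ 2 : ℝ) : ℂ) = (N : ℂ) + pairSum L m X := by
  rw [Complex.ofReal_pow, ← Complex.mul_conj', planeWaveSum, map_sum, Finset.sum_mul_sum, ← Finset.sum_product',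
    ← Finset.diag_union_offDiag, Finset.sum_union (Finset.disjoint_diag_offDiag _),
    Finset.sum_diag, pairSum]
  congr 1
  simp [Complex.mul_conj', norm_cellWave]


/-! ### Real form of the pair-correlation polynomial -/

/-- `t_m(X) = |ρ_m(X)|² - N`, the real form of `T_m` (`ρ_m = planeWaveSum`). [folklore] -/
def pairCorr (L : ℝ) (m : Fin 3 → ℤ) (X : Config N) : ℝ :=
  ‖planeWaveSum L m X‖ ^ 2 - N

/-- `t_m = T_m` (the pair sum is real). [folklore] -/
theorem ofReal_pairCorr (L : ℝ) (m : Fin 3 → ℤ) (X : Config N) :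
    ((pairCorr L m X : ℝ) : ℂ) = pairSum L m X := by
  rw [pairCorr, Complex.ofReal_sub, normSq_planeWaveSum]
  push_cast
  ring

/-- `t_m ≤ N² - N` (`|ρ_m| ≤ N`). [folklore] -/
theorem pairCorr_le (L : ℝ) (m : Fin 3 → ℤ) (X : Config N) :
    pairCorr L m X ≤ (N : ℝ) ^ 2 - N := by
  unfold pairCorr
  have h := norm_planeWaveSum_le L m X
  have h0 := norm_nonneg (planeWaveSum L m X)
  nlinarith

/-- `-N ≤ t_m`. [folklore] -/
theorem neg_le_pairCorr (L : ℝ) (m : Fin 3 → ℤ) (X : Config N) : -(N : ℝ) ≤ pairCorr L m X := by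
  unfold pairCorr
  nlinarith [sq_nonneg ‖planeWaveSum L m X‖]

/-- `t_m` is `C¹`. [folklore] -/
theorem contDiff_pairCorr (L : ℝ) (m : Fin 3 → ℤ) : ContDiff ℝ 1 (pairCorr (N := N) L m) :=
  (ContDiff.norm_sq (𝕜 := ℂ) (contDiff_planeWaveSum L m)).sub contDiff_const

/-- `t_m` is continuous. [folklore] -/
theorem continuous_pairCorr (L : ℝ) (m : Fin 3 → ℤ) : Continuous (pairCorr (N := N) L m) :=
  (contDiff_pairCorr L m).continuous

/-- `t_m` is `Lℤ³`-periodic in each particle. [folklore] -/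
theorem pairCorr_periodic (hL : L ≠ 0) (m : Fin 3 → ℤ) (X : Config N) (i : Fin N) (a : Fin 3) :
    pairCorr L m (X + Pi.single i (EuclideanSpace.single a L)) = pairCorr L m X := by
  unfold pairCorr
  rw [planeWaveSum_periodic hL]

/-- `t_m` is Bose-symmetric. [folklore] -/
theorem pairCorr_symm (L : ℝ) (m : Fin 3 → ℤ) (σ : Equiv.Perm (Fin N)) (X : Config N) :
    pairCorr L m (X ∘ σ) = pairCorr L m X := by
  unfold pairCorr
  rw [planeWaveSum_symm]

/-- Continuous real functions are integrable on the cell. [folklore] -/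
theorem integrableOn_cellN_real (L : ℝ) {f : Config N → ℝ} (hf : Continuous f) :
    IntegrableOn f (cellN N L) volume :=
  (hf.continuousOn.integrableOn_compact (isCompact_closedBoxN N L)).mono_set
    (cellN_subset_closedBoxN N L)

/-- `∫_{Λᴺ} t_m = 0`. [folklore] -/
theorem integral_cellN_pairCorr (hL : 0 < L) {m : Fin 3 → ℤ} (hm : m ≠ 0) :
    ∫ X in cellN N L, pairCorr L m X = 0 := by
  have h : ((∫ X in cellN N L, pairCorr L m X : ℝ) : ℂ) = 0 := by
    rw [← integral_complex_ofReal]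
    simp_rw [ofReal_pairCorr]
    exact integral_cellN_pairSum hL hm
  exact_mod_cast h

/-- `∫_{Λᴺ} t_m² = N(N-1) L^{3N}`. [folklore] -/
theorem integral_cellN_pairCorr_sq (hL : 0 < L) {m : Fin 3 → ℤ} (hm : m ≠ 0) :
    ∫ X in cellN N L, pairCorr L m X ^ 2 = (N : ℝ) * ((N : ℝ) - 1) * (L ^ 3) ^ N := by
  have h : ((∫ X in cellN N L, pairCorr L m X ^ 2 : ℝ) : ℂ) =
      (((N : ℝ) * ((N : ℝ) - 1) * (L ^ 3) ^ N : ℝ) : ℂ) := by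
    rw [← integral_complex_ofReal]
    push_cast
    simp_rw [ofReal_pairCorr]
    rw [integral_cellN_pairSum_sq hL hm]
    have hc : (((Finset.univ : Finset (Fin N)).offDiag.card : ℕ) : ℂ) =
        ((((Finset.univ : Finset (Fin N)).offDiag.card : ℕ) : ℝ) : ℂ) := by norm_cast
    rw [hc, card_offDiag_fin N]
    push_cast
    ring
  exact_mod_cast h

/-! ### The anti-correlated witness `Ψ ∝ √(1 - ε t_m)` -/

/-- The witness density `g(X) = 1 - ε t_m(X)`; for `0 ≤ ε`, `ε(N² - N) ≤ ½` it lies in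
`[½, 1 + εN]`. [folklore] -/
def witnessDensity (ε L : ℝ) (m : Fin 3 → ℤ) (X : Config N) : ℝ :=
  1 - ε * pairCorr L m X

/-- `½ ≤ g`. [folklore] -/
theorem half_le_witnessDensity {ε : ℝ} (hε : 0 ≤ ε) (hε' : ε * ((N : ℝ) ^ 2 - N) ≤ 1 / 2)
    (L : ℝ) (m : Fin 3 → ℤ) (X : Config N) : 1 / 2 ≤ witnessDensity ε L m X := by
  unfold witnessDensity
  have h1 : ε * pairCorr L m X ≤ ε * ((N : ℝ) ^ 2 - N) :=
    mul_le_mul_of_nonneg_left (pairCorr_le L m X) hε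
  linarith

/-- `0 < g`. [folklore] -/
theorem witnessDensity_pos {ε : ℝ} (hε : 0 ≤ ε) (hε' : ε * ((N : ℝ) ^ 2 - N) ≤ 1 / 2)
    (L : ℝ) (m : Fin 3 → ℤ) (X : Config N) : 0 < witnessDensity ε L m X :=
  lt_of_lt_of_le (by norm_num) (half_le_witnessDensity hε hε' L m X)

/-- `g` is continuous. [folklore] -/
theorem continuous_witnessDensity (ε L : ℝ) (m : Fin 3 → ℤ) :
    Continuous (witnessDensity (N := N) ε L m) :=
  continuous_const.sub (continuous_const.mul (continuous_pairCorr L m))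

/-- `g` is `C¹`. [folklore] -/
theorem contDiff_witnessDensity (ε L : ℝ) (m : Fin 3 → ℤ) :
    ContDiff ℝ 1 (witnessDensity (N := N) ε L m) :=
  contDiff_const.sub (contDiff_const.mul (contDiff_pairCorr L m))

/-- The (unnormalised) witness wave function `√g`, real and strictly positive. [folklore] -/
def witnessFun (ε L : ℝ) (m : Fin 3 → ℤ) (X : Config N) : ℂ :=
  ((Real.sqrt (witnessDensity ε L m X) : ℝ) : ℂ)

/-- `|√g| = √g`. [folklore] -/
theorem norm_witnessFun (ε L : ℝ) (m : Fin 3 → ℤ) (X : Config N) :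
    ‖witnessFun ε L m X‖ = Real.sqrt (witnessDensity ε L m X) := by
  rw [witnessFun, Complex.norm_real, Real.norm_of_nonneg (Real.sqrt_nonneg _)]

section Witness

variable {ε : ℝ} (hε : 0 ≤ ε) (hε' : ε * ((N : ℝ) ^ 2 - N) ≤ 1 / 2)
include hε hε'

/-- `|√g|² = g`. [folklore] -/
theorem norm_sq_witnessFun (L : ℝ) (m : Fin 3 → ℤ) (X : Config N) :
    ‖witnessFun ε L m X‖ ^ 2 = witnessDensity ε L m X := by
  rw [norm_witnessFun, Real.sq_sqrt (witnessDensity_pos hε hε' L m X).le]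

/-- `√g` is `C¹` (`g > 0`). [folklore] -/
theorem contDiff_witnessFun (L : ℝ) (m : Fin 3 → ℤ) :
    ContDiff ℝ 1 (witnessFun (N := N) ε L m) := by
  unfold witnessFun
  refine Complex.ofRealCLM.contDiff.comp ?_
  exact (contDiff_witnessDensity ε L m).sqrt fun X => (witnessDensity_pos hε hε' L m X).ne'

omit hε hε' in
/-- `√g` is periodic. [folklore] -/
theorem witnessFun_periodic (hL : L ≠ 0) (m : Fin 3 → ℤ) (X : Config N) (i : Fin N) (a : Fin 3) :
    witnessFun ε L m (X + Pi.single i (EuclideanSpace.single a L)) = witnessFun ε L m X := by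
  simp only [witnessFun, witnessDensity, pairCorr_periodic hL]

omit hε hε' in
/-- `√g` is Bose-symmetric. [folklore] -/
theorem witnessFun_symm (L : ℝ) (m : Fin 3 → ℤ) (σ : Equiv.Perm (Fin N)) (X : Config N) :
    witnessFun ε L m (X ∘ σ) = witnessFun ε L m X := by
  simp only [witnessFun, witnessDensity, pairCorr_symm]

/-- `√g ≠ 0`. [folklore] -/
theorem witnessFun_ne_zero (L : ℝ) (m : Fin 3 → ℤ) (X : Config N) : witnessFun ε L m X ≠ 0 := by
  rw [witnessFun, Complex.ofReal_ne_zero]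
  exact (Real.sqrt_pos.2 (witnessDensity_pos hε hε' L m X)).ne'

omit hε hε' in
/-- `√g` is real. [folklore] -/
theorem witnessFun_real (L : ℝ) (m : Fin 3 → ℤ) (X : Config N) :
    witnessFun ε L m X = (‖witnessFun ε L m X‖ : ℂ) := by
  rw [norm_witnessFun, witnessFun]

omit hε hε' in
/-- `(L³)ᴺ` is the real volume of the cell. [folklore] -/
theorem measureReal_cellN (hL : 0 < L) (N : ℕ) :
    (volume : Measure (Config N)).real (cellN N L) = (L ^ 3) ^ N := by
  rw [measureReal_def, volume_cellN, ENNReal.toReal_pow, ENNReal.toReal_pow,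
    ENNReal.toReal_ofReal hL.le]

/-- `∫_{Λᴺ} |√g|² = ∫ g = L^{3N}` (the correction `t_m` has zero mean). [folklore] -/
theorem lintegral_witnessFun (hL : 0 < L) {m : Fin 3 → ℤ} (hm : m ≠ 0) :
    ∫⁻ X in cellN N L, ((‖witnessFun ε L m X‖₊ : ℝ≥0∞)) ^ 2 = ENNReal.ofReal ((L ^ 3) ^ N) := by
  simp_rw [coe_nnnorm_sq_eq_ofReal, norm_sq_witnessFun hε hε']
  rw [← ofReal_integral_eq_lintegral_ofReal
    (integrableOn_cellN_real L (continuous_witnessDensity ε L m))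
    (Filter.Eventually.of_forall fun X => (witnessDensity_pos hε hε' L m X).le)]
  congr 1
  unfold witnessDensity
  have hi1 : IntegrableOn (fun _ : Config N => (1 : ℝ)) (cellN N L) volume :=
    integrableOn_const (by
      rw [volume_cellN]; exact ENNReal.pow_ne_top (ENNReal.pow_ne_top ENNReal.ofReal_ne_top))
  have hi2 : IntegrableOn (fun X : Config N => ε * pairCorr L m X) (cellN N L)
      volume := (integrableOn_cellN_real L (continuous_pairCorr L m)).const_mul _
  rw [integral_sub hi1 hi2, integral_const_mul, integral_cellN_pairCorr hL hm, mul_zero, sub_zero,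
    setIntegral_const, measureReal_cellN hL, smul_eq_mul, mul_one]

/-- **The witness state** `Ψ = √g / ‖√g‖` on the torus of side `L`: `C¹`, periodic, symmetric,
normalised, real and pointwise positive. [folklore] -/
def witnessState (hL : 0 < L) {m : Fin 3 → ℤ} (hm : m ≠ 0) : PeriodicTrialState N L :=
  PeriodicTrialState.ofFun (witnessFun ε L m) (contDiff_witnessFun hε hε' L m)
    (witnessFun_periodic hL.ne' m) (witnessFun_symm L m)
    (by rw [lintegral_witnessFun hε hε' hL hm]; exact (ENNReal.ofReal_pos.2 (by positivity)).ne')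
    (by rw [lintegral_witnessFun hε hε' hL hm]; exact ENNReal.ofReal_ne_top)

/-- The witness state is `(L³)^{-N/2} √g`. [folklore] -/
theorem witnessState_apply (hL : 0 < L) {m : Fin 3 → ℤ} (hm : m ≠ 0) (X : Config N) :
    (witnessState hε hε' hL hm).ψ X = ((Real.sqrt ((L ^ 3) ^ N))⁻¹ : ℂ) * witnessFun ε L m X := by
  rw [witnessState, PeriodicTrialState.ofFun_apply, lintegral_witnessFun hε hε' hL hm,
    ENNReal.toReal_ofReal (by positivity)]

/-- `|Ψ|² = (L³)^{-N} g`. [folklore] -/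
theorem norm_sq_witnessState (hL : 0 < L) {m : Fin 3 → ℤ} (hm : m ≠ 0) (X : Config N) :
    ‖(witnessState hε hε' hL hm).ψ X‖ ^ 2 = ((L ^ 3) ^ N)⁻¹ * witnessDensity ε L m X := by
  rw [witnessState_apply, norm_mul, mul_pow, norm_sq_witnessFun hε hε', norm_inv, Complex.norm_real,
    Real.norm_of_nonneg (Real.sqrt_nonneg _), inv_pow, Real.sq_sqrt (by positivity)]

/-- The witness state is real (`Ψ = |Ψ|`). [folklore] -/
theorem witnessState_real (hL : 0 < L) {m : Fin 3 → ℤ} (hm : m ≠ 0) (X : Config N) :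
    (witnessState hε hε' hL hm).ψ X = (‖(witnessState hε hε' hL hm).ψ X‖ : ℂ) := by
  rw [witnessState_apply, norm_mul, norm_inv, Complex.norm_real,
    Real.norm_of_nonneg (Real.sqrt_nonneg _), Complex.ofReal_mul, Complex.ofReal_inv,
    ← witnessFun_real]

/-- The witness state is pointwise non-zero. [folklore] -/
theorem witnessState_ne_zero (hL : 0 < L) {m : Fin 3 → ℤ} (hm : m ≠ 0) (X : Config N) :
    (witnessState hε hε' hL hm).ψ X ≠ 0 := by
  rw [witnessState_apply]
  refine mul_ne_zero ?_ (witnessFun_ne_zero hε hε' L m X)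
  rw [Ne, inv_eq_zero, Complex.ofReal_eq_zero]
  exact (Real.sqrt_pos.2 (by positivity)).ne'

/-- **The structure factor of the witness**: `S_m(Ψ) = 1 - ε(N-1)`. [folklore] -/
theorem structureFactor_witnessState (hL : 0 < L) (hN : 0 < N) {m : Fin 3 → ℤ} (hm : m ≠ 0) :
    (N : ℝ)⁻¹ * ∫ X in cellN N L,
        ‖∑ j : Fin N, cellWave L m (X j)‖ ^ 2 * ‖(witnessState hε hε' hL hm).ψ X‖ ^ 2 =
      1 - ε * ((N : ℝ) - 1) := by
  have hN' : (0 : ℝ) < N := by exact_mod_cast hN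
  have hV : (0 : ℝ) < (L ^ 3) ^ N := by positivity
  have hfun : (fun X : Config N =>
      ‖∑ j : Fin N, cellWave L m (X j)‖ ^ 2 * ‖(witnessState hε hε' hL hm).ψ X‖ ^ 2) =
      fun X => ((L ^ 3) ^ N)⁻¹ * ((N : ℝ) + (1 - ε * N) * pairCorr L m X - ε * pairCorr L m X ^ 2) := by
    funext X
    rw [norm_sq_witnessState hε hε']
    have : ‖∑ j : Fin N, cellWave L m (X j)‖ ^ 2 = pairCorr L m X + N := by
      rw [pairCorr, planeWaveSum]; ring
    rw [this, witnessDensity]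
    ring
  rw [hfun, integral_const_mul]
  have hi1 : IntegrableOn (fun _ : Config N => (N : ℝ)) (cellN N L) volume :=
    integrableOn_const (by
      rw [volume_cellN]; exact ENNReal.pow_ne_top (ENNReal.pow_ne_top ENNReal.ofReal_ne_top))
  have hi2 : IntegrableOn (fun X : Config N => (1 - ε * N) * pairCorr L m X) (cellN N L) volume :=
    (integrableOn_cellN_real L (continuous_pairCorr L m)).const_mul _
  have hi3 : IntegrableOn (fun X : Config N => ε * pairCorr L m X ^ 2) (cellN N L) volume :=
    (integrableOn_cellN_real L ((continuous_pairCorr L m).pow 2)).const_mul _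
  have hi12 : IntegrableOn (fun X : Config N => (N : ℝ) + (1 - ε * N) * pairCorr L m X) (cellN N L)
      volume := hi1.add hi2
  rw [integral_sub hi12 hi3, integral_add hi1 hi2, integral_const_mul, integral_const_mul,
    integral_cellN_pairCorr hL hm, integral_cellN_pairCorr_sq hL hm, setIntegral_const,
    measureReal_cellN hL, smul_eq_mul]
  field_simp
  ring

end Witness

/-! ### The kinetic energy of the witness: `E(Ψ_ε) ≤ 2 ε² N³ |k|²` -/

section Energy

variable {ε : ℝ} (hε : 0 ≤ ε) (hε' : ε * ((N : ℝ) ^ 2 - N) ≤ 1 / 2)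
include hε hε'

omit hε hε' in
/-- Derivative of the witness density: `Dg = -ε · 2⟪ρ_m, Dρ_m⟫_ℝ`. [folklore] -/
theorem hasFDerivAt_witnessDensity (L : ℝ) (m : Fin 3 → ℤ) (X : Config N) :
    HasFDerivAt (witnessDensity (N := N) ε L m)
      (-(ε • (2 • ((innerSL ℝ (planeWaveSum (M := N) L m X)).comp
        (fderiv ℝ (planeWaveSum (M := N) L m) X))))) X := by
  have hρ : HasFDerivAt (planeWaveSum (M := N) L m) (fderiv ℝ (planeWaveSum (M := N) L m) X) X :=
    (((contDiff_planeWaveSum L m).differentiable (by simp)) X).hasFDerivAt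
  exact ((hρ.norm_sq.sub_const (N : ℝ)).const_mul ε).const_sub 1

omit hε hε' in
/-- `|∂_{i,a} ρ_m| = |2π mₐ / L|`. [folklore] -/
theorem norm_fderiv_planeWaveSum_single (L : ℝ) (m : Fin 3 → ℤ) (X : Config N) (i : Fin N)
    (a : Fin 3) :
    ‖fderiv ℝ (planeWaveSum (M := N) L m) X (Pi.single i (EuclideanSpace.single a 1))‖ =
      |2 * Real.pi * (m a) / L| := by
  rw [fderiv_planeWaveSum_apply_single, norm_mul, norm_cellWave, mul_one,
    show (2 * Real.pi * Complex.I * (m a) / L : ℂ) = ((2 * Real.pi * (m a) / L : ℝ) : ℂ) * Complex.I by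
      push_cast; ring, norm_mul, Complex.norm_I, mul_one, Complex.norm_real, Real.norm_eq_abs]

/-- **Pointwise bound on the partial derivatives of the witness state**:
`|∂_{i,a} Ψ_ε|² ≤ 2 (L³)^{-N} ε² N² (2π mₐ/L)²` (from `∂Ψ = c ∂g/(2√g)`, `|∂g| ≤ 2εN|∂ρ|`,
`g ≥ ½`). [folklore] -/
theorem norm_fderiv_witnessState_single_sq_le (hL : 0 < L) {m : Fin 3 → ℤ} (hm : m ≠ 0)
    (X : Config N) (i : Fin N) (a : Fin 3) :
    ‖fderiv ℝ (witnessState hε hε' hL hm).ψ X (Pi.single i (EuclideanSpace.single a 1))‖ ^ 2 ≤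
      2 * ((L ^ 3) ^ N)⁻¹ * ε ^ 2 * (N : ℝ) ^ 2 * (2 * Real.pi * (m a) / L) ^ 2 := by
  set c : ℂ := ((Real.sqrt ((L ^ 3) ^ N))⁻¹ : ℂ) with hc
  set g := witnessDensity (N := N) ε L m with hg
  set ρf := planeWaveSum (M := N) L m with hρf
  set g' : Config N →L[ℝ] ℝ := -(ε • (2 • ((innerSL ℝ (ρf X)).comp (fderiv ℝ ρf X))))
    with hg'
  have hgX : 0 < g X := witnessDensity_pos hε hε' L m X
  have hD : HasFDerivAt g g' X := hasFDerivAt_witnessDensity L m X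
  have hS : HasFDerivAt (fun Y => Real.sqrt (g Y)) ((1 / (2 * Real.sqrt (g X))) • g') X :=
    hD.sqrt hgX.ne'
  have hF : HasFDerivAt (fun Y => ((Real.sqrt (g Y) : ℝ) : ℂ))
      (Complex.ofRealCLM.comp ((1 / (2 * Real.sqrt (g X))) • g')) X :=
    Complex.ofRealCLM.hasFDerivAt.comp X hS
  have hfun : (witnessState hε hε' hL hm).ψ = fun Y => c * ((Real.sqrt (g Y) : ℝ) : ℂ) :=
    funext fun Y => witnessState_apply hε hε' hL hm Y
  have hΨ := hF.const_mul c
  rw [hfun, hΨ.fderiv]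
  -- evaluate on the coordinate vector
  set v : Config N := Pi.single i (EuclideanSpace.single a 1) with hv
  have happ : (c • Complex.ofRealCLM.comp ((1 / (2 * Real.sqrt (g X))) • g')) v =
      c * (((1 / (2 * Real.sqrt (g X))) * g' v : ℝ) : ℂ) := by
    simp [smul_eq_mul]
  rw [happ, norm_mul, Complex.norm_real, Real.norm_eq_abs, abs_mul,
    abs_of_pos (by positivity : 0 < 1 / (2 * Real.sqrt (g X)))]
  -- |g' v| ≤ 2 ε N |∂ρ|
  have hg'v : |g' v| ≤ 2 * ε * N * |2 * Real.pi * (m a) / L| := by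
    have h1 : g' v = -(ε * (2 * inner ℝ (ρf X) (fderiv ℝ ρf X v))) := by
      simp only [hg', neg_apply, smul_apply,
        ContinuousLinearMap.comp_apply, innerSL_apply_apply, smul_eq_mul, nsmul_eq_mul,
        Nat.cast_ofNat]
    rw [h1, abs_neg, abs_mul, abs_of_nonneg hε, abs_mul, abs_of_pos (by norm_num : (0:ℝ) < 2)]
    have h2 := abs_real_inner_le_norm (ρf X) (fderiv ℝ ρf X v)
    rw [norm_fderiv_planeWaveSum_single] at h2
    have h3 : ‖ρf X‖ ≤ N := norm_planeWaveSum_le L m X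
    calc ε * (2 * |inner ℝ (ρf X) (fderiv ℝ ρf X v)|)
        ≤ ε * (2 * (‖ρf X‖ * |2 * Real.pi * (m a) / L|)) := by gcongr
      _ ≤ ε * (2 * (N * |2 * Real.pi * (m a) / L|)) := by gcongr
      _ = 2 * ε * N * |2 * Real.pi * (m a) / L| := by ring
  -- assemble: (‖c‖ · (1/(2√g)) · |g'v|)² ≤ ‖c‖² · (1/(4g)) · 4ε²N²(∂ρ)² ≤ 2‖c‖²ε²N²(∂ρ)²
  have hcn : ‖c‖ ^ 2 = ((L ^ 3) ^ N)⁻¹ := by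
    rw [hc, norm_inv, Complex.norm_real, Real.norm_of_nonneg (Real.sqrt_nonneg _), inv_pow,
      Real.sq_sqrt (by positivity)]
  have hhalf : 1 / 2 ≤ g X := half_le_witnessDensity hε hε' L m X
  have hsq : (1 / (2 * Real.sqrt (g X))) ^ 2 = 1 / (4 * g X) := by
    rw [div_pow, mul_pow, Real.sq_sqrt hgX.le]; norm_num
  have hb : 0 ≤ |g' v| := abs_nonneg _
  calc (‖c‖ * (1 / (2 * Real.sqrt (g X)) * |g' v|)) ^ 2
      = ‖c‖ ^ 2 * (1 / (4 * g X)) * |g' v| ^ 2 := by rw [mul_pow, mul_pow, hsq]; ring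
    _ ≤ ‖c‖ ^ 2 * (1 / (4 * g X)) * (2 * ε * N * |2 * Real.pi * (m a) / L|) ^ 2 := by
        gcongr
    _ ≤ ‖c‖ ^ 2 * (1 / 2) * (2 * ε * N * |2 * Real.pi * (m a) / L|) ^ 2 := by
        gcongr ‖c‖ ^ 2 * ?_ * _
        rw [div_le_iff₀ (by positivity)]
        linarith
    _ = 2 * ((L ^ 3) ^ N)⁻¹ * ε ^ 2 * (N : ℝ) ^ 2 * (2 * Real.pi * (m a) / L) ^ 2 := by
        rw [hcn, mul_pow, mul_pow, mul_pow, sq_abs]; ring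

omit hε hε' in
/-- `∑ₐ (2π mₐ/L)² = |k|²` with `kn m = ‖(2π/L) • latticeVec 1 m‖`. [folklore] -/
theorem sum_sq_eq_norm_sq (L : ℝ) (m : Fin 3 → ℤ) :
    ∑ a : Fin 3, (2 * Real.pi * (m a) / L) ^ 2 = ‖((2 * Real.pi / L) • latticeVec 1 m)‖ ^ 2 := by
  rw [EuclideanSpace.real_norm_sq_eq]
  refine Finset.sum_congr rfl fun a _ => ?_
  simp only [latticeVec, PiLp.smul_apply, smul_eq_mul, one_mul]
  ring

/-- **Kinetic energy of the witness**: `periodicEnergy 0 Ψ_ε ≤ 2 ε² N³ |k|²` (the interaction is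
absent for `v ≡ 0`; pointwise `|∇Ψ_ε|² ≤ 2(L³)^{-N}ε²N³|k|²`, cell volume `(L³)ᴺ`). [folklore] -/
theorem periodicEnergy_witnessState_le (hL : 0 < L) {m : Fin 3 → ℤ} (hm : m ≠ 0) :
    periodicEnergy (0 : ℝ → ℝ≥0∞) (witnessState hε hε' hL hm) ≤
      ENNReal.ofReal (2 * ε ^ 2 * (N : ℝ) ^ 3 * ‖((2 * Real.pi / L) • latticeVec 1 m)‖ ^ 2) := by
  set B : ℝ := 2 * ((L ^ 3) ^ N)⁻¹ * ε ^ 2 * (N : ℝ) ^ 3 * ‖((2 * Real.pi / L) • latticeVec 1 m)‖ ^ 2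
    with hB
  have hpt : ∀ X : Config N, kineticDensity (witnessState hε hε' hL hm).ψ X ≤ ENNReal.ofReal B := by
    intro X
    unfold kineticDensity
    calc ∑ i : Fin N, ∑ a : Fin 3, ((‖fderiv ℝ (witnessState hε hε' hL hm).ψ X
          (Pi.single i (EuclideanSpace.single a 1))‖₊ : ℝ≥0∞)) ^ 2
        ≤ ∑ _i : Fin N, ∑ a : Fin 3, ENNReal.ofReal
            (2 * ((L ^ 3) ^ N)⁻¹ * ε ^ 2 * (N : ℝ) ^ 2 * (2 * Real.pi * (m a) / L) ^ 2) := by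
          gcongr with i _ a _
          rw [coe_nnnorm_sq_eq_ofReal]
          exact ENNReal.ofReal_le_ofReal
            (norm_fderiv_witnessState_single_sq_le hε hε' hL hm X i a)
      _ = ENNReal.ofReal B := by
          rw [← ENNReal.ofReal_sum_of_nonneg (fun a _ => by positivity), ← Finset.mul_sum,
            sum_sq_eq_norm_sq, Finset.sum_const, Finset.card_univ, Fintype.card_fin,
            nsmul_eq_mul, ← ENNReal.ofReal_natCast, ← ENNReal.ofReal_mul (Nat.cast_nonneg _), hB]
          congr 1
          ring
  calc periodicEnergy (0 : ℝ → ℝ≥0∞) (witnessState hε hε' hL hm)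
      = ∫⁻ X in cellN N L, kineticDensity (witnessState hε hε' hL hm).ψ X := by
        rw [periodicEnergy]
        refine lintegral_congr fun X => ?_
        rw [periodicInteraction_zeroPotential, zero_mul, add_zero]
    _ ≤ ∫⁻ _ in cellN N L, ENNReal.ofReal B := lintegral_mono fun X => hpt X
    _ = ENNReal.ofReal B * ((ENNReal.ofReal L ^ 3) ^ N) := by rw [setLIntegral_const, volume_cellN]
    _ = ENNReal.ofReal (2 * ε ^ 2 * (N : ℝ) ^ 3 * ‖((2 * Real.pi / L) • latticeVec 1 m)‖ ^ 2) := by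
        rw [← ENNReal.ofReal_pow hL.le, ← ENNReal.ofReal_pow (by positivity),
          ← ENNReal.ofReal_mul (by positivity), hB]
        congr 1
        have hV : (0 : ℝ) < (L ^ 3) ^ N := by positivity
        field_simp

end Energy

/-! ### Dropping minimality: the statement and its refutation -/

/-- `PuffFloor` with the hypothesis `periodicEnergy v Ψ = periodicGroundStateEnergy v (n+1) L`
DROPPED (everything else verbatim): the floor claimed for every finite-energy, real, pointwise
positive periodic trial state. -/
def PuffFloorWithoutMinimality : Prop :=
  ∀ v : ℝ → ENNReal, IsRepulsiveFiniteRange v → (∀ r, v r ≠ ⊤) →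
    ContDiff ℝ 2 (fun x : Space => (v ‖x‖).toReal) →
    (∃ Cₑ : ℝ, ∀ x : Space, ‖iteratedFDeriv ℝ 2 (fun x : Space => (v ‖x‖).toReal) x‖ ≤
      Cₑ * Real.sqrt ((v ‖x‖).toReal)) →
    ∃ C : ℝ, 0 ≤ C ∧ ∃ ρ₀ : ℝ, 0 < ρ₀ ∧ ∀ ρ : ℝ, 0 < ρ → ρ < ρ₀ →
      ∀ᶠ n : ℕ in Filter.atTop, ∀ Ψ : PeriodicTrialState (n + 1) (sideLength ρ (n + 1)),
        (let L : ℝ := sideLength ρ (n + 1)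
         let S : (Fin 3 → ℤ) → ℝ := fun m => ((n : ℝ) + 1)⁻¹ *
           ∫ X in cellN (n + 1) L, ‖∑ j : Fin (n + 1), cellWave L m (X j)‖ ^ 2 * ‖Ψ.ψ X‖ ^ 2
         let kn : (Fin 3 → ℤ) → ℝ := fun m => ‖((2 * Real.pi / L) • latticeVec 1 m)‖
         periodicEnergy v Ψ ≠ ⊤ → (∀ X, Ψ.ψ X = (‖Ψ.ψ X‖ : ℂ)) → (∀ X, Ψ.ψ X ≠ 0) →
           ∀ m : Fin 3 → ℤ, m ≠ 0 → kn m / Real.sqrt (kn m ^ 2 + C * ρ) ≤ S m)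

/-- Dropping the minimality hypothesis STRENGTHENS the crux. [folklore] -/
theorem puffFloor_of_withoutMinimality (h : PuffFloorWithoutMinimality) :
    Summit.AtomisticToContinuum.BoseEinsteinCondensation.Theses.BECConjugateDomination.PuffFloor := by
  intro v h1 h2 h3 h4
  obtain ⟨C, hC, ρ₀, hρ₀, h⟩ := h v h1 h2 h3 h4
  refine ⟨C, hC, ρ₀, hρ₀, fun ρ hρ hρ' => ?_⟩
  filter_upwards [h ρ hρ hρ'] with n hn Ψ
  intro L S kn _ hE hre hne m hm
  exact hn Ψ hE hre hne m hm

/-- The free gas `v ≡ 0` belongs to the smooth class. [folklore] -/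
theorem smoothClass_zero :
    IsRepulsiveFiniteRange (0 : ℝ → ℝ≥0∞) ∧ (∀ r, (0 : ℝ → ℝ≥0∞) r ≠ ⊤) ∧
      ContDiff ℝ 2 (fun x : Space => ((0 : ℝ → ℝ≥0∞) ‖x‖).toReal) ∧
      (∃ Cₑ : ℝ, ∀ x : Space,
        ‖iteratedFDeriv ℝ 2 (fun x : Space => ((0 : ℝ → ℝ≥0∞) ‖x‖).toReal) x‖ ≤
          Cₑ * Real.sqrt (((0 : ℝ → ℝ≥0∞) ‖x‖).toReal)) := by
  have hf : (fun x : Space => ((0 : ℝ → ℝ≥0∞) ‖x‖).toReal) = fun _ => (0 : ℝ) := by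
    funext x; simp
  refine ⟨⟨measurable_const, 0, fun r _ => rfl⟩, fun r => ENNReal.zero_ne_top, ?_, ⟨0, fun x => ?_⟩⟩
  · rw [hf]; exact contDiff_const
  · rw [hf, iteratedFDeriv_fun_zero]; simp

/-- Every periodic trial state of the free gas has finite energy. [folklore] -/
theorem periodicEnergy_zero_ne_top (Ψ : PeriodicTrialState N L) :
    periodicEnergy (0 : ℝ → ℝ≥0∞) Ψ ≠ ⊤ := by
  have hW : ∫⁻ X in cellN N L, periodicInteraction (0 : ℝ → ℝ≥0∞) L X ≠ ⊤ := by
    simp_rw [periodicInteraction_zeroPotential]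
    simp
  exact (lintegral_energy_lt_top measurable_const hW Ψ.contDiff).ne

/-- `|c · (M e₀)| = c M` for the lattice vector `(M, 0, 0)`. [folklore] -/
theorem norm_smul_latticeVec_single {c : ℝ} (hc : 0 ≤ c) (M : ℕ) :
    ‖c • latticeVec 1 (Pi.single (0 : Fin 3) (M : ℤ))‖ = c * M := by
  rw [norm_smul, Real.norm_of_nonneg hc]
  congr 1
  rw [EuclideanSpace.norm_eq, Fin.sum_univ_three]
  simp [latticeVec, Pi.single_apply]

/-- The admissible amplitude `ε = 1/(2N²)`: `ε(N² - N) ≤ ½`. [folklore] -/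
theorem eps_admissible (N : ℕ) : (2 * (N : ℝ) ^ 2)⁻¹ * ((N : ℝ) ^ 2 - N) ≤ 1 / 2 := by
  rcases Nat.eq_zero_or_pos N with rfl | hN
  · simp
  · have hN' : (0 : ℝ) < N := by exact_mod_cast hN
    rw [inv_mul_le_iff₀ (by positivity)]
    nlinarith

/-- `S_m` of the witness with `ε = 1/(2N²)` in the syntactic form of the crux (`N = n + 1`):
`S_m = 1 - n / (2(n+1)²)`. [folklore] -/
theorem structureFactor_witnessState_succ (hL : 0 < L) (n : ℕ) {m : Fin 3 → ℤ} (hm : m ≠ 0) :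
    ((n : ℝ) + 1)⁻¹ * ∫ X in cellN (n + 1) L,
        ‖∑ j : Fin (n + 1), cellWave L m (X j)‖ ^ 2 *
          ‖(witnessState (N := n + 1) (ε := (2 * ((n : ℝ) + 1) ^ 2)⁻¹) (by positivity)
            (by exact_mod_cast eps_admissible (n + 1)) hL hm).ψ X‖ ^ 2 =
      1 - (n : ℝ) / (2 * ((n : ℝ) + 1) ^ 2) := by
  have h := structureFactor_witnessState (N := n + 1) (ε := (2 * ((n : ℝ) + 1) ^ 2)⁻¹)
    (by positivity) (by exact_mod_cast eps_admissible (n + 1)) hL (Nat.succ_pos n) hm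
  push_cast at h
  rw [add_sub_cancel_right] at h
  rw [h]
  ring

/-- **Minimality is load-bearing.** `PuffFloor` with the minimiser hypothesis dropped is FALSE:
for the free gas `v ≡ 0` (in the smooth class) and every `N ≥ 2`, the real, positive, finite-energy
state `Ψ_N ∝ √(1 - (|ρ_m|² - N)/(2N²))` has `S_m = 1 - (N-1)/(2N²)`, while the floor at a mode
`m = (M, 0, 0)` with `M` large is `> 1 - (N-1)/(2N²)` — for every `C ≥ 0` and every density. -/
theorem puffFloor_false_without_minimality : ¬ PuffFloorWithoutMinimality := by
  intro h
  obtain ⟨h1, h2, h3, h4⟩ := smoothClass_zero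
  obtain ⟨C, hC, ρ₀, hρ₀, h⟩ := h 0 h1 h2 h3 h4
  set ρ : ℝ := ρ₀ / 2 with hρdef
  have hρ : 0 < ρ := by positivity
  have hev := h ρ hρ (by rw [hρdef]; linarith)
  rw [Filter.eventually_atTop] at hev
  obtain ⟨n₀, hn₀⟩ := hev
  set n : ℕ := max n₀ 1 with hndef
  have h1n : 1 ≤ n := le_max_right _ _
  have key := hn₀ n (le_max_left _ _)
  set L : ℝ := sideLength ρ (n + 1) with hLdef
  have hL : 0 < L := Real.rpow_pos_of_pos (by positivity) _
  -- the deficit of the witness and the mode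
  set δ : ℝ := (n : ℝ) / (2 * ((n : ℝ) + 1) ^ 2) with hδdef
  have hn' : (1 : ℝ) ≤ n := by exact_mod_cast h1n
  have hδ0 : 0 < δ := by positivity
  have hδ1 : δ < 1 := by
    rw [hδdef, div_lt_one (by positivity)]
    nlinarith
  have hcL : 0 < 2 * Real.pi / L := by positivity
  obtain ⟨M, hM⟩ := exists_nat_gt (C * ρ / ((2 * Real.pi / L) ^ 2 * δ))
  set m : Fin 3 → ℤ := Pi.single (0 : Fin 3) ((M + 1 : ℕ) : ℤ) with hmdef
  have hm : m ≠ 0 := by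
    intro h0
    have := congr_fun h0 0
    rw [hmdef, Pi.single_eq_same, Pi.zero_apply] at this
    exact absurd this (by exact_mod_cast Nat.succ_ne_zero M)
  have hkn : ‖((2 * Real.pi / L) • latticeVec 1 m)‖ = (2 * Real.pi / L) * (M + 1 : ℕ) :=
    norm_smul_latticeVec_single hcL.le (M + 1)
  set k : ℝ := (2 * Real.pi / L) * (M + 1 : ℕ) with hkdef
  have hk : 0 < k := by positivity
  -- `C ρ < k² δ`
  have hCρ : C * ρ < k ^ 2 * δ := by
    have hq : C * ρ / ((2 * Real.pi / L) ^ 2 * δ) < (M + 1 : ℕ) :=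
      hM.trans (by exact_mod_cast Nat.lt_succ_self M)
    rw [div_lt_iff₀ (by positivity)] at hq
    have hM1 : (1 : ℝ) ≤ (M + 1 : ℕ) := by exact_mod_cast Nat.succ_le_succ (Nat.zero_le M)
    calc C * ρ < (M + 1 : ℕ) * ((2 * Real.pi / L) ^ 2 * δ) := hq
      _ ≤ (M + 1 : ℕ) * ((2 * Real.pi / L) ^ 2 * δ) * (M + 1 : ℕ) :=
          le_mul_of_one_le_right (by positivity) hM1
      _ = k ^ 2 * δ := by rw [hkdef]; ring
  -- evaluate the crux inequality on the witness
  have hεa : (2 * ((n : ℝ) + 1) ^ 2)⁻¹ * ((((n + 1 : ℕ) : ℝ)) ^ 2 - ((n + 1 : ℕ) : ℝ)) ≤ 1 / 2 := by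
    have h := eps_admissible (n + 1)
    push_cast at h ⊢
    exact h
  have hε0 : (0 : ℝ) ≤ (2 * ((n : ℝ) + 1) ^ 2)⁻¹ := by positivity
  have hw := key (witnessState hε0 hεa hL hm) (periodicEnergy_zero_ne_top _)
    (witnessState_real hε0 hεa hL hm) (witnessState_ne_zero hε0 hεa hL hm) m hm
  dsimp only at hw
  rw [structureFactor_witnessState_succ hL n hm, hkn, ← hδdef] at hw
  -- `k/√(k² + Cρ) ≤ 1 - δ` contradicts `Cρ < k²δ`
  clear_value k δ
  have hsq : 0 < Real.sqrt (k ^ 2 + C * ρ) := Real.sqrt_pos.2 (by positivity)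
  rw [div_le_iff₀ hsq] at hw
  have h3 : k ^ 2 ≤ ((1 - δ) * Real.sqrt (k ^ 2 + C * ρ)) ^ 2 :=
    pow_le_pow_left₀ hk.le hw 2
  rw [mul_pow, Real.sq_sqrt (by positivity)] at h3
  have h4 : k ^ 2 * δ * (2 - δ) ≤ C * ρ := by nlinarith
  have h5 : 0 < k ^ 2 * δ * (1 - δ) := mul_pos (mul_pos (pow_pos hk 2) hδ0) (by linarith)
  nlinarith [h4, h5, hCρ]


/-! ### Decoration: the guard `m ≠ 0` is unnecessary -/

/-- `PuffFloor` with the guard `m ≠ 0` REMOVED (the floor claimed at every lattice mode,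
including `m = 0` where `kn 0 = 0`). -/
def PuffFloorAllModes : Prop :=
  ∀ v : ℝ → ENNReal, IsRepulsiveFiniteRange v → (∀ r, v r ≠ ⊤) →
    ContDiff ℝ 2 (fun x : Space => (v ‖x‖).toReal) →
    (∃ Cₑ : ℝ, ∀ x : Space, ‖iteratedFDeriv ℝ 2 (fun x : Space => (v ‖x‖).toReal) x‖ ≤
      Cₑ * Real.sqrt ((v ‖x‖).toReal)) →
    ∃ C : ℝ, 0 ≤ C ∧ ∃ ρ₀ : ℝ, 0 < ρ₀ ∧ ∀ ρ : ℝ, 0 < ρ → ρ < ρ₀ →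
      ∀ᶠ n : ℕ in Filter.atTop, ∀ Ψ : PeriodicTrialState (n + 1) (sideLength ρ (n + 1)),
        (let L : ℝ := sideLength ρ (n + 1)
         let S : (Fin 3 → ℤ) → ℝ := fun m => ((n : ℝ) + 1)⁻¹ *
           ∫ X in cellN (n + 1) L, ‖∑ j : Fin (n + 1), cellWave L m (X j)‖ ^ 2 * ‖Ψ.ψ X‖ ^ 2
         let kn : (Fin 3 → ℤ) → ℝ := fun m => ‖((2 * Real.pi / L) • latticeVec 1 m)‖
         periodicEnergy v Ψ = periodicGroundStateEnergy v (n + 1) L → periodicEnergy v Ψ ≠ ⊤ →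
           (∀ X, Ψ.ψ X = (‖Ψ.ψ X‖ : ℂ)) → (∀ X, Ψ.ψ X ≠ 0) →
           ∀ m : Fin 3 → ℤ, kn m / Real.sqrt (kn m ^ 2 + C * ρ) ≤ S m)

/-- **`m ≠ 0` is decoration**: at `m = 0` the floor reads `0 ≤ S 0`, which always holds
(`kn 0 = 0`, `S 0 ≥ 0`), so removing the guard gives an EQUIVALENT statement. A prover may
ignore the guard; a planner may drop it. [folklore] -/
theorem puffFloorAllModes_iff :
    PuffFloorAllModes ↔
      Summit.AtomisticToContinuum.BoseEinsteinCondensation.Theses.BECConjugateDomination.PuffFloor := by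
  constructor
  · intro h v h1 h2 h3 h4
    obtain ⟨C, hC, ρ₀, hρ₀, h⟩ := h v h1 h2 h3 h4
    refine ⟨C, hC, ρ₀, hρ₀, fun ρ hρ hρ' => ?_⟩
    filter_upwards [h ρ hρ hρ'] with n hn Ψ
    intro L S kn hE hfin hre hne m _
    exact hn Ψ hE hfin hre hne m
  · intro h v h1 h2 h3 h4
    obtain ⟨C, hC, ρ₀, hρ₀, h⟩ := h v h1 h2 h3 h4
    refine ⟨C, hC, ρ₀, hρ₀, fun ρ hρ hρ' => ?_⟩
    filter_upwards [h ρ hρ hρ'] with n hn Ψ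
    intro L S kn hE hfin hre hne m
    by_cases hm : m = 0
    · subst hm
      simp only [kn, S]
      rw [latticeVec_zero, smul_zero, norm_zero, zero_div]
      exact mul_nonneg (by positivity) (integral_nonneg fun X => by positivity)
    · exact hn Ψ hE hfin hre hne m hm

/-! ### Tightness: the free gas saturates the floor with `C = 0` at every mode -/

/-- `latticeVec 1 m ≠ 0` for `m ≠ 0`, hence `kn m > 0`. [folklore] -/
theorem norm_latticeVec_one_pos {m : Fin 3 → ℤ} (hm : m ≠ 0) : 0 < ‖latticeVec 1 m‖ := by
  rw [norm_pos_iff]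
  intro h
  apply hm
  funext k
  simpa [latticeVec] using congr_arg (fun x : Space => x k) h

/-- The constant state is the witness with `ε = 0`; it is a minimiser of the free gas
(`periodicEnergy 0 = 0 = E₀^per`). [folklore] -/
theorem periodicEnergy_witnessState_zero (hL : 0 < L) {m : Fin 3 → ℤ} (hm : m ≠ 0) :
    periodicEnergy (0 : ℝ → ℝ≥0∞) (witnessState (N := N) (ε := 0) le_rfl (by simp) hL hm) =
      periodicGroundStateEnergy (0 : ℝ → ℝ≥0∞) N L := by
  have hconst : (witnessState (N := N) (ε := (0 : ℝ)) le_rfl (by simp) hL hm).ψ =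
      fun _ => ((Real.sqrt ((L ^ 3) ^ N))⁻¹ : ℂ) := by
    funext X
    rw [witnessState_apply, witnessFun, witnessDensity, zero_mul, sub_zero, Real.sqrt_one,
      Complex.ofReal_one, mul_one]
  generalize witnessState (N := N) (ε := (0 : ℝ)) le_rfl (by simp) hL hm = Ψ at hconst ⊢
  rw [periodicGroundStateEnergy_zero_eq_zero N hL, periodicEnergy]
  refine (lintegral_congr fun X => ?_).trans lintegral_zero
  rw [periodicInteraction_zeroPotential, zero_mul, add_zero]
  simp [kineticDensity, hconst]

/-- **Tightness at the free gas.** For `v ≡ 0` and the constant minimiser the crux's inequality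
holds with EQUALITY at `C = 0` and every mode `m ≠ 0`: `kn m / √(kn m² + 0·ρ) = 1 = S_m`. So the
floor `|k|/√(|k|² + Cρ) ≤ S` cannot be sharpened by any uniform positive margin, and `C(v) → 0` as
`v → 0` is consistent (Bogoliubov: `C = 16πa`). [folklore] -/
theorem puffFloor_tight_at_freeGas (hL : 0 < L) (hN : 0 < N) {m : Fin 3 → ℤ} (hm : m ≠ 0) (ρ : ℝ) :
    ‖((2 * Real.pi / L) • latticeVec 1 m)‖ /
        Real.sqrt (‖((2 * Real.pi / L) • latticeVec 1 m)‖ ^ 2 + 0 * ρ) =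
      (N : ℝ)⁻¹ * ∫ X in cellN N L, ‖∑ j : Fin N, cellWave L m (X j)‖ ^ 2 *
        ‖(witnessState (N := N) (ε := 0) le_rfl (by simp) hL hm).ψ X‖ ^ 2 := by
  have hk : 0 < ‖((2 * Real.pi / L) • latticeVec 1 m)‖ := by
    rw [norm_smul]
    exact mul_pos (by rw [Real.norm_eq_abs, abs_pos]; positivity) (norm_latticeVec_one_pos hm)
  rw [zero_mul, add_zero, Real.sqrt_sq hk.le, div_self hk.ne',
    structureFactor_witnessState le_rfl (by simp) hL hN hm, zero_mul, sub_zero]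


/-! ### Near-minimisers: the floor fails at arbitrarily small excitation energy -/

/-- `PuffFloor` with exact minimality WEAKENED to near-minimality in the weakest form
(`periodicEnergy v Ψ ≤ E₀^per + δ` with `∃ δ > 0` chosen AFTER `n`, as in `SmoothPeriodicBEC`),
all else verbatim. -/
def PuffFloorNearMinimisers : Prop :=
  ∀ v : ℝ → ENNReal, IsRepulsiveFiniteRange v → (∀ r, v r ≠ ⊤) →
    ContDiff ℝ 2 (fun x : Space => (v ‖x‖).toReal) →
    (∃ Cₑ : ℝ, ∀ x : Space, ‖iteratedFDeriv ℝ 2 (fun x : Space => (v ‖x‖).toReal) x‖ ≤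
      Cₑ * Real.sqrt ((v ‖x‖).toReal)) →
    ∃ C : ℝ, 0 ≤ C ∧ ∃ ρ₀ : ℝ, 0 < ρ₀ ∧ ∀ ρ : ℝ, 0 < ρ → ρ < ρ₀ →
      ∀ᶠ n : ℕ in Filter.atTop, ∃ δ : ENNReal, 0 < δ ∧
        ∀ Ψ : PeriodicTrialState (n + 1) (sideLength ρ (n + 1)),
        (let L : ℝ := sideLength ρ (n + 1)
         let S : (Fin 3 → ℤ) → ℝ := fun m => ((n : ℝ) + 1)⁻¹ *
           ∫ X in cellN (n + 1) L, ‖∑ j : Fin (n + 1), cellWave L m (X j)‖ ^ 2 * ‖Ψ.ψ X‖ ^ 2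
         let kn : (Fin 3 → ℤ) → ℝ := fun m => ‖((2 * Real.pi / L) • latticeVec 1 m)‖
         periodicEnergy v Ψ ≤ periodicGroundStateEnergy v (n + 1) L + δ → periodicEnergy v Ψ ≠ ⊤ →
           (∀ X, Ψ.ψ X = (‖Ψ.ψ X‖ : ℂ)) → (∀ X, Ψ.ψ X ≠ 0) →
           ∀ m : Fin 3 → ℤ, m ≠ 0 → kn m / Real.sqrt (kn m ^ 2 + C * ρ) ≤ S m)

/-- Near-minimality with any `δ > 0` contains exact minimality: the near-minimiser form
STRENGTHENS the crux. [folklore] -/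
theorem puffFloor_of_nearMinimisers (h : PuffFloorNearMinimisers) :
    Summit.AtomisticToContinuum.BoseEinsteinCondensation.Theses.BECConjugateDomination.PuffFloor := by
  intro v h1 h2 h3 h4
  obtain ⟨C, hC, ρ₀, hρ₀, h⟩ := h v h1 h2 h3 h4
  refine ⟨C, hC, ρ₀, hρ₀, fun ρ hρ hρ' => ?_⟩
  filter_upwards [h ρ hρ hρ'] with n hn Ψ
  obtain ⟨δ, _, hn⟩ := hn
  intro L S kn hE hfin hre hne m hm
  exact hn Ψ (by rw [hE]; exact le_self_add) hfin hre hne m hm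

/-- `S_m` of the witness in the syntactic form of the crux (`N = n + 1`): `S_m = 1 - ε n`.
[folklore] -/
theorem structureFactor_witnessState_succ' (hL : 0 < L) (n : ℕ) {ε : ℝ} (hε : 0 ≤ ε)
    (hε' : ε * ((((n + 1 : ℕ) : ℝ)) ^ 2 - ((n + 1 : ℕ) : ℝ)) ≤ 1 / 2) {m : Fin 3 → ℤ}
    (hm : m ≠ 0) :
    ((n : ℝ) + 1)⁻¹ * ∫ X in cellN (n + 1) L, ‖∑ j : Fin (n + 1), cellWave L m (X j)‖ ^ 2 *
        ‖(witnessState hε hε' hL hm).ψ X‖ ^ 2 = 1 - ε * n := by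
  have h := structureFactor_witnessState hε hε' hL (Nat.succ_pos n) hm
  push_cast at h
  rw [add_sub_cancel_right] at h
  exact h

/-- `k ≤ s + c ⇒ k² ≤ 2s² + 2c²` for `k ≥ 0`. [folklore] -/
theorem sq_le_two_sq_add_two_sq {k s c : ℝ} (hk : 0 ≤ k) (h : k ≤ s + c) :
    k ^ 2 ≤ 2 * s ^ 2 + 2 * c ^ 2 := by
  nlinarith [sq_nonneg (s - c)]

/-- `n ≤ (n+1)²`. [folklore] -/
theorem le_succ_sq (n : ℝ) (hn : 0 ≤ n) : n ≤ (n + 1) ^ 2 := by nlinarith [sq_nonneg n]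

/-- The algebra of the contradiction: `k/√(k²+Cρ) ≤ 1 - δ` (squared) and `Cρ < k²δ` are
incompatible for `0 < δ < 1`. [folklore] -/
theorem floor_contradiction {k δ Cρ : ℝ} (hk : 0 < k) (hδ0 : 0 < δ) (hδ1 : δ < 1) (hCρ0 : 0 ≤ Cρ)
    (hCρ : Cρ < k ^ 2 * δ) (h3 : k ^ 2 ≤ (1 - δ) ^ 2 * (k ^ 2 + Cρ)) : False := by
  have hA : (1 - δ) ^ 2 * Cρ ≤ Cρ :=
    mul_le_of_le_one_left hCρ0 (by nlinarith)
  have h4 : k ^ 2 * δ * (2 - δ) ≤ Cρ := by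
    have e : k ^ 2 * δ * (2 - δ) = k ^ 2 - (1 - δ) ^ 2 * k ^ 2 := by ring
    rw [e]
    linarith [mul_add ((1 - δ) ^ 2) (k ^ 2) Cρ]
  have h5 : 0 < k ^ 2 * δ * (1 - δ) := mul_pos (mul_pos (pow_pos hk 2) hδ0) (by linarith)
  have e2 : k ^ 2 * δ * (2 - δ) = k ^ 2 * δ + k ^ 2 * δ * (1 - δ) := by ring
  linarith

/-- **The floor fails for near-minimisers at every energy resolution.** `PuffFloorNearMinimisers`
is FALSE: for the free gas (`E₀^per = 0`), every `C ≥ 0`, `ρ > 0`, `N ≥ 2` and every `δ > 0` the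
witness `Ψ_ε` with `ε = η/N²` at a high mode `k = (2π/L)(j,0,0)`, `k² ≈ Cρ/(εn)`, has
`periodicEnergy ≤ 2ε²N³k² ≤ η(8Cρ + 16π²/L²) < δ` for `η` small, yet `S_m = 1 - εn` lies below the
floor (`Cρ < k²·εn`). The energy cost of violating the floor decays like `1/k²` along high modes, so
the floor is a property of the EXACT minimiser only (consistent with the route: near-minimisers enter
`IMUChainGlue` through `NearMinimiserStability` on `n₀`, never through `S`). [folklore] -/
theorem puffFloor_false_for_nearMinimisers : ¬ PuffFloorNearMinimisers := by
  intro h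
  obtain ⟨h1, h2, h3, h4⟩ := smoothClass_zero
  obtain ⟨C, hC, ρ₀, hρ₀, h⟩ := h 0 h1 h2 h3 h4
  set ρ : ℝ := ρ₀ / 2 with hρdef
  have hρ : 0 < ρ := by positivity
  have hev := h ρ hρ (by rw [hρdef]; linarith)
  rw [Filter.eventually_atTop] at hev
  obtain ⟨n₀, hn₀⟩ := hev
  set n : ℕ := max n₀ 1 with hndef
  have h1n : 1 ≤ n := le_max_right _ _
  have hn' : (1 : ℝ) ≤ n := by exact_mod_cast h1n
  obtain ⟨δ', hδ'0, key⟩ := hn₀ n (le_max_left _ _)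
  set L : ℝ := sideLength ρ (n + 1) with hLdef
  have hL : 0 < L := Real.rpow_pos_of_pos (by positivity) _
  clear_value L n ρ
  -- a real energy budget `δr` below `δ'`
  obtain ⟨δr, hδr, hδr'⟩ : ∃ δr : ℝ, 0 < δr ∧ ENNReal.ofReal δr ≤ δ' := by
    rcases eq_or_ne δ' ⊤ with htop | htop
    · exact ⟨1, one_pos, htop ▸ le_top⟩
    · exact ⟨δ'.toReal, ENNReal.toReal_pos hδ'0.ne' htop, ENNReal.ofReal_toReal_le⟩
  -- the small parameter `η` and the amplitude `ε = η / N²` (all constants opaque)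
  obtain ⟨c₀, hc₀⟩ : ∃ c₀ : ℝ, c₀ = 2 * Real.pi / L := ⟨_, rfl⟩
  have hc₀0 : 0 < c₀ := by rw [hc₀]; positivity
  obtain ⟨A, hA⟩ : ∃ A : ℝ, A = 8 * C * ρ + 4 * c₀ ^ 2 := ⟨_, rfl⟩
  have hA0 : 0 < A := by rw [hA]; positivity
  obtain ⟨η, hηdef⟩ : ∃ η : ℝ, η = min (1 / 2) (δr / (2 * A)) := ⟨_, rfl⟩
  have hη0 : 0 < η := by rw [hηdef]; exact lt_min (by norm_num) (by positivity)
  have hη1 : η ≤ 1 / 2 := by rw [hηdef]; exact min_le_left _ _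
  have hηA : η * A ≤ δr / 2 := by
    have : η ≤ δr / (2 * A) := by rw [hηdef]; exact min_le_right _ _
    rw [le_div_iff₀ (by positivity)] at this
    linarith
  obtain ⟨ε, hεdef⟩ : ∃ ε : ℝ, ε = η / ((n : ℝ) + 1) ^ 2 := ⟨_, rfl⟩
  have hε0 : 0 ≤ ε := by rw [hεdef]; positivity
  have hεN : ε * ((n : ℝ) + 1) ^ 2 = η := by rw [hεdef]; field_simp
  have hεa : ε * ((((n + 1 : ℕ) : ℝ)) ^ 2 - ((n + 1 : ℕ) : ℝ)) ≤ 1 / 2 := by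
    push_cast
    have e : ε * (((n : ℝ) + 1) ^ 2 - ((n : ℝ) + 1)) = ε * ((n : ℝ) + 1) ^ 2 - ε * ((n : ℝ) + 1) := by
      ring
    have hpos : 0 ≤ ε * ((n : ℝ) + 1) := by positivity
    rw [e, hεN]
    linarith
  -- the deficit `δ = ε n` of the witness
  obtain ⟨δ, hδdef⟩ : ∃ δ : ℝ, δ = ε * n := ⟨_, rfl⟩
  have hδ0 : 0 < δ := by
    rw [hδdef]; exact mul_pos (by rw [hεdef]; positivity) (by positivity)
  have hδ1 : δ < 1 := by
    have : δ ≤ ε * ((n : ℝ) + 1) ^ 2 := by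
      rw [hδdef]; exact mul_le_mul_of_nonneg_left (le_succ_sq _ (by positivity)) hε0
    linarith
  -- the mode: `j = ⌊√K/c₀⌋ + 1`, `K = Cρ/δ`, `k = c₀ j`
  obtain ⟨K, hK⟩ : ∃ K : ℝ, K = C * ρ / δ := ⟨_, rfl⟩
  have hK0 : 0 ≤ K := by rw [hK]; positivity
  obtain ⟨j, hj⟩ : ∃ j : ℕ, j = ⌊Real.sqrt K / c₀⌋₊ + 1 := ⟨_, rfl⟩
  have hj0 : 0 < j := by rw [hj]; exact Nat.succ_pos _
  obtain ⟨m, hmdef⟩ : ∃ m : Fin 3 → ℤ, m = Pi.single (0 : Fin 3) ((j : ℕ) : ℤ) := ⟨_, rfl⟩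
  have hm : m ≠ 0 := by
    intro h0
    have := congr_fun h0 0
    rw [hmdef, Pi.single_eq_same, Pi.zero_apply] at this
    exact hj0.ne' (by exact_mod_cast this)
  have hkn : ‖((2 * Real.pi / L) • latticeVec 1 m)‖ = c₀ * j := by
    rw [hmdef, hc₀]
    exact norm_smul_latticeVec_single (by positivity) j
  obtain ⟨k, hkdef⟩ : ∃ k : ℝ, k = c₀ * j := ⟨_, rfl⟩
  rw [← hkdef] at hkn
  have hjlow : Real.sqrt K / c₀ < j := by rw [hj]; push_cast; exact Nat.lt_floor_add_one _
  have hjup : (j : ℝ) ≤ Real.sqrt K / c₀ + 1 := by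
    rw [hj]; push_cast; gcongr; exact Nat.floor_le (by positivity)
  have hklow : Real.sqrt K < k := by
    rw [div_lt_iff₀ hc₀0] at hjlow; rw [hkdef]; linarith
  have hk0 : 0 < k := lt_of_le_of_lt (Real.sqrt_nonneg K) hklow
  have hkup : k ≤ Real.sqrt K + c₀ := by
    have := mul_le_mul_of_nonneg_left hjup hc₀0.le
    rw [hkdef]
    calc c₀ * j ≤ c₀ * (Real.sqrt K / c₀ + 1) := this
      _ = Real.sqrt K + c₀ := by field_simp
  have hsqK : Real.sqrt K ^ 2 = K := Real.sq_sqrt hK0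
  have hK_lt : K < k ^ 2 := by
    rw [← hsqK]
    exact pow_lt_pow_left₀ hklow (Real.sqrt_nonneg K) two_ne_zero
  have hCρ : C * ρ < k ^ 2 * δ := by
    have : C * ρ = K * δ := by rw [hK]; field_simp
    rw [this]
    exact mul_lt_mul_of_pos_right hK_lt hδ0
  have hk2 : k ^ 2 ≤ 2 * K + 2 * c₀ ^ 2 := by
    have h0 := sq_le_two_sq_add_two_sq hk0.le hkup
    rwa [hsqK] at h0
  -- real-arithmetic energy budget: `2 ε² N³ k² ≤ η A ≤ δr`
  have hEreal : 2 * ε ^ 2 * ((n : ℝ) + 1) ^ 3 * k ^ 2 ≤ δr := by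
    have hx0 : 0 ≤ 2 * ε ^ 2 * ((n : ℝ) + 1) ^ 3 := by positivity
    have h1 : 2 * ε ^ 2 * ((n : ℝ) + 1) ^ 3 * k ^ 2 ≤
        2 * ε ^ 2 * ((n : ℝ) + 1) ^ 3 * (2 * K) + 2 * ε ^ 2 * ((n : ℝ) + 1) ^ 3 * (2 * c₀ ^ 2) := by
      rw [← mul_add]; exact mul_le_mul_of_nonneg_left hk2 hx0
    have h2 : 2 * ε ^ 2 * ((n : ℝ) + 1) ^ 3 * (2 * K) ≤ 8 * η * (C * ρ) := by
      have he : 2 * ε ^ 2 * ((n : ℝ) + 1) ^ 3 * (2 * K) =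
          4 * η * (C * ρ) * (((n : ℝ) + 1) / n) := by
        rw [hK, hδdef, ← hεN]
        field_simp
        ring
      rw [he]
      have h3 : ((n : ℝ) + 1) / n ≤ 2 := by rw [div_le_iff₀ (by positivity)]; linarith
      have h4 : 0 ≤ 4 * η * (C * ρ) := by positivity
      calc 4 * η * (C * ρ) * (((n : ℝ) + 1) / n) ≤ 4 * η * (C * ρ) * 2 :=
            mul_le_mul_of_nonneg_left h3 h4
        _ = 8 * η * (C * ρ) := by ring
    have h3 : 2 * ε ^ 2 * ((n : ℝ) + 1) ^ 3 * (2 * c₀ ^ 2) ≤ 4 * η * c₀ ^ 2 := by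
      have he : 2 * ε ^ 2 * ((n : ℝ) + 1) ^ 3 * (2 * c₀ ^ 2) =
          4 * c₀ ^ 2 * (η * (η / ((n : ℝ) + 1))) := by
        rw [← hεN]; field_simp; ring
      rw [he]
      have h5 : η / ((n : ℝ) + 1) ≤ 1 := by
        rw [div_le_one (by positivity)]; linarith
      have h6 : η * (η / ((n : ℝ) + 1)) ≤ η := by
        calc η * (η / ((n : ℝ) + 1)) ≤ η * 1 := mul_le_mul_of_nonneg_left h5 hη0.le
          _ = η := mul_one η
      calc 4 * c₀ ^ 2 * (η * (η / ((n : ℝ) + 1))) ≤ 4 * c₀ ^ 2 * η :=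
            mul_le_mul_of_nonneg_left h6 (by positivity)
        _ = 4 * η * c₀ ^ 2 := by ring
    have h7 : 8 * η * (C * ρ) + 4 * η * c₀ ^ 2 = η * A := by rw [hA]; ring
    linarith
  -- the witness and its energy
  have hE : periodicEnergy (0 : ℝ → ℝ≥0∞) (witnessState hε0 hεa hL hm) ≤
      periodicGroundStateEnergy (0 : ℝ → ℝ≥0∞) (n + 1) L + δ' := by
    rw [periodicGroundStateEnergy_zero_eq_zero (n + 1) hL, zero_add]
    refine (periodicEnergy_witnessState_le hε0 hεa hL hm).trans (le_trans ?_ hδr')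
    refine ENNReal.ofReal_le_ofReal ?_
    rw [hkn]
    push_cast
    exact hEreal
  -- evaluate the near-minimiser inequality on the witness
  have hw := key (witnessState hε0 hεa hL hm) hE (periodicEnergy_zero_ne_top _)
    (witnessState_real hε0 hεa hL hm) (witnessState_ne_zero hε0 hεa hL hm) m hm
  dsimp only at hw
  rw [structureFactor_witnessState_succ' hL n hε0 hεa hm, hkn, ← hδdef] at hw
  -- `k/√(k² + Cρ) ≤ 1 - δ` contradicts `Cρ < k²δ`
  have hsq : 0 < Real.sqrt (k ^ 2 + C * ρ) := Real.sqrt_pos.2 (by positivity)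
  rw [div_le_iff₀ hsq] at hw
  have h3 : k ^ 2 ≤ ((1 - δ) * Real.sqrt (k ^ 2 + C * ρ)) ^ 2 :=
    pow_le_pow_left₀ hk0.le hw 2
  rw [mul_pow, Real.sq_sqrt (by positivity)] at h3
  exact floor_contradiction hk0 hδ0 hδ1 (by positivity) hCρ h3

/-! ### Small model: for the free gas the crux HOLDS with `C = 0` (every minimiser is constant) -/

/-- The open box `(0,L)^{3N}` inside the cell. [folklore] -/
def openBoxN (N : ℕ) (L : ℝ) : Set (Config N) := {X | ∀ i a, X i a ∈ Set.Ioo 0 L}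

/-- The open box is open. [folklore] -/
theorem isOpen_openBoxN (N : ℕ) (L : ℝ) : IsOpen (openBoxN N L) := by
  have hrw : openBoxN N L = ⋂ i, ⋂ a, (fun X : Config N => X i a) ⁻¹' Set.Ioo 0 L := by
    ext X; simp [openBoxN]
  rw [hrw]
  exact isOpen_iInter_of_finite fun i => isOpen_iInter_of_finite fun a =>
    isOpen_Ioo.preimage (by fun_prop)

/-- The open box is convex. [folklore] -/
theorem convex_openBoxN (N : ℕ) (L : ℝ) : Convex ℝ (openBoxN N L) := by
  intro X hX Y hY s t hs ht hst i a
  have h := convex_Ioo (0 : ℝ) L (hX i a) (hY i a) hs ht hst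
  simpa using h

/-- The open box lies in the cell. [folklore] -/
theorem openBoxN_subset_cellN (N : ℕ) (L : ℝ) : openBoxN N L ⊆ cellN N L :=
  fun _ hX i a => Set.Ioo_subset_Ico_self (hX i a)

/-- A continuous linear functional on `Config N` vanishing on all coordinate vectors
`eᵢ ⊗ eₐ` is zero. [folklore] -/
theorem clm_eq_zero_of_apply_single {A : Config N →L[ℝ] ℂ}
    (h : ∀ (i : Fin N) (a : Fin 3), A (Pi.single i (EuclideanSpace.single a 1)) = 0) : A = 0 := by
  ext v
  have hv : v = ∑ i, Pi.single i (v i) := (Finset.univ_sum_single v).symm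
  rw [hv, map_sum, zero_apply]
  refine Finset.sum_eq_zero fun i _ => ?_
  have hlin : (A.toLinearMap.comp (LinearMap.single ℝ (fun _ : Fin N => Space) i)) = 0 := by
    refine (EuclideanSpace.basisFun (Fin 3) ℝ).toBasis.ext fun a => ?_
    simp [h i a]
  have := LinearMap.congr_fun hlin (v i)
  simpa using this

/-- **Zero kinetic energy kills every partial derivative on the open box.** [folklore] -/
theorem fderiv_eq_zero_of_kinetic_zero (Ψ : PeriodicTrialState N L)
    (h0 : ∫⁻ X in cellN N L, kineticDensity Ψ.ψ X = 0) {X : Config N} (hX : X ∈ openBoxN N L) :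
    fderiv ℝ Ψ.ψ X = 0 := by
  refine clm_eq_zero_of_apply_single fun i a => ?_
  by_contra hne
  have hpos := lintegral_cellN_pos (L := L) (continuous_fderiv_config_single Ψ.contDiff i a) hX hne
  have hle : ∫⁻ Y in cellN N L,
      ((‖fderiv ℝ Ψ.ψ Y (Pi.single i (EuclideanSpace.single a 1))‖₊ : ℝ≥0∞)) ^ 2 ≤
        ∫⁻ Y in cellN N L, kineticDensity Ψ.ψ Y := by
    refine lintegral_mono fun Y => ?_
    unfold kineticDensity
    refine le_trans ?_ (Finset.single_le_sum (f := fun i' : Fin N => ∑ a' : Fin 3,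
      ((‖fderiv ℝ Ψ.ψ Y (Pi.single i' (EuclideanSpace.single a' 1))‖₊ : ℝ≥0∞)) ^ 2)
      (fun _ _ => bot_le) (Finset.mem_univ i))
    exact Finset.single_le_sum (f := fun a' : Fin 3 =>
      ((‖fderiv ℝ Ψ.ψ Y (Pi.single i (EuclideanSpace.single a' 1))‖₊ : ℝ≥0∞)) ^ 2)
      (fun _ _ => bot_le) (Finset.mem_univ a)
  rw [h0] at hle
  exact hpos.ne' (le_antisymm hle bot_le)

/-- **Zero kinetic energy: `Ψ` is constant on the cell** (constant on the convex open box by the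
mean value theorem, then on `[0,L)^{3N}` by continuity along the inward diagonal). [folklore] -/
theorem exists_eq_const_of_kinetic_zero (hL : 0 < L) (hN : 0 < N) (Ψ : PeriodicTrialState N L)
    (h0 : ∫⁻ X in cellN N L, kineticDensity Ψ.ψ X = 0) :
    ∃ c : ℂ, ∀ X ∈ cellN N L, Ψ.ψ X = c := by
  haveI : Nonempty (Fin N) := ⟨⟨0, hN⟩⟩
  set X₀ : Config N := fun _ => (WithLp.toLp 2 (fun _ : Fin 3 => L / 2) : Space) with hX₀def
  have hX₀ : X₀ ∈ openBoxN N L := fun i a => by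
    simp only [hX₀def, PiLp.toLp_apply, Set.mem_Ioo]
    constructor <;> linarith
  refine ⟨Ψ.ψ X₀, fun X hX => ?_⟩
  have hdiff : Differentiable ℝ Ψ.ψ := Ψ.contDiff.differentiable (by simp)
  have hconst : ∀ Y ∈ openBoxN N L, Ψ.ψ Y = Ψ.ψ X₀ := fun Y hY =>
    (convex_openBoxN N L).is_const_of_fderivWithin_eq_zero hdiff.differentiableOn
      (fun Z hZ => by
        rw [fderivWithin_of_isOpen (isOpen_openBoxN N L) hZ]
        exact fderiv_eq_zero_of_kinetic_zero Ψ h0 hZ) hY hX₀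
  -- an inward diagonal segment from `X`
  obtain ⟨t₀, ht₀, ht₀'⟩ : ∃ t₀ : ℝ, 0 < t₀ ∧ ∀ i a, X i a + t₀ ≤ L := by
    obtain ⟨p, -, hp⟩ := Finset.exists_min_image Finset.univ
      (fun p : Fin N × Fin 3 => L - X p.1 p.2) Finset.univ_nonempty
    refine ⟨L - X p.1 p.2, by linarith [(hX p.1 p.2).2], fun i a => ?_⟩
    have := hp (i, a) (Finset.mem_univ _)
    linarith
  set D : Config N := fun _ => (WithLp.toLp 2 (fun _ : Fin 3 => (1 : ℝ)) : Space) with hDdef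
  have hseg : ∀ t ∈ Set.Ioo (0 : ℝ) t₀, X + t • D ∈ openBoxN N L := by
    intro t ht i a
    have h1 := (hX i a).1
    have h2 := ht₀' i a
    simp only [hDdef, Pi.add_apply, Pi.smul_apply, PiLp.add_apply, PiLp.smul_apply,
      smul_eq_mul, mul_one, Set.mem_Ioo]
    constructor <;> linarith [ht.1, ht.2]
  have hcont : Continuous fun t : ℝ => Ψ.ψ (X + t • D) :=
    Ψ.contDiff.continuous.comp (continuous_const.add (continuous_id.smul continuous_const))
  have hEq : Set.EqOn (fun t : ℝ => Ψ.ψ (X + t • D)) (fun _ => Ψ.ψ X₀) (Set.Ioo 0 t₀) :=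
    fun t ht => hconst _ (hseg t ht)
  have hcl := hEq.closure hcont continuous_const
  have h0mem : (0 : ℝ) ∈ closure (Set.Ioo (0 : ℝ) t₀) := by
    rw [closure_Ioo ht₀.ne]; exact ⟨le_rfl, ht₀.le⟩
  simpa using hcl h0mem

/-- A state constant on the cell has `|c|²(L³)ᴺ = 1`. [folklore] -/
theorem norm_sq_mul_vol_eq_one (hL : 0 < L) (Ψ : PeriodicTrialState N L) {c : ℂ}
    (hc : ∀ X ∈ cellN N L, Ψ.ψ X = c) : ‖c‖ ^ 2 * (L ^ 3) ^ N = 1 := by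
  have h := Ψ.norm_eq
  rw [setLIntegral_congr_fun (measurableSet_cellN N L)
      (fun X hX => by simp only [hc X hX] : Set.EqOn (fun X => ((‖Ψ.ψ X‖₊ : ℝ≥0∞)) ^ 2)
        (fun _ => ((‖c‖₊ : ℝ≥0∞)) ^ 2) (cellN N L)),
    setLIntegral_const, volume_cellN, coe_nnnorm_sq_eq_ofReal, ← ENNReal.ofReal_pow hL.le,
    ← ENNReal.ofReal_pow (by positivity), ← ENNReal.ofReal_mul (by positivity),
    ← ENNReal.ofReal_one, ENNReal.ofReal_eq_ofReal_iff (by positivity) zero_le_one] at h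
  exact h

/-- **A free-gas minimiser has `S_m = 1` at every mode `m ≠ 0`.** [folklore] -/
theorem structureFactor_eq_one_of_freeMinimiser (hL : 0 < L) (hN : 0 < N)
    (Ψ : PeriodicTrialState N L)
    (hE : periodicEnergy (0 : ℝ → ℝ≥0∞) Ψ = periodicGroundStateEnergy (0 : ℝ → ℝ≥0∞) N L)
    {m : Fin 3 → ℤ} (hm : m ≠ 0) :
    (N : ℝ)⁻¹ * ∫ X in cellN N L, ‖∑ j : Fin N, cellWave L m (X j)‖ ^ 2 * ‖Ψ.ψ X‖ ^ 2 = 1 := by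
  -- zero kinetic energy
  have h0 : ∫⁻ X in cellN N L, kineticDensity Ψ.ψ X = 0 := by
    rw [periodicGroundStateEnergy_zero_eq_zero N hL, periodicEnergy] at hE
    rw [← hE]
    refine lintegral_congr fun X => ?_
    rw [periodicInteraction_zeroPotential, zero_mul, add_zero]
  obtain ⟨c, hc⟩ := exists_eq_const_of_kinetic_zero hL hN Ψ h0
  have hcn := norm_sq_mul_vol_eq_one hL Ψ hc
  have hN' : (0 : ℝ) < N := by exact_mod_cast hN
  rw [setIntegral_congr_fun (measurableSet_cellN N L)
    (fun X hX => by simp only [hc X hX] :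
      Set.EqOn (fun X : Config N => ‖∑ j : Fin N, cellWave L m (X j)‖ ^ 2 * ‖Ψ.ψ X‖ ^ 2)
        (fun X => ‖∑ j : Fin N, cellWave L m (X j)‖ ^ 2 * ‖c‖ ^ 2) (cellN N L))]
  have hfun : (fun X : Config N => ‖∑ j : Fin N, cellWave L m (X j)‖ ^ 2 * ‖c‖ ^ 2) =
      fun X => ‖c‖ ^ 2 * pairCorr L m X + ‖c‖ ^ 2 * N := by
    funext X; rw [pairCorr, planeWaveSum]; ring
  have hi1 : IntegrableOn (fun X : Config N => ‖c‖ ^ 2 * pairCorr L m X) (cellN N L) volume :=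
    (integrableOn_cellN_real L (continuous_pairCorr L m)).const_mul _
  have hi2 : IntegrableOn (fun _ : Config N => ‖c‖ ^ 2 * (N : ℝ)) (cellN N L) volume :=
    integrableOn_const (by
      rw [volume_cellN]; exact ENNReal.pow_ne_top (ENNReal.pow_ne_top ENNReal.ofReal_ne_top))
  rw [hfun, integral_add hi1 hi2, integral_const_mul, integral_cellN_pairCorr hL hm, mul_zero,
    zero_add, setIntegral_const, measureReal_cellN hL, smul_eq_mul]
  calc (N : ℝ)⁻¹ * ((L ^ 3) ^ N * (‖c‖ ^ 2 * N)) = ‖c‖ ^ 2 * (L ^ 3) ^ N * ((N : ℝ)⁻¹ * N) := by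
        ring
    _ = 1 := by rw [inv_mul_cancel₀ hN'.ne', mul_one, hcn]

/-- The floor never exceeds `1`. [folklore] -/
theorem floor_le_one {k C ρ : ℝ} (hk : 0 ≤ k) (hCρ : 0 ≤ C * ρ) :
    k / Real.sqrt (k ^ 2 + C * ρ) ≤ 1 := by
  rcases eq_or_lt_of_le hk with hk0 | hk0
  · rw [← hk0, zero_div]; exact zero_le_one
  · rw [div_le_one (Real.sqrt_pos.2 (by positivity))]
    calc k = Real.sqrt (k ^ 2) := (Real.sqrt_sq hk).symm
      _ ≤ Real.sqrt (k ^ 2 + C * ρ) := Real.sqrt_le_sqrt (by linarith)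

/-- **Small model `v ≡ 0`: the crux's conclusion HOLDS for the free gas, with `C = 0`, every
`ρ₀`, every `n` and every minimiser** (its minimisers are exactly the states of zero kinetic
energy, i.e. constant on the cell, and those have `S_m = 1 ≥ kn/√(kn² + Cρ)`). So `PuffFloor`
restricted to the free gas is true — the smooth class is not where a refutation can live without
interaction, and the normalisations of `S`, `kn` in the crux are the right ones. [folklore] -/
theorem puffFloor_holds_at_freeGas :
    ∃ C : ℝ, 0 ≤ C ∧ ∃ ρ₀ : ℝ, 0 < ρ₀ ∧ ∀ ρ : ℝ, 0 < ρ → ρ < ρ₀ →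
      ∀ᶠ n : ℕ in Filter.atTop, ∀ Ψ : PeriodicTrialState (n + 1) (sideLength ρ (n + 1)),
        (let L : ℝ := sideLength ρ (n + 1)
         let S : (Fin 3 → ℤ) → ℝ := fun m => ((n : ℝ) + 1)⁻¹ *
           ∫ X in cellN (n + 1) L, ‖∑ j : Fin (n + 1), cellWave L m (X j)‖ ^ 2 * ‖Ψ.ψ X‖ ^ 2
         let kn : (Fin 3 → ℤ) → ℝ := fun m => ‖((2 * Real.pi / L) • latticeVec 1 m)‖
         periodicEnergy (0 : ℝ → ℝ≥0∞) Ψ = periodicGroundStateEnergy (0 : ℝ → ℝ≥0∞) (n + 1) L →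
           periodicEnergy (0 : ℝ → ℝ≥0∞) Ψ ≠ ⊤ →
           (∀ X, Ψ.ψ X = (‖Ψ.ψ X‖ : ℂ)) → (∀ X, Ψ.ψ X ≠ 0) →
           ∀ m : Fin 3 → ℤ, m ≠ 0 → kn m / Real.sqrt (kn m ^ 2 + C * ρ) ≤ S m) := by
  refine ⟨0, le_rfl, 1, one_pos, fun ρ hρ _ => Filter.Eventually.of_forall fun n Ψ => ?_⟩
  intro L S kn hE _ _ _ m hm
  have hL : 0 < L := Real.rpow_pos_of_pos (by positivity) _
  have hS : S m = 1 := by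
    have h := structureFactor_eq_one_of_freeMinimiser hL (Nat.succ_pos n) Ψ hE hm
    push_cast at h
    exact h
  rw [hS]
  exact floor_le_one (norm_nonneg _) (by positivity)

/-! ## Cycle 2 (gen-2 seat, 2026-08-16) -/

/-! ### Decoration: the finite-energy hypothesis is implied by minimality -/

/-- `PuffFloor` with the hypothesis `periodicEnergy v Ψ ≠ ⊤` DROPPED (everything else verbatim). -/
def PuffFloorWithoutFiniteEnergy : Prop :=
  ∀ v : ℝ → ENNReal, IsRepulsiveFiniteRange v → (∀ r, v r ≠ ⊤) →
    ContDiff ℝ 2 (fun x : Space => (v ‖x‖).toReal) →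
    (∃ Cₑ : ℝ, ∀ x : Space, ‖iteratedFDeriv ℝ 2 (fun x : Space => (v ‖x‖).toReal) x‖ ≤
      Cₑ * Real.sqrt ((v ‖x‖).toReal)) →
    ∃ C : ℝ, 0 ≤ C ∧ ∃ ρ₀ : ℝ, 0 < ρ₀ ∧ ∀ ρ : ℝ, 0 < ρ → ρ < ρ₀ →
      ∀ᶠ n : ℕ in Filter.atTop, ∀ Ψ : PeriodicTrialState (n + 1) (sideLength ρ (n + 1)),
        (let L : ℝ := sideLength ρ (n + 1)
         let S : (Fin 3 → ℤ) → ℝ := fun m => ((n : ℝ) + 1)⁻¹ *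
           ∫ X in cellN (n + 1) L, ‖∑ j : Fin (n + 1), cellWave L m (X j)‖ ^ 2 * ‖Ψ.ψ X‖ ^ 2
         let kn : (Fin 3 → ℤ) → ℝ := fun m => ‖((2 * Real.pi / L) • latticeVec 1 m)‖
         periodicEnergy v Ψ = periodicGroundStateEnergy v (n + 1) L →
           (∀ X, Ψ.ψ X = (‖Ψ.ψ X‖ : ℂ)) → (∀ X, Ψ.ψ X ≠ 0) →
           ∀ m : Fin 3 → ℤ, m ≠ 0 → kn m / Real.sqrt (kn m ^ 2 + C * ρ) ≤ S m)

/-- **`periodicEnergy v Ψ ≠ ⊤` is decoration**: for every repulsive finite-range `v` (hard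
cores included) the periodic ground-state energy along `L = sideLength ρ N` is finite for all
large `N` once `ρ` is small (`exists_eventually_periodicGroundStateEnergy_lt_top`, Ruelle §3.5.11),
so an exact minimiser has finite energy automatically after shrinking `ρ₀`; removing the
hypothesis gives an EQUIVALENT statement. A planner may drop it; a prover gets it for free.
[folklore] -/
theorem puffFloorWithoutFiniteEnergy_iff :
    PuffFloorWithoutFiniteEnergy ↔
      Summit.AtomisticToContinuum.BoseEinsteinCondensation.Theses.BECConjugateDomination.PuffFloor := by
  constructor
  · intro h v h1 h2 h3 h4
    obtain ⟨C, hC, ρ₀, hρ₀, h⟩ := h v h1 h2 h3 h4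
    refine ⟨C, hC, ρ₀, hρ₀, fun ρ hρ hρ' => ?_⟩
    filter_upwards [h ρ hρ hρ'] with n hn Ψ
    intro L S kn hE _ hre hne m hm
    exact hn Ψ hE hre hne m hm
  · intro h v h1 h2 h3 h4
    obtain ⟨C, hC, ρ₀, hρ₀, h⟩ := h v h1 h2 h3 h4
    obtain ⟨ρ₁, hρ₁, hfin⟩ :=
      Literature.Barriers.AtomisticToContinuum.BoseGas.exists_eventually_periodicGroundStateEnergy_lt_top h1
    refine ⟨C, hC, min ρ₀ ρ₁, lt_min hρ₀ hρ₁, fun ρ hρ hρ' => ?_⟩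
    have hA := h ρ hρ (lt_of_lt_of_le hρ' (min_le_left _ _))
    have hB := (Filter.tendsto_add_atTop_nat 1).eventually
      (hfin ρ hρ (lt_of_lt_of_le hρ' (min_le_right _ _)))
    filter_upwards [hA, hB] with n hn hn' Ψ
    intro L S kn hE hre hne m hm
    have hfinΨ : periodicEnergy v Ψ ≠ ⊤ := by
      rw [hE]; exact hn'.ne
    exact hn Ψ hE hfinΨ hre hne m hm

/-! ### The three-moment (Hölder) step of the intended proof, and its tightness -/

/-- **Lyapunov–Hölder moment inequality `m₁³ ≤ m₀² m₃`**: for any measure `μ` (the spectral measure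
of `H - E₀` in the vector `ρ_k† Ψ`, supported on `[0,∞)` BECAUSE `Ψ` is the exact minimiser) and any
measurable `ω ≥ 0`, `(∫ ω dμ)³ ≤ μ(univ)² · ∫ ω³ dμ`. With `m₀ = N S(k)`, `m₁ = N|k|²` (f-sum rule)
and `m₃ ≤ N|k|⁴(|k|² + Θ)` (Puff) this is exactly `S(k) ≥ |k|/√(|k|² + Θ)`: one Hölder step with
exponents `(3, 3/2)`. [folklore] -/
theorem lintegral_pow_three_le_measure_sq_mul {α : Type*} [MeasurableSpace α] (μ : Measure α)
    {ω : α → ℝ≥0∞} (hω : AEMeasurable ω μ) :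
    (∫⁻ x, ω x ∂μ) ^ 3 ≤ μ Set.univ ^ 2 * ∫⁻ x, ω x ^ 3 ∂μ := by
  have hpq : Real.HolderConjugate 3 (3 / 2) := ⟨by norm_num, by norm_num, by norm_num⟩
  have h := ENNReal.lintegral_mul_le_Lp_mul_Lq μ hpq hω (aemeasurable_const (b := (1 : ℝ≥0∞)))
  simp only [Pi.mul_apply, mul_one, ENNReal.one_rpow, lintegral_const, one_mul] at h
  -- `h : ∫⁻ ω ≤ (∫⁻ ω ^ 3) ^ (1/3) * (μ univ) ^ (1/(3/2))`
  have h3 : ((∫⁻ x, ω x ^ (3 : ℝ) ∂μ) ^ (1 / 3 : ℝ) * μ Set.univ ^ (1 / (3 / 2) : ℝ)) ^ 3 =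
      μ Set.univ ^ 2 * ∫⁻ x, ω x ^ 3 ∂μ := by
    rw [mul_pow, mul_comm]
    congr 1
    · rw [← ENNReal.rpow_natCast, ← ENNReal.rpow_mul]
      norm_num
    · rw [show (1 / 3 : ℝ) = ((3 : ℕ) : ℝ)⁻¹ by norm_num, ENNReal.rpow_inv_natCast_pow three_ne_zero]
      simp_rw [show (3 : ℝ) = ((3 : ℕ) : ℝ) by norm_num, ENNReal.rpow_natCast]
  calc (∫⁻ x, ω x ∂μ) ^ 3
      ≤ ((∫⁻ x, ω x ^ (3 : ℝ) ∂μ) ^ (1 / 3 : ℝ) * μ Set.univ ^ (1 / (3 / 2) : ℝ)) ^ 3 :=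
        pow_le_pow_left₀ bot_le h 3
    _ = μ Set.univ ^ 2 * ∫⁻ x, ω x ^ 3 ∂μ := h3

/-- **Tightness of the three-moment method (single-mode saturation)**: for a one-atom measure
`μ = M δ_{ω₀}` (Feynman/Bogoliubov single-mode structure) `m₁³ = m₀² m₃` EXACTLY. So the Hölder step
loses nothing at Bogoliubov level and the method's output `|k|/√(|k|²+Θ)` cannot be improved by
re-using the same three moments: `Θ = O(ρ)` uniformly in `N` is NECESSARY for the intended proof
(not for the statement). [folklore] -/
theorem moment_method_tight_single_mode {α : Type*} [MeasurableSpace α] [MeasurableSingletonClass α]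
    (x₀ : α) (M ω₀ : ℝ≥0∞) :
    (∫⁻ x, (fun _ => ω₀) x ∂(M • Measure.dirac x₀)) ^ 3 =
      (M • Measure.dirac x₀) Set.univ ^ 2 * ∫⁻ x, (fun _ => ω₀) x ^ 3 ∂(M • Measure.dirac x₀) := by
  simp only [lintegral_const, Measure.smul_apply, measure_univ, smul_eq_mul, mul_one]
  ring


/-! ### Hard cores: the crux's inner hypotheses become jointly unsatisfiable (vacuity guard) -/

/-- Two points of the open box `(0, δ)³` are closer than `2δ`. [folklore] -/
theorem norm_sub_lt_of_mem_box {δ : ℝ} {x y : Space} (hx : x ∈ box δ) (hy : y ∈ box δ) :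
    ‖x - y‖ < 2 * δ := by
  have hδ : 0 < δ := by have := hx 0; exact this.1.trans this.2
  have hcoord : ∀ k, ‖(x - y) k‖ ^ 2 ≤ δ ^ 2 := by
    intro k
    have h1 := hx k; have h2 := hy k
    rw [PiLp.sub_apply, Real.norm_eq_abs, sq_abs]
    have : |x k - y k| ≤ δ := by
      rw [abs_sub_le_iff]; constructor <;> linarith [h1.1, h1.2, h2.1, h2.2]
    nlinarith [abs_nonneg (x k - y k), sq_abs (x k - y k)]
  have hsq : ‖x - y‖ ^ 2 < (2 * δ) ^ 2 := by
    rw [EuclideanSpace.norm_sq_eq]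
    calc ∑ k, ‖(x - y) k‖ ^ 2 ≤ ∑ _k : Fin 3, δ ^ 2 := Finset.sum_le_sum fun k _ => hcoord k
      _ = 3 * δ ^ 2 := by simp
      _ < (2 * δ) ^ 2 := by nlinarith
  exact lt_of_pow_lt_pow_left₀ 2 (by positivity) hsq

/-- **For a hard core the inner hypotheses of the crux are contradictory**: if `v = ⊤` on
`[0, R₀)` (`R₀ > 0`), every periodic trial state of `N ≥ 2` particles that is pointwise non-zero
has INFINITE periodic energy (the pair `(0,1)` sits inside the core on the small box `(0,δ)^{3N}`,
`δ = min L (R₀/2)`, of positive volume, where `|Ψ|² > 0`). [folklore] -/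
theorem periodicEnergy_eq_top_of_hardCore {N : ℕ} {L R₀ : ℝ} (hL : 0 < L) (hR : 0 < R₀)
    (hN : 2 ≤ N) {v : ℝ → ℝ≥0∞} (hv : ∀ r, 0 ≤ r → r < R₀ → v r = ⊤)
    (Ψ : PeriodicTrialState N L) (hΨ : ∀ X, Ψ.ψ X ≠ 0) : periodicEnergy v Ψ = ⊤ := by
  set δ : ℝ := min L (R₀ / 2) with hδ
  have hδpos : 0 < δ := lt_min hL (by positivity)
  have hδL : δ ≤ L := min_le_left _ _
  have hδR : 2 * δ ≤ R₀ := by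
    have := min_le_right L (R₀ / 2); linarith
  let i₀ : Fin N := ⟨0, by omega⟩
  let i₁ : Fin N := ⟨1, by omega⟩
  have hi : i₀ < i₁ := Fin.mk_lt_mk.2 zero_lt_one
  -- on the small box the interaction is `⊤`
  have hint : ∀ X ∈ boxN N δ, periodicInteraction v L X = ⊤ := by
    intro X hX
    have hclose : ‖X i₀ - X i₁‖ < R₀ :=
      (norm_sub_lt_of_mem_box (hX i₀) (hX i₁)).trans_le hδR
    have htop : periodizedPotential v L (X i₀ - X i₁) = ⊤ := by
      refine top_le_iff.1 ?_
      calc (⊤ : ℝ≥0∞) = v ‖X i₀ - X i₁‖ := (hv _ (norm_nonneg _) hclose).symm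
        _ ≤ periodizedPotential v L (X i₀ - X i₁) := le_periodizedPotential v L _
    refine top_le_iff.1 ?_
    calc (⊤ : ℝ≥0∞) = periodizedPotential v L (X i₀ - X i₁) := htop.symm
      _ ≤ ∑ j ∈ Finset.univ.filter (fun j => i₀ < j), periodizedPotential v L (X i₀ - X j) :=
          Finset.single_le_sum (f := fun j => periodizedPotential v L (X i₀ - X j))
            (fun _ _ => zero_le) (Finset.mem_filter.2 ⟨Finset.mem_univ _, hi⟩)
      _ ≤ periodicInteraction v L X :=
          Finset.single_le_sum
            (f := fun i => ∑ j ∈ Finset.univ.filter (fun j => i < j),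
              periodizedPotential v L (X i - X j))
            (fun _ _ => zero_le) (Finset.mem_univ i₀)
  -- hence the energy density is `⊤` there
  have hdens : ∀ X ∈ boxN N δ,
      kineticDensity Ψ.ψ X + periodicInteraction v L X * (‖Ψ.ψ X‖₊ : ℝ≥0∞) ^ 2 = ⊤ := by
    intro X hX
    rw [hint X hX, ENNReal.top_mul, add_top]
    exact pow_ne_zero 2 (by simpa using hΨ X)
  refine top_le_iff.1 ?_
  calc (⊤ : ℝ≥0∞) = ⊤ * volume (boxN N δ) := by
        rw [ENNReal.top_mul]
        rw [volume_boxN]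
        exact pow_ne_zero _ (pow_ne_zero _ (by simpa using hδpos))
    _ = ∫⁻ _X in boxN N δ, (⊤ : ℝ≥0∞) := (setLIntegral_const _ _).symm
    _ = ∫⁻ X in boxN N δ,
          kineticDensity Ψ.ψ X + periodicInteraction v L X * (‖Ψ.ψ X‖₊ : ℝ≥0∞) ^ 2 :=
        setLIntegral_congr_fun (measurableSet_boxN N δ) fun X hX => (hdens X hX).symm
    _ ≤ periodicEnergy v Ψ := lintegral_mono_set (boxN_subset_cellN hδL)

/-- **The finiteness hypothesis `∀ r, v r ≠ ⊤` is what keeps the crux non-vacuous**: for any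
potential with a hard core on `[0, R₀)` the WHOLE inner statement of `PuffFloor` holds trivially
(with `C = 0`, any `ρ₀`, all `n ≥ 1`), because `periodicEnergy v Ψ ≠ ⊤` and `∀ X, Ψ X ≠ 0` cannot
both hold. Consequence for planners: a `PuffFloor`-type statement extended verbatim to hard cores
(bypassing `HardCoreExtension`) would be provable for the wrong reason; positivity must then be
asked only off the core. [folklore] -/
theorem puffFloor_conclusion_vacuous_for_hardCore {v : ℝ → ℝ≥0∞} {R₀ : ℝ} (hR : 0 < R₀)
    (hv : ∀ r, 0 ≤ r → r < R₀ → v r = ⊤) :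
    ∃ C : ℝ, 0 ≤ C ∧ ∃ ρ₀ : ℝ, 0 < ρ₀ ∧ ∀ ρ : ℝ, 0 < ρ → ρ < ρ₀ →
      ∀ᶠ n : ℕ in Filter.atTop, ∀ Ψ : PeriodicTrialState (n + 1) (sideLength ρ (n + 1)),
        (let L : ℝ := sideLength ρ (n + 1)
         let S : (Fin 3 → ℤ) → ℝ := fun m => ((n : ℝ) + 1)⁻¹ *
           ∫ X in cellN (n + 1) L, ‖∑ j : Fin (n + 1), cellWave L m (X j)‖ ^ 2 * ‖Ψ.ψ X‖ ^ 2
         let kn : (Fin 3 → ℤ) → ℝ := fun m => ‖((2 * Real.pi / L) • latticeVec 1 m)‖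
         periodicEnergy v Ψ = periodicGroundStateEnergy v (n + 1) L → periodicEnergy v Ψ ≠ ⊤ →
           (∀ X, Ψ.ψ X = (‖Ψ.ψ X‖ : ℂ)) → (∀ X, Ψ.ψ X ≠ 0) →
           ∀ m : Fin 3 → ℤ, m ≠ 0 → kn m / Real.sqrt (kn m ^ 2 + C * ρ) ≤ S m) := by
  refine ⟨0, le_rfl, 1, one_pos, fun ρ hρ _ => ?_⟩
  filter_upwards [Filter.eventually_ge_atTop 1] with n hn Ψ
  intro L S kn _ hfin _ hne m _
  have hL : 0 < L := Real.rpow_pos_of_pos (by positivity) _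
  exact absurd (periodicEnergy_eq_top_of_hardCore hL hR (by omega) hv Ψ hne) hfin

/-! ## Cycle 3 (gen-3 seat, 2026-08-16)

### Targets — line `coupling-slope-pocket` (PICKED 02:34Z; gen-2 skeleton, 5 stubs)

Attack log (cheap arsenal: degenerate states, small clusters, hypothesis mutation, constant
re-derivation; `kit` not needed). No stub is misstated; the formal by-products follow this block.

* **S1 `stub_corePairDomination`** (hardest) — SURVIVES.
  - constant state `Ψ ≡ L⁻³`, `N = 2`: both sides exact (`pairCount_constState_two`,
    `coreEnergy_constState_two`): `|B̄_R| L⁻³ ≤ C · c₀ |B_{r₀}| L⁻³`, so every admissible constant has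
    `(R/r₀)³ ≤ C c₀` (`corePairDomination_ratio_le`) — Lee's `C = 8/A`, `A = min(E′,c₀)/(2M)`,
    `M = ⌈√3ℓ/r₀⌉³ ≥ (4√3 R/r₀)³` has exactly this shape; no `c₀`- or `R`-uniform domination exists,
    and the `k ≥ 2M` pigeonhole branch (the only place `c₀` enters) cannot be spared;
  - `c₀ = 0` (hypothesis `0 < c₀` weakened to `0 ≤ c₀`, all else byte for byte): FALSE
    (`corePairDomination_false_without_core`; RHS = kinetic energy = 0 for the constant state, LHS > 0).
    The positive core is load-bearing; the coreless class of S5 has no substitute lever;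
  - Jastrow-depleted homogeneous gas, `N → ∞` at density `ρ`: pairs `≈ ρN|B_R|/2`, energy
    `≈ 4πa(c₀,r₀)ρN` ⇒ ratio `|B_R|/(8πa)` bounded ✓ (Lee's two-body branch `E^Neu(2,Q_ℓ) ≥ E′ ≍ a/ℓ³`);
  - tight cluster of `k ≤ M ≍ (R/r₀)³` particles pairwise at distance `∈ (r₀, R]`: interaction `0`,
    pairs `k²/2`, localisation kinetic energy `≍ k/r₀²` ⇒ ratio `≲ k r₀² ≲ R³/r₀` bounded ✓; `N/k` such
    clusters scale both sides by `N/k` ✓; `k > M` forces core pairs by pigeonhole (pays `c₀` each) ✓;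
  - annulus two-body state (relative coordinate supported in `r₀ < |y| < R`): interaction `0`, pairs
    `1`, kinetic `≥ λ₁^Dir(annulus) > 0` ✓ — so the KINETIC term of the right-hand side is load-bearing as
    soon as `R > r₀`; FORMAL: `corePairDomination_false_without_kinetic` (S1 with the kinetic energy
    deleted is FALSE at `(c₀,r₀,R) = (1,1,2)`), witnessed by the smooth periodic SHELL STATE
    `Ψ ∝ g((c(y) − c₁)(c₂ − c(y)))`, `c(y) = Σₐcos(2πyₐ/L)` the lattice cosine, whose level shells are
    trapped between spheres around the lattice (`8d²/L² ≤ 3 − c ≤ 2π²d²/L²`, Kober) — a reusable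
    device for shell-localised periodic two-body witnesses;
  - NUDGE (from the constant-state computation): `periodicEnergy` is monotone in the profile, so S1 for
    core height `c₀` follows from S1 for `min c₀ c₁` with ANY smaller `c₁ > 0`; choosing
    `c₁ = π²/(16ℓ₀²)` makes Lee's two-body Neumann bound elementary — on `Q_ℓ²`, `ℓ ∈ [ℓ₀,2ℓ₀]`, write
    `ψ = α + φ`, `φ ⊥ 1`: `T ≥ (π²/ℓ²)‖φ‖²` (Neumann gap), `⟨ψ,Vψ⟩ ≥ ½α²V̄ - c₁‖φ‖²` (`0 ≤ V ≤ c₁`), hence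
    `E^Neu(2,Q_ℓ) ≥ ½V̄ ≥ c₁|B_{r₀}|/(16ℓ³)` with no Dyson lemma and no scattering length; the pigeonhole
    branch then runs with `c₁` too. (`corePairDomination_of_radius_lt_core`: for `R < r₀` S1 is trivial
    with the sharp `C = 1/c₀`; all content is `R > r₀`.)
  - statement audit: for `L ≥ L₀ > 2R` at most one image `q` is within `R` (`‖L(q-q′)‖ ≤ 2R < L ⇒ q = q′`);
    profiles are evaluated at norms only (the indicator on `Iio r₀` at negative reals is never read);
    `N = 0, 1`: no pairs, `0 ≤ …` ✓; quantifier order `∀ c₀ r₀ R ∃ C L₀ ∀ N L Ψ` = Lee's uniformity ✓.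
* **S2 `stub_pocketNoBinding_of_domination`** — SURVIVES; bookkeeping verified on paper:
  `ṽ(0) = (v 0).toReal > 0` (as `v 0 ≠ ⊤`, `0 < v 0`) and continuity of `ṽ` give `r₀` with
  `v ≥ (v₀/2)·1_{[0,r₀)}` on `[0,∞)`; `D²ṽ` continuous with compact support ⇒ `M₂ = sup ‖D²ṽ‖ < ∞`,
  `W ≤ R₀² M₂ 1_{B̄_{R₀}}` imagewise; `periodicEnergy` is monotone in the profile on `[0,∞)`;
  `t₀ = (C R₀² M₂ + 1)⁻¹`. Size M, no hidden analysis.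
* **S3 `stub_puffFeynmanFloor`** — SURVIVES. Constants re-derived this cycle, independently of the
  ideator/planner derivations: with `A = Σⱼ e^{ik·xⱼ}(|k|² + 2k·pⱼ)`, `p = -i∇`, `k = κẑ`,
  `u = κ² + 2κp_z`, `w = 2κp_z - κ²`: same-particle kinetic part of `[A†,[H,A]]` is
  `u³ - w³ = 2κ²(u² + uw + w²) = 24κ⁴p_z² + 2κ⁶` ⇒ `m₃ ⊃ N|k|⁶ + 12|k|²Σⱼ‖(k·∇ⱼ)Ψ‖²`; potential part
  `4κ²[Σⱼ V_{z_j z_j} + Σ_{l≠j} cos(κ z_{jl}) V_{z_j z_l}] = 8κ² Σ_{i<j}(1 - cos κz_{ij}) v_zz(x_{ij})` ⇒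
  `m₃ ⊃ 4Σ_{i<j} E[(1 - cos k·y)(k·∇)²ṽ^per(y)]`; the cross term `4iκ³Σⱼ⟨∂_{z_j}V⟩` vanishes by
  translation invariance of `V` (for every state, not only by the eigen-equation). Normalisation
  check: `kineticDensity = Σ_{j,a}|∂_{j,a}Ψ|²` (ℓ²-gradient, `BoseEinsteinCondensation.lean`), so
  `12|k|²Σ‖(k·∇ⱼ)Ψ‖² ≤ 12|k|⁴ T` ✓; `1 - cos θ ≤ θ²/2`, `|D²ṽ(z)(k,k)| ≤ ‖D²ṽ(z)‖ |k|²` ⇒ `2|k|⁴P` ✓;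
  Bogoliubov consistency (`Θ = 16πaρ` saturates) ✓. Hypothesis audit: needs `ContDiff ℝ 3`, exact
  minimality, reality — NOT `Ψ ≠ 0` ✓; all `n`, all `L > 0` ✓ (images termwise, `k·Lq ∈ 2πℤ`);
  `v ≡ 0`: `T = P = 0` and `S = 1` ✓; `n = 0`: `S = 1` ✓.
  SMALL-MODEL TEST (`n = 1`, the only computable interacting minimiser; `kit j012913`, script
  `toy/n2_s3_check.py`, split-step imaginary time with spectral kinetic symbol on `M³` grids,
  `v = A(1−r²)⁴₊`, `R₀ = 1`; at `N = 2`, `S_m = 1 + E[cos k·y]`, `T = 2∫|∇φ|²`, `P = E[W^per]`, and S3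
  reads `S_m ≥ k/√(k² + Θ)` with `Θ = 6T + P`): `(L, A) = (4, 50)`: `T = 0.0856`, `P = 2.199`,
  `Θ = 2.712`, lowest mode `S = 0.9425 ≥ 0.690`; the SHARPEST admissible `Θ* = max_m k²(S_m⁻² − 1)` is
  `0.310 = 0.114·Θ`; `(3, 50)`: `Θ*/Θ = 0.104`; `(4, 400)`: `0.079`; `(6, 50)` (`M = 60`): `0.125`; the
  slack `S_m − floor_m` is positive at EVERY mode `|mᵢ| ≤ M/6` in every case (minimum `≥ 1.1·10⁻³`, at
  the highest trusted modes where both sides `→ 1`); grid check `M = 48 → 64` at `(4, 50)` changes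
  nothing in five digits. So S3 holds at `N = 2` with an order of magnitude of room, and the room sits
  in Puff's bound of the potential part of `m₃` by `2|k|⁴P` (`P/6T ≈ 4–23`: the pair-weight term
  dominates `Θ` while the true cubic moment is `≈ 10×` below the bound) — information for the lead:
  `Θ = O(ρ)` through `P = O(ρN)` is sufficient with a wide margin, not a knife edge.
* **S4 `stub_minimiserRegularity`** — SURVIVES (true: weak EL against symmetric `C¹` tests + `Ψ ∈ C¹`,
  `V^per ∈ C² ⊂ C^{1,α}` locally finite ⇒ Schauder `C^{2,α}` then `C^{3,α}`; or 11787 + uniqueness: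
  for `Ψ, Ψ₀ > 0` minimisers `Φ = √((Ψ²+Ψ₀²)/2)` is an admissible `C¹` state with
  `E[Φ] = E₀ - ∫|Ψ₀∇Ψ - Ψ∇Ψ₀|²/(2(Ψ²+Ψ₀²))` ⇒ `Ψ = Ψ₀`). Not attackable.
* **S5 `stub_corelessPairMoment`** — OPEN residual (expected true: `g₂ ≈ f₀² ≤ 1`, `f₀` constant
  inside a hollow core; clustering costs `O(1)` kinetic energy per particle against `O(aρ)`); NEW: the
  family `{class ∧ v 0 = 0}` is NOT `{0}` (`hollowShell_mem_smoothClass` below), so S5 cannot be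
  discharged by `FreeGasModel`; its near-minimiser weakening is false (cycle-2 (i) design) but S5 keeps
  exact minimality. Disposition unchanged: tenure restatement `0 < v 0`.
-/

section Cycle3
open Metric
open scoped Polynomial

/-! ### (k) Non-vacuity: smooth-class inhabitants (landed copy: `Negative/SmoothClassInhabitants.lean`) -/

/-! ### The flat glue `g = expNegInvGlue`: closed forms of `g'`, `g''` and the bound `≤ 480 √g` -/

/-- `g' = t⁻² g` on all of `ℝ` (both sides vanish for `t ≤ 0`). [folklore] -/
theorem deriv_expNegInvGlue :
    deriv expNegInvGlue = fun t => t⁻¹ ^ 2 * expNegInvGlue t := by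
  funext t
  have h := expNegInvGlue.hasDerivAt_polynomial_eval_inv_mul (1 : ℝ[X]) t
  simp only [Polynomial.eval_one, one_mul, Polynomial.derivative_one, sub_zero, mul_one,
    Polynomial.eval_pow, Polynomial.eval_X] at h
  exact h.deriv

/-- `g'' = (t⁻⁴ - 2 t⁻³) g` on all of `ℝ`. [folklore] -/
theorem deriv_deriv_expNegInvGlue :
    deriv (fun t => t⁻¹ ^ 2 * expNegInvGlue t) = fun t => (t⁻¹ ^ 4 - 2 * t⁻¹ ^ 3) * expNegInvGlue t := by
  funext t
  have h := expNegInvGlue.hasDerivAt_polynomial_eval_inv_mul (Polynomial.X ^ 2 : ℝ[X]) t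
  simp only [Polynomial.eval_pow, Polynomial.eval_X] at h
  rw [h.deriv]
  simp only [Polynomial.derivative_X_pow, Polynomial.eval_mul, Polynomial.eval_pow,
    Polynomial.eval_X, Polynomial.eval_sub, Polynomial.eval_C, Nat.cast_ofNat]
  ring

/-- `iteratedDeriv 2 g = (t⁻⁴ - 2 t⁻³) g`. [folklore] -/
theorem iteratedDeriv_two_expNegInvGlue :
    iteratedDeriv 2 expNegInvGlue = fun t => (t⁻¹ ^ 4 - 2 * t⁻¹ ^ 3) * expNegInvGlue t := by
  rw [show (2 : ℕ) = 1 + 1 from rfl, iteratedDeriv_succ, iteratedDeriv_one, deriv_expNegInvGlue,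
    deriv_deriv_expNegInvGlue]

/-- For `t > 0`: `g t = s²` with `s = e^{-u}`, `u = t⁻¹/2 > 0`, and `√(g t) = s`. [folklore] -/
theorem expNegInvGlue_eq_sq {t : ℝ} (ht : 0 < t) :
    expNegInvGlue t = Real.exp (-(t⁻¹ / 2)) ^ 2 := by
  rw [expNegInvGlue, if_neg (not_le.2 ht), sq, ← Real.exp_add]
  congr 1; ring

/-- `√(g t) = e^{-u}`, `u = t⁻¹/2`, for `t > 0`. [folklore] -/
theorem sqrt_expNegInvGlue {t : ℝ} (ht : 0 < t) :
    Real.sqrt (expNegInvGlue t) = Real.exp (-(t⁻¹ / 2)) := by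
  rw [expNegInvGlue_eq_sq ht, Real.sqrt_sq (Real.exp_pos _).le]

/-- `uⁿ e^{-u} ≤ n!` for `u ≥ 0`. [folklore] -/
theorem pow_mul_exp_neg_le_factorial {u : ℝ} (hu : 0 ≤ u) (n : ℕ) :
    u ^ n * Real.exp (-u) ≤ n.factorial := by
  have h := Real.pow_div_factorial_le_exp u hu n
  have hf : (0 : ℝ) < n.factorial := by exact_mod_cast Nat.factorial_pos n
  rw [div_le_iff₀ hf] at h
  rw [Real.exp_neg, ← div_eq_mul_inv, div_le_iff₀ (Real.exp_pos u)]
  linarith [mul_comm (Real.exp u) (n.factorial : ℝ)]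

/-- `g ≤ √g` (since `0 ≤ g ≤ 1`). [folklore] -/
theorem expNegInvGlue_le_sqrt (t : ℝ) : expNegInvGlue t ≤ Real.sqrt (expNegInvGlue t) := by
  rcases le_or_gt t 0 with ht | ht
  · simp [expNegInvGlue.zero_of_nonpos ht]
  · rw [sqrt_expNegInvGlue ht, expNegInvGlue_eq_sq ht, sq]
    refine mul_le_of_le_one_left (Real.exp_pos _).le ?_
    rw [Real.exp_le_one_iff]
    have : 0 < t⁻¹ := inv_pos.2 ht
    linarith

/-- `|g'| = t⁻² g ≤ 8 √g`. [folklore] -/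
theorem abs_deriv_expNegInvGlue_le (t : ℝ) :
    |t⁻¹ ^ 2 * expNegInvGlue t| ≤ 8 * Real.sqrt (expNegInvGlue t) := by
  rcases le_or_gt t 0 with ht | ht
  · simp [expNegInvGlue.zero_of_nonpos ht]
  · set u : ℝ := t⁻¹ / 2 with hu
    have hu0 : 0 ≤ u := by positivity
    have ht' : t⁻¹ = 2 * u := by rw [hu]; ring
    rw [sqrt_expNegInvGlue ht, expNegInvGlue_eq_sq ht, ← hu, ht', abs_of_nonneg (by positivity)]
    have h2 := pow_mul_exp_neg_le_factorial hu0 2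
    simp only [Nat.factorial, Nat.succ_eq_add_one, Nat.reduceAdd, Nat.reduceMul, Nat.cast_ofNat] at h2
    have hs : 0 < Real.exp (-u) := Real.exp_pos _
    nlinarith [hs, h2]

/-- `|g''| = |t⁻⁴ - 2t⁻³| g ≤ 480 √g`. [folklore] -/
theorem abs_deriv_deriv_expNegInvGlue_le (t : ℝ) :
    |(t⁻¹ ^ 4 - 2 * t⁻¹ ^ 3) * expNegInvGlue t| ≤ 480 * Real.sqrt (expNegInvGlue t) := by
  rcases le_or_gt t 0 with ht | ht
  · simp [expNegInvGlue.zero_of_nonpos ht]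
  · set u : ℝ := t⁻¹ / 2 with hu
    have hu0 : 0 ≤ u := by positivity
    have ht' : t⁻¹ = 2 * u := by rw [hu]; ring
    rw [sqrt_expNegInvGlue ht, expNegInvGlue_eq_sq ht, ← hu, ht']
    have h3 := pow_mul_exp_neg_le_factorial hu0 3
    have h4 := pow_mul_exp_neg_le_factorial hu0 4
    simp only [Nat.factorial, Nat.succ_eq_add_one, Nat.reduceAdd, Nat.reduceMul, Nat.cast_ofNat,
      mul_one] at h3 h4
    have hs : 0 < Real.exp (-u) := Real.exp_pos _
    rw [abs_mul, abs_of_nonneg (sq_nonneg (Real.exp (-u)))]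
    have habs : |(2 * u) ^ 4 - 2 * (2 * u) ^ 3| ≤ 16 * u ^ 4 + 16 * u ^ 3 := by
      rw [abs_le]; constructor <;> nlinarith [pow_nonneg hu0 3, pow_nonneg hu0 4]
    calc |(2 * u) ^ 4 - 2 * (2 * u) ^ 3| * Real.exp (-u) ^ 2
        ≤ (16 * u ^ 4 + 16 * u ^ 3) * Real.exp (-u) ^ 2 :=
          mul_le_mul_of_nonneg_right habs (sq_nonneg _)
      _ = 16 * (u ^ 4 * Real.exp (-u)) * Real.exp (-u) + 16 * (u ^ 3 * Real.exp (-u)) * Real.exp (-u) := by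
          ring
      _ ≤ 16 * 24 * Real.exp (-u) + 16 * 6 * Real.exp (-u) := by
          gcongr
      _ = 480 * Real.exp (-u) := by ring

/-- **The flat glue has all derivatives of order `≤ 2` bounded by `480 √g`** — the one-dimensional
content of the edge condition `‖D²ṽ‖ ≤ Cₑ √ṽ` (zeros of infinite order are admissible edges).
[folklore] -/
theorem norm_iteratedFDeriv_expNegInvGlue_le {i : ℕ} (hi : i ≤ 2) (t : ℝ) :
    ‖iteratedFDeriv ℝ i expNegInvGlue t‖ ≤ 480 * Real.sqrt (expNegInvGlue t) := by
  rw [norm_iteratedFDeriv_eq_norm_iteratedDeriv, Real.norm_eq_abs]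
  have hsq : 0 ≤ Real.sqrt (expNegInvGlue t) := Real.sqrt_nonneg _
  interval_cases i
  · rw [iteratedDeriv_zero, abs_of_nonneg (expNegInvGlue.nonneg t)]
    linarith [expNegInvGlue_le_sqrt t]
  · rw [iteratedDeriv_one, deriv_expNegInvGlue]
    linarith [abs_deriv_expNegInvGlue_le t]
  · rw [iteratedDeriv_two_expNegInvGlue]
    exact abs_deriv_deriv_expNegInvGlue_le t

/-! ### The edge condition for `g ∘ f`, `f` any `C²` function non-positive off a ball -/

/-- **Edge condition for glued profiles.** If `f : ℝ³ → ℝ` is `C²` and `f ≤ 0` outside the ball of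
radius `R`, then `ṽ = g ∘ f` (`g = expNegInvGlue`) satisfies `‖D²ṽ(x)‖ ≤ Cₑ √ṽ(x)` for all `x`, for
some `Cₑ` (`= 960 B²`, `B` a bound for `max(1, ‖Df‖, ‖D²f‖)` on the closed ball). [folklore] -/
theorem exists_edgeConst_expNegInvGlue_comp {f : Space → ℝ} (hf : ContDiff ℝ 2 f) {R : ℝ}
    (hR : ∀ x : Space, R < ‖x‖ → f x ≤ 0) :
    ∃ Cₑ : ℝ, ∀ x : Space,
      ‖iteratedFDeriv ℝ 2 (fun x => expNegInvGlue (f x)) x‖ ≤ Cₑ * Real.sqrt (expNegInvGlue (f x)) := by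
  set D : Space → ℝ := fun x => max 1 (max ‖iteratedFDeriv ℝ 1 f x‖ ‖iteratedFDeriv ℝ 2 f x‖) with hD
  have h1 : Continuous fun x => iteratedFDeriv ℝ 1 f x :=
    hf.continuous_iteratedFDeriv (by exact_mod_cast (by norm_num : (1 : ℕ) ≤ 2))
  have h2 : Continuous fun x => iteratedFDeriv ℝ 2 f x :=
    hf.continuous_iteratedFDeriv (by exact_mod_cast (le_refl 2))
  have hDcont : Continuous D := continuous_const.max (h1.norm.max h2.norm)
  obtain ⟨B, hB⟩ := (isCompact_closedBall (0 : Space) R).exists_bound_of_continuousOn hDcont.continuousOn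
  have hg : ContDiff ℝ 2 expNegInvGlue := expNegInvGlue.contDiff (n := 2)
  refine ⟨2 * 480 * B ^ 2, fun x => ?_⟩
  have hD1 : 1 ≤ D x := le_max_left _ _
  have hcomp := norm_iteratedFDeriv_comp_le (g := expNegInvGlue) (f := f) (n := 2) hg hf le_rfl x
    (C := 480 * Real.sqrt (expNegInvGlue (f x))) (D := D x)
    (fun i hi => norm_iteratedFDeriv_expNegInvGlue_le hi (f x))
    (fun i hi1 hi2 => by
      interval_cases i
      · rw [pow_one]; exact (le_max_left _ _).trans (le_max_right _ _)
      · exact ((le_max_right _ _).trans (le_max_right _ _)).trans (le_self_pow₀ hD1 two_ne_zero))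
  have hfun : (expNegInvGlue ∘ f) = fun x => expNegInvGlue (f x) := rfl
  rw [hfun] at hcomp
  refine hcomp.trans ?_
  have hsq : 0 ≤ Real.sqrt (expNegInvGlue (f x)) := Real.sqrt_nonneg _
  rcases le_or_gt ‖x‖ R with hx | hx
  · have hxB : D x ≤ B := by
      have := hB x (by simpa using hx)
      rw [Real.norm_eq_abs, abs_of_nonneg (zero_le_one.trans hD1)] at this
      exact this
    have hB0 : 0 ≤ B := (zero_le_one.trans hD1).trans hxB
    have : D x ^ 2 ≤ B ^ 2 := pow_le_pow_left₀ (zero_le_one.trans hD1) hxB 2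
    calc ((2 : ℕ).factorial : ℝ) * (480 * Real.sqrt (expNegInvGlue (f x))) * D x ^ 2
        = (2 * 480 * D x ^ 2) * Real.sqrt (expNegInvGlue (f x)) := by
          simp [Nat.factorial]; ring
      _ ≤ (2 * 480 * B ^ 2) * Real.sqrt (expNegInvGlue (f x)) := by gcongr
  · have h0 : expNegInvGlue (f x) = 0 := expNegInvGlue.zero_of_nonpos (hR x hx)
    simp [h0]

/-! ### Radial glued profiles are smooth-class members -/

/-- The radial profile `v_P(r) = g(P(r²))` of a `C²` "shape function" `P : ℝ → ℝ`. [folklore] -/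
def glueProfile (P : ℝ → ℝ) : ℝ → ℝ≥0∞ := fun r => ENNReal.ofReal (expNegInvGlue (P (r ^ 2)))

/-- `ṽ_P(x) = g(P(|x|²))`. [folklore] -/
theorem glueProfile_toReal (P : ℝ → ℝ) (x : Space) :
    (glueProfile P ‖x‖).toReal = expNegInvGlue (P (‖x‖ ^ 2)) :=
  ENNReal.toReal_ofReal (expNegInvGlue.nonneg _)

/-- `ṽ_P = g ∘ (P(|·|²))` as functions. [folklore] -/
theorem glueProfile_toReal_funext (P : ℝ → ℝ) :
    (fun x : Space => (glueProfile P ‖x‖).toReal) = fun x : Space => expNegInvGlue (P (‖x‖ ^ 2)) :=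
  funext (glueProfile_toReal P)

/-- **Glued radial profiles lie in the smooth class of `PuffFloor`.** For a `C²` shape function `P`
with `P(r²) ≤ 0` for `r > R`, `v = g(P(r²))` is repulsive of finite range,
finite, `C²` as `x ↦ v(|x|)`, and satisfies the edge condition. [folklore] -/
theorem glueProfile_mem_smoothClass {P : ℝ → ℝ} (hP : ContDiff ℝ 2 P) {R : ℝ}
    (hR : ∀ r, R < r → P (r ^ 2) ≤ 0) :
    IsRepulsiveFiniteRange (glueProfile P) ∧ (∀ r, glueProfile P r ≠ ⊤) ∧
      ContDiff ℝ 2 (fun x : Space => (glueProfile P ‖x‖).toReal) ∧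
      ∃ Cₑ : ℝ, ∀ x : Space, ‖iteratedFDeriv ℝ 2 (fun x : Space => (glueProfile P ‖x‖).toReal) x‖ ≤
        Cₑ * Real.sqrt ((glueProfile P ‖x‖).toReal) := by
  have hf : ContDiff ℝ 2 (fun x : Space => P (‖x‖ ^ 2)) := hP.comp (contDiff_norm_sq ℝ)
  refine ⟨⟨?_, R, fun r hr => ?_⟩, fun r => ENNReal.ofReal_ne_top, ?_, ?_⟩
  · -- measurable: continuous
    refine Continuous.measurable ?_
    exact ENNReal.continuous_ofReal.comp
      (expNegInvGlue.contDiff (n := 0)).continuous |>.comp (hP.continuous.comp (continuous_pow 2))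
  · simp [glueProfile, expNegInvGlue.zero_of_nonpos (hR r hr)]
  · rw [glueProfile_toReal_funext]
    exact (expNegInvGlue.contDiff (n := 2)).comp hf
  · obtain ⟨Cₑ, hC⟩ := exists_edgeConst_expNegInvGlue_comp hf (R := R) (fun x hx => hR ‖x‖ hx)
    refine ⟨Cₑ, fun x => ?_⟩
    rw [glueProfile_toReal_funext, glueProfile_toReal]
    exact hC x

/-! ### Instance 1: the solid bump `v(r) = g(R₀² - r²)` — positive soft core -/

/-- The solid soft-core bump of range `R₀`: `v(r) = e^{-1/(R₀² - r²)}` for `r < R₀`, `0` beyond.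
[folklore] -/
def solidBump (R₀ : ℝ) : ℝ → ℝ≥0∞ := glueProfile fun s => R₀ ^ 2 - s

/-- **The smooth class contains a genuinely interacting potential with a positive soft core.**
For `R₀ > 0`, `solidBump R₀` satisfies all four class hypotheses of `PuffFloor`, has `0 < v 0`
(the main branch of `Lines/coupling-slope-pocket.lean`, stubs S1–S2) and is not the zero potential:
the crux is not settled by the free-gas model (`puffFloor_holds_at_freeGas`). [folklore] -/
theorem solidBump_mem_smoothClass {R₀ : ℝ} (hR₀ : 0 < R₀) :
    IsRepulsiveFiniteRange (solidBump R₀) ∧ (∀ r, solidBump R₀ r ≠ ⊤) ∧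
      ContDiff ℝ 2 (fun x : Space => (solidBump R₀ ‖x‖).toReal) ∧
      (∃ Cₑ : ℝ, ∀ x : Space, ‖iteratedFDeriv ℝ 2 (fun x : Space => (solidBump R₀ ‖x‖).toReal) x‖ ≤
        Cₑ * Real.sqrt ((solidBump R₀ ‖x‖).toReal)) ∧
      0 < solidBump R₀ 0 ∧ solidBump R₀ ≠ 0 := by
  have hP : ContDiff ℝ 2 (fun s : ℝ => R₀ ^ 2 - s) := contDiff_const.sub contDiff_id
  have hR : ∀ r, R₀ < r → (fun s : ℝ => R₀ ^ 2 - s) (r ^ 2) ≤ 0 := by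
    intro r hr
    have : R₀ ^ 2 < r ^ 2 := by nlinarith
    simp only; linarith
  obtain ⟨h1, h2, h3, h4⟩ := glueProfile_mem_smoothClass hP hR
  have h0 : 0 < solidBump R₀ 0 := by
    change 0 < ENNReal.ofReal (expNegInvGlue (R₀ ^ 2 - 0 ^ 2))
    rw [ENNReal.ofReal_pos]
    exact expNegInvGlue.pos_of_pos (by norm_num; positivity)
  refine ⟨h1, h2, h3, h4, h0, fun h => ?_⟩
  rw [h] at h0
  exact lt_irrefl _ h0

/-! ### Instance 2: the hollow shell `v(r) = g((r² - r₁²)(R₀² - r²))` — coreless, not zero -/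

/-- The hollow soft shell supported on `r₁ ≤ r ≤ R₀`: `v(r) = g((r² - r₁²)(R₀² - r²))`; particles
closer than `r₁` do not interact. [folklore] -/
def hollowShell (r₁ R₀ : ℝ) : ℝ → ℝ≥0∞ := glueProfile fun s => (s - r₁ ^ 2) * (R₀ ^ 2 - s)

/-- **The coreless part of the smooth class is not reduced to `v ≡ 0`.** For `0 < r₁ < R₀`,
`hollowShell r₁ R₀` satisfies all four class hypotheses of `PuffFloor`, has `v 0 = 0` — indeed
`v r = 0` for every `r ≤ r₁` — and is not the zero potential (`v((r₁+R₀)/2…) ≠ 0` at `r² =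
(r₁²+R₀²)/2`). Hence the scope-residual stub `stub_corelessPairMoment` (S5 of
`Lines/coupling-slope-pocket.lean` = `Lines/sacrificial-edge-layer.lean`) is a statement about exact
minimisers of genuinely interacting coreless potentials: it is NOT dischargeable by `FreeGasModel`,
and the recommended restatement of the class with `0 < v 0` excludes a non-empty admissible family.
[folklore] -/
theorem hollowShell_mem_smoothClass {r₁ R₀ : ℝ} (hr₁ : 0 < r₁) (hR : r₁ < R₀) :
    IsRepulsiveFiniteRange (hollowShell r₁ R₀) ∧ (∀ r, hollowShell r₁ R₀ r ≠ ⊤) ∧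
      ContDiff ℝ 2 (fun x : Space => (hollowShell r₁ R₀ ‖x‖).toReal) ∧
      (∃ Cₑ : ℝ, ∀ x : Space,
        ‖iteratedFDeriv ℝ 2 (fun x : Space => (hollowShell r₁ R₀ ‖x‖).toReal) x‖ ≤
          Cₑ * Real.sqrt ((hollowShell r₁ R₀ ‖x‖).toReal)) ∧
      (∀ r, |r| ≤ r₁ → hollowShell r₁ R₀ r = 0) ∧
      hollowShell r₁ R₀ (Real.sqrt ((r₁ ^ 2 + R₀ ^ 2) / 2)) ≠ 0 := by
  have hR₀ : 0 < R₀ := hr₁.trans hR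
  have hP : ContDiff ℝ 2 (fun s : ℝ => (s - r₁ ^ 2) * (R₀ ^ 2 - s)) :=
    (contDiff_id.sub contDiff_const).mul (contDiff_const.sub contDiff_id)
  have hRr : ∀ r, R₀ < r → (fun s : ℝ => (s - r₁ ^ 2) * (R₀ ^ 2 - s)) (r ^ 2) ≤ 0 := by
    intro r hr
    have h1 : R₀ ^ 2 < r ^ 2 := by nlinarith
    have h2 : r₁ ^ 2 < r ^ 2 := by nlinarith
    simp only
    nlinarith
  obtain ⟨h1, h2, h3, h4⟩ := glueProfile_mem_smoothClass hP hRr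
  refine ⟨h1, h2, h3, h4, fun r hr => ?_, ?_⟩
  · simp only [hollowShell, glueProfile, ENNReal.ofReal_eq_zero]
    refine le_of_eq (expNegInvGlue.zero_of_nonpos ?_)
    have hr2 : r ^ 2 ≤ r₁ ^ 2 := by
      rw [← sq_abs r]; exact pow_le_pow_left₀ (abs_nonneg r) hr 2
    have hR2 : r ^ 2 < R₀ ^ 2 := lt_of_le_of_lt hr2 (by nlinarith)
    nlinarith
  · simp only [hollowShell, glueProfile, ne_eq, ENNReal.ofReal_eq_zero, not_le]
    refine expNegInvGlue.pos_of_pos ?_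
    rw [Real.sq_sqrt (by positivity)]
    have : r₁ ^ 2 < R₀ ^ 2 := by nlinarith
    nlinarith


/-! ### (d) Target S1 at the constant state (landed copy: `Negative/CorePairDominationConstState.lean`) -/

/-! ### The constant periodic trial state `Ψ ≡ (L³)^{-N/2}` -/

/-- The amplitude `(L³)^{-N/2}` of the normalised constant state. [folklore] -/
def constAmp (N : ℕ) (L : ℝ) : ℝ := (Real.sqrt ((L ^ 3) ^ N))⁻¹

/-- `|(L³)^{-N/2}|² = (L³)^{-N}` in `ℝ≥0∞`. [folklore] -/
theorem nnnorm_constAmp_sq (hL : 0 < L) :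
    ((‖(constAmp N L : ℂ)‖₊ : ℝ≥0∞) ^ 2) = ENNReal.ofReal ((L ^ 3) ^ N)⁻¹ := by
  have hApos : 0 < (L ^ 3) ^ N := by positivity
  rw [← ENNReal.coe_pow, ENNReal.ofReal, ENNReal.coe_inj]
  ext
  rw [NNReal.coe_pow, coe_nnnorm, Complex.norm_real, constAmp, norm_inv,
    Real.norm_of_nonneg (Real.sqrt_nonneg _), inv_pow, Real.sq_sqrt hApos.le,
    Real.coe_toNNReal _ (by positivity)]

/-- **The constant state** `Ψ ≡ (L³)^{-N/2}` on the torus of side `L > 0` (zero kinetic energy; the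
free-gas minimiser). [folklore] -/
def constState (N : ℕ) (hL : 0 < L) : PeriodicTrialState N L where
  ψ := fun _ => (constAmp N L : ℂ)
  contDiff := contDiff_const
  periodic := fun _ _ _ => rfl
  symm := fun _ _ => rfl
  norm_eq := by
    have hApos : 0 < (L ^ 3) ^ N := by positivity
    have hvolA : (ENNReal.ofReal L ^ 3) ^ N = ENNReal.ofReal ((L ^ 3) ^ N) := by
      rw [← ENNReal.ofReal_pow hL.le, ← ENNReal.ofReal_pow (by positivity)]
    rw [setLIntegral_const, volume_cellN, nnnorm_constAmp_sq hL, hvolA,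
      ← ENNReal.ofReal_mul (inv_nonneg.2 hApos.le), inv_mul_cancel₀ hApos.ne', ENNReal.ofReal_one]

/-- The constant state's value. [folklore] -/
@[simp] theorem constState_apply (hL : 0 < L) (X : Config N) :
    (constState N hL).ψ X = (constAmp N L : ℂ) := rfl

/-- A constant function has zero kinetic energy density. [folklore] -/
theorem kineticDensity_const (c : ℂ) (X : Config N) :
    kineticDensity (fun _ : Config N => c) X = 0 := by
  simp [kineticDensity]

/-- The expectation of a pair functional `∑_{i<j} w^per` in the constant state is its cell average:
`∫_{cell^N} (∑ w^per)·|Ψ|² = (L³)^{-N} ∫_{cell^N} ∑ w^per`. [folklore] -/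
theorem pairExpectation_constState (w : ℝ → ℝ≥0∞) (hL : 0 < L) :
    (∫⁻ X in cellN N L, periodicInteraction w L X * (‖(constState N hL).ψ X‖₊ : ℝ≥0∞) ^ 2) =
      (∫⁻ X in cellN N L, periodicInteraction w L X) * ENNReal.ofReal ((L ^ 3) ^ N)⁻¹ := by
  rw [← lintegral_mul_const' _ _ ENNReal.ofReal_ne_top]
  refine lintegral_congr fun X => ?_
  rw [constState_apply, nnnorm_constAmp_sq hL]

/-- The energy of the constant state is its (cell-averaged) interaction: no kinetic energy.
[folklore] -/
theorem periodicEnergy_constState (w : ℝ → ℝ≥0∞) (hL : 0 < L) :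
    periodicEnergy w (constState N hL) =
      (∫⁻ X in cellN N L, periodicInteraction w L X) * ENNReal.ofReal ((L ^ 3) ^ N)⁻¹ := by
  rw [← pairExpectation_constState w hL]
  unfold periodicEnergy
  refine lintegral_congr fun X => ?_
  change kineticDensity (fun _ : Config N => (constAmp N L : ℂ)) X + _ = _
  rw [kineticDensity_const, zero_add]

/-! ### Two particles: unfolding the periodisation on the cell -/

/-- The periodisation of a measurable profile is measurable. [folklore] -/
private theorem measurable_periodizedPotential' {w : ℝ → ℝ≥0∞} (hw : Measurable w) (L : ℝ) :
    Measurable (periodizedPotential w L) := by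
  unfold periodizedPotential
  exact Measurable.tsum fun n => hw.comp (measurable_id.sub_const _).norm

/-- `∫_{cell^{n+1}} w^per(xᵢ - xⱼ) dX = (∫_{ℝ³} w(|y|)dy) · L^{3n}` for `i ≠ j` (slice integration in
`xᵢ`, unfolding of the periodisation on the cell). Adapted verbatim from the line skeleton
`Lines/coupling-slope-pocket.lean` §EnergyUpperBound (itself from `Lines/sacrificial-edge-layer.lean`).
[folklore] -/
theorem lintegral_cellN_periodizedPotential_pair {w : ℝ → ℝ≥0∞} (hw : Measurable w) (hL : 0 < L)
    {n : ℕ} {i j : Fin (n + 1)} (hij : i ≠ j) :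
    ∫⁻ X in cellN (n + 1) L, periodizedPotential w L (X i - X j) =
      (∫⁻ x : Space, w ‖x‖) * (ENNReal.ofReal L ^ 3) ^ n := by
  have hH : Measurable fun X : Config (n + 1) => periodizedPotential w L (X i - X j) :=
    (measurable_periodizedPotential' hw L).comp ((measurable_pi_apply i).sub (measurable_pi_apply j))
  have key := lintegral_cellN_lintegral_update (L := L) i hH
  have hinner : ∀ X : Config (n + 1),
      (∫⁻ x in cell L, periodizedPotential w L (Function.update X i x i - Function.update X i x j)) =
        ∫⁻ y : Space, w ‖y‖ := by
    intro X
    simp only [Function.update_self, Function.update_of_ne hij.symm]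
    exact lintegral_cell_periodizedPotential_sub hL hw (X j)
  simp only [hinner] at key
  rw [setLIntegral_const, volume_cellN, pow_succ, ← mul_assoc] at key
  have hV0 : (ENNReal.ofReal L ^ 3) ≠ 0 := pow_ne_zero _ ((ENNReal.ofReal_pos.2 hL).ne')
  have hVt : (ENNReal.ofReal L ^ 3) ≠ ⊤ := ENNReal.pow_ne_top ENNReal.ofReal_ne_top
  have key' : (ENNReal.ofReal L ^ 3) * ((∫⁻ y : Space, w ‖y‖) * (ENNReal.ofReal L ^ 3) ^ n) =
      (ENNReal.ofReal L ^ 3) * ∫⁻ X in cellN (n + 1) L, periodizedPotential w L (X i - X j) := by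
    rw [← key]; ring
  exact ((ENNReal.mul_right_inj hV0 hVt).1 key').symm

/-- For two particles the interaction has the single term `w^per(x₀ - x₁)`. [folklore] -/
theorem periodicInteraction_two (w : ℝ → ℝ≥0∞) (L : ℝ) (X : Config 2) :
    periodicInteraction w L X = periodizedPotential w L (X 0 - X 1) := by
  have h0 : (Finset.univ.filter fun j : Fin 2 => (0 : Fin 2) < j) = {1} := by decide
  have h1 : (Finset.univ.filter fun j : Fin 2 => (1 : Fin 2) < j) = ∅ := by decide
  rw [periodicInteraction, Fin.sum_univ_two, h0, h1, Finset.sum_singleton, Finset.sum_empty, add_zero]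

/-- `∫_{cell²} w^per(x₀ - x₁) = (∫_{ℝ³} w(|y|) dy) · L³`. [folklore] -/
theorem lintegral_cellN_two_periodicInteraction {w : ℝ → ℝ≥0∞} (hw : Measurable w) (hL : 0 < L) :
    ∫⁻ X in cellN 2 L, periodicInteraction w L X = (∫⁻ y : Space, w ‖y‖) * ENNReal.ofReal L ^ 3 := by
  simp_rw [periodicInteraction_two]
  have h := lintegral_cellN_periodizedPotential_pair (n := 1) (i := 0) (j := 1) hw hL (by decide)
  rw [pow_one] at h
  exact h

/-! ### The two radial integrals: `∫ 1{|y| ≤ R} = |B̄_R|`, `∫ c₀ 1{|y| < r₀} = c₀ |B_{r₀}|` -/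

/-- `∫_{ℝ³} 1{|y| ≤ R} dy = |B̄_R|`. [folklore] -/
theorem lintegral_indicator_Iic_norm (R : ℝ) :
    ∫⁻ y : Space, Set.indicator (Set.Iic R) (fun _ : ℝ => (1 : ℝ≥0∞)) ‖y‖ =
      volume (closedBall (0 : Space) R) := by
  rw [← lintegral_indicator_one measurableSet_closedBall]
  refine lintegral_congr fun y => ?_
  by_cases hy : ‖y‖ ≤ R
  · rw [Set.indicator_of_mem (show ‖y‖ ∈ Set.Iic R from hy),
      Set.indicator_of_mem (mem_closedBall_zero_iff.2 hy), Pi.one_apply]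
  · rw [Set.indicator_of_notMem (show ‖y‖ ∉ Set.Iic R from hy),
      Set.indicator_of_notMem (fun h => hy (mem_closedBall_zero_iff.1 h))]

/-- `∫_{ℝ³} c·1{|y| < r₀} dy = c |B_{r₀}|`. [folklore] -/
theorem lintegral_indicator_Iio_norm (r₀ : ℝ) (c : ℝ≥0∞) :
    ∫⁻ y : Space, Set.indicator (Set.Iio r₀) (fun _ : ℝ => c) ‖y‖ = c * volume (ball (0 : Space) r₀) := by
  rw [← lintegral_indicator_const measurableSet_ball]
  refine lintegral_congr fun y => ?_
  by_cases hy : ‖y‖ < r₀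
  · rw [Set.indicator_of_mem (show ‖y‖ ∈ Set.Iio r₀ from hy),
      Set.indicator_of_mem (mem_ball_zero_iff.2 hy)]
  · rw [Set.indicator_of_notMem (show ‖y‖ ∉ Set.Iio r₀ from hy),
      Set.indicator_of_notMem (fun h => hy (mem_ball_zero_iff.1 h))]

/-- Indicator profiles are measurable. [folklore] -/
theorem measurable_indicator_const' (s : Set ℝ) (hs : MeasurableSet s) (c : ℝ≥0∞) :
    Measurable (Set.indicator s (fun _ : ℝ => c)) :=
  measurable_const.indicator hs

/-! ### Both sides of S1 at the constant two-particle state -/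

/-- **Pair count of the constant state**: `E[#pairs at periodic distance ≤ R] = |B̄_R| · L³ · L⁻⁶`.
[folklore] -/
theorem pairCount_constState_two (hL : 0 < L) (R : ℝ) :
    (∫⁻ X in cellN 2 L,
        periodicInteraction (Set.indicator (Set.Iic R) (fun _ : ℝ => (1 : ℝ≥0∞))) L X *
          (‖(constState 2 hL).ψ X‖₊ : ℝ≥0∞) ^ 2) =
      volume (closedBall (0 : Space) R) * ENNReal.ofReal L ^ 3 * ENNReal.ofReal ((L ^ 3) ^ 2)⁻¹ := by
  rw [pairExpectation_constState _ hL,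
    lintegral_cellN_two_periodicInteraction (measurable_indicator_const' _ measurableSet_Iic _) hL,
    lintegral_indicator_Iic_norm]

/-- **Core energy of the constant state**: `⟨Ψ, H(c₀1_{[0,r₀)}) Ψ⟩ = c₀ |B_{r₀}| · L³ · L⁻⁶`.
[folklore] -/
theorem coreEnergy_constState_two (hL : 0 < L) (r₀ c₀ : ℝ) :
    periodicEnergy (Set.indicator (Set.Iio r₀) (fun _ : ℝ => ENNReal.ofReal c₀)) (constState 2 hL) =
      ENNReal.ofReal c₀ * volume (ball (0 : Space) r₀) * ENNReal.ofReal L ^ 3 *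
        ENNReal.ofReal ((L ^ 3) ^ 2)⁻¹ := by
  rw [periodicEnergy_constState _ hL,
    lintegral_cellN_two_periodicInteraction (measurable_indicator_const' _ measurableSet_Iio _) hL,
    lintegral_indicator_Iio_norm]

/-- **The constant-state test of S1.** If the close-pair domination inequality of
`stub_corePairDomination` holds with constant `C` for the constant two-particle state on ONE torus
of side `L > 0`, then `|B̄_R| ≤ C c₀ |B_{r₀}|`. [folklore] -/
theorem corePairDomination_constState_necessary {c₀ r₀ R C : ℝ} (hL : 0 < L) (hC : 0 ≤ C)
    (h : (∫⁻ X in cellN 2 L,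
        periodicInteraction (Set.indicator (Set.Iic R) (fun _ : ℝ => (1 : ℝ≥0∞))) L X *
          (‖(constState 2 hL).ψ X‖₊ : ℝ≥0∞) ^ 2) ≤
        ENNReal.ofReal C *
          periodicEnergy (Set.indicator (Set.Iio r₀) (fun _ : ℝ => ENNReal.ofReal c₀)) (constState 2 hL)) :
    volume (closedBall (0 : Space) R) ≤ ENNReal.ofReal (C * c₀) * volume (ball (0 : Space) r₀) := by
  rw [pairCount_constState_two, coreEnergy_constState_two] at h
  set K : ℝ≥0∞ := ENNReal.ofReal L ^ 3 * ENNReal.ofReal ((L ^ 3) ^ 2)⁻¹ with hK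
  have hK0 : K ≠ 0 := by
    refine mul_ne_zero (pow_ne_zero _ ((ENNReal.ofReal_pos.2 hL).ne')) ?_
    rw [ne_eq, ENNReal.ofReal_eq_zero, not_le]
    positivity
  have hKt : K ≠ ⊤ := ENNReal.mul_ne_top (ENNReal.pow_ne_top ENNReal.ofReal_ne_top) ENNReal.ofReal_ne_top
  have h' : volume (closedBall (0 : Space) R) * K ≤
      (ENNReal.ofReal (C * c₀) * volume (ball (0 : Space) r₀)) * K := by
    calc volume (closedBall (0 : Space) R) * K
        = volume (closedBall (0 : Space) R) * ENNReal.ofReal L ^ 3 * ENNReal.ofReal ((L ^ 3) ^ 2)⁻¹ := by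
          rw [hK, mul_assoc]
      _ ≤ _ := h
      _ = (ENNReal.ofReal (C * c₀) * volume (ball (0 : Space) r₀)) * K := by
          rw [ENNReal.ofReal_mul hC, hK]; ring
  exact (ENNReal.mul_le_mul_iff_left hK0 hKt).1 h'

/-! ### Consequence 1: the admissible constant is at least `(R/r₀)³ / c₀` -/

/-- **Tight parameter dependence of S1.** Every pair `(C, L₀)` admissible in
`stub_corePairDomination` for core height `c₀ > 0`, core radius `r₀ > 0`, counting radius `R > 0`
satisfies `(R/r₀)³ ≤ C · c₀`. [folklore] -/
theorem corePairDomination_ratio_le {c₀ r₀ R C L₀ : ℝ} (hc₀ : 0 < c₀) (hr₀ : 0 < r₀) (hR : 0 < R)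
    (hC : 0 ≤ C) (hL₀ : 0 < L₀)
    (h : ∀ N : ℕ, ∀ L : ℝ, L₀ ≤ L → ∀ Ψ : PeriodicTrialState N L,
      (∫⁻ X in cellN N L,
          periodicInteraction (Set.indicator (Set.Iic R) (fun _ : ℝ => (1 : ℝ≥0∞))) L X *
            (‖Ψ.ψ X‖₊ : ℝ≥0∞) ^ 2) ≤
        ENNReal.ofReal C *
          periodicEnergy (Set.indicator (Set.Iio r₀) (fun _ : ℝ => ENNReal.ofReal c₀)) Ψ) :
    (R / r₀) ^ 3 ≤ C * c₀ := by
  have key := corePairDomination_constState_necessary hL₀ hC (h 2 L₀ le_rfl (constState 2 hL₀))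
  have hdim : Module.finrank ℝ Space = 3 := finrank_euclideanSpace_fin
  rw [Measure.addHaar_closedBall _ _ hR.le, Measure.addHaar_ball _ _ hr₀.le, hdim] at key
  have hB0 : volume (ball (0 : Space) 1) ≠ 0 := (measure_ball_pos volume (0 : Space) one_pos).ne'
  have hBt : volume (ball (0 : Space) 1) ≠ ⊤ := measure_ball_lt_top.ne
  rw [← mul_assoc, ENNReal.mul_le_mul_iff_left hB0 hBt, ← ENNReal.ofReal_mul (by positivity),
    ENNReal.ofReal_le_ofReal_iff (by positivity)] at key
  rw [div_pow, div_le_iff₀ (by positivity)]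
  linarith

/-! ### Consequence 2: without a positive core S1 is false -/

/-- `stub_corePairDomination` of `Lines/coupling-slope-pocket.lean` with the hypothesis `0 < c₀`
WEAKENED to `0 ≤ c₀`; everything else byte for byte. -/
def CorePairDominationWithoutCore : Prop :=
  ∀ c₀ r₀ R : ℝ, 0 ≤ c₀ → 0 < r₀ → 0 < R →
    ∃ C L₀ : ℝ, 0 ≤ C ∧ 0 < L₀ ∧ ∀ N : ℕ, ∀ L : ℝ, L₀ ≤ L → ∀ Ψ : PeriodicTrialState N L,
      (∫⁻ X in cellN N L,
          periodicInteraction (Set.indicator (Set.Iic R) (fun _ : ℝ => (1 : ℝ≥0∞))) L X *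
            (‖Ψ.ψ X‖₊ : ℝ≥0∞) ^ 2) ≤
        ENNReal.ofReal C *
          periodicEnergy (Set.indicator (Set.Iio r₀) (fun _ : ℝ => ENNReal.ofReal c₀)) Ψ

/-- **The positive core is load-bearing in S1**: at `c₀ = 0` the right-hand side is `C` times the
kinetic energy, the constant two-particle state has none, yet it has `|B̄_R|/L³ > 0` expected close
pairs. So `CorePairDominationWithoutCore` is false; any proof of S1 must use `0 < c₀` (Lee's
pigeonhole branch `k ≥ 2M`), and nothing of the kind is available on the coreless class of S5.
[folklore] -/
theorem corePairDomination_false_without_core : ¬ CorePairDominationWithoutCore := by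
  intro h
  obtain ⟨C, L₀, hC, hL₀, h⟩ := h 0 1 1 le_rfl one_pos one_pos
  have key := corePairDomination_constState_necessary hL₀ hC (h 2 L₀ le_rfl (constState 2 hL₀))
  rw [mul_zero, ENNReal.ofReal_zero, zero_mul, nonpos_iff_eq_zero] at key
  exact (measure_closedBall_pos volume (0 : Space) one_pos).ne' key


/-! ### Consequence 3: for `R < r₀` S1 is trivial with the constant `1/c₀` — the bound above is sharp -/

/-- Pointwise: `1{r ≤ R} ≤ c₀⁻¹ · (c₀ 1{r < r₀})` when `R < r₀`, `c₀ > 0`. [folklore] -/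
theorem indicator_Iic_le_inv_mul_indicator_Iio {c₀ r₀ R : ℝ} (hc₀ : 0 < c₀) (hR : R < r₀) (r : ℝ) :
    Set.indicator (Set.Iic R) (fun _ : ℝ => (1 : ℝ≥0∞)) r ≤
      (ENNReal.ofReal c₀)⁻¹ * Set.indicator (Set.Iio r₀) (fun _ : ℝ => ENNReal.ofReal c₀) r := by
  by_cases hr : r ≤ R
  · have hr' : r ∈ Set.Iio r₀ := lt_of_le_of_lt hr hR
    rw [Set.indicator_of_mem (show r ∈ Set.Iic R from hr), Set.indicator_of_mem hr',
      ENNReal.inv_mul_cancel (by simpa using hc₀) ENNReal.ofReal_ne_top]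
  · rw [Set.indicator_of_notMem (show r ∉ Set.Iic R from hr)]
    exact zero_le

/-- The periodisation is monotone and commutes with constant factors: if `w ≤ c · u` pointwise then
`w^per ≤ c · u^per`. [folklore] -/
theorem periodizedPotential_le_const_mul {w u : ℝ → ℝ≥0∞} {c : ℝ≥0∞} (h : ∀ r, w r ≤ c * u r)
    (L : ℝ) (y : Space) : periodizedPotential w L y ≤ c * periodizedPotential u L y := by
  unfold periodizedPotential
  rw [← ENNReal.tsum_mul_left]
  exact ENNReal.tsum_le_tsum fun n => h _

/-- Same for the pair sum `∑_{i<j}`. [folklore] -/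
theorem periodicInteraction_le_const_mul {w u : ℝ → ℝ≥0∞} {c : ℝ≥0∞} (h : ∀ r, w r ≤ c * u r)
    (L : ℝ) (X : Config N) : periodicInteraction w L X ≤ c * periodicInteraction u L X := by
  unfold periodicInteraction
  rw [Finset.mul_sum]
  refine Finset.sum_le_sum fun i _ => ?_
  rw [Finset.mul_sum]
  exact Finset.sum_le_sum fun j _ => periodizedPotential_le_const_mul h L _

/-- **S1 below the core radius is trivial, with the sharp constant.** If the counting radius is
smaller than the core radius (`R < r₀`), every close pair is a core pair and pays `c₀`: the
inequality of `stub_corePairDomination` holds with `C = 1/c₀` for EVERY `N`, `L` and `Ψ` (kinetic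
energy discarded). Together with `corePairDomination_ratio_le` (`C ≥ (R/r₀)³/c₀`, `R/r₀ ↑ 1`): the
constant-state bound is sharp at `R = r₀⁻`, and the whole content of S1 lies in the regime `R > r₀`
(close pairs OUTSIDE the core, which only kinetic energy can pay for — Lee's two-body Neumann
branch). A positive instance of a stub, not of a Theses statement. [folklore] -/
theorem corePairDomination_of_radius_lt_core {c₀ r₀ R : ℝ} (hc₀ : 0 < c₀) (hR : R < r₀)
    (N : ℕ) (L : ℝ) (Ψ : PeriodicTrialState N L) :
    (∫⁻ X in cellN N L,
        periodicInteraction (Set.indicator (Set.Iic R) (fun _ : ℝ => (1 : ℝ≥0∞))) L X *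
          (‖Ψ.ψ X‖₊ : ℝ≥0∞) ^ 2) ≤
      ENNReal.ofReal (1 / c₀) *
        periodicEnergy (Set.indicator (Set.Iio r₀) (fun _ : ℝ => ENNReal.ofReal c₀)) Ψ := by
  rw [one_div, ENNReal.ofReal_inv_of_pos hc₀]
  unfold periodicEnergy
  rw [← lintegral_const_mul' _ _ (ENNReal.inv_ne_top.2 (by simpa using hc₀))]
  refine lintegral_mono fun X => ?_
  calc periodicInteraction (Set.indicator (Set.Iic R) (fun _ : ℝ => (1 : ℝ≥0∞))) L X *
          (‖Ψ.ψ X‖₊ : ℝ≥0∞) ^ 2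
      ≤ ((ENNReal.ofReal c₀)⁻¹ *
          periodicInteraction (Set.indicator (Set.Iio r₀) (fun _ : ℝ => ENNReal.ofReal c₀)) L X) *
          (‖Ψ.ψ X‖₊ : ℝ≥0∞) ^ 2 :=
        mul_le_mul' (periodicInteraction_le_const_mul
          (indicator_Iic_le_inv_mul_indicator_Iio hc₀ hR) L X) le_rfl
    _ = (ENNReal.ofReal c₀)⁻¹ *
          (periodicInteraction (Set.indicator (Set.Iio r₀) (fun _ : ℝ => ENNReal.ofReal c₀)) L X *
            (‖Ψ.ψ X‖₊ : ℝ≥0∞) ^ 2) := by ring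
    _ ≤ (ENNReal.ofReal c₀)⁻¹ *
          (kineticDensity Ψ.ψ X +
            periodicInteraction (Set.indicator (Set.Iio r₀) (fun _ : ℝ => ENNReal.ofReal c₀)) L X *
              (‖Ψ.ψ X‖₊ : ℝ≥0∞) ^ 2) := by
        gcongr
        exact le_add_self


/-! ### (d′) Target S1 without the kinetic term (landed copies: `Negative/LatticeCosine.lean`, `Negative/CorePairDominationKinetic.lean`) -/

/-! ### The lattice cosine `c(y) = ∑ₐ cos(2π yₐ / L)` -/

/-- The lattice cosine `c(y) = ∑ₐ cos(2π yₐ/L)`: smooth, `Lℤ³`-periodic, even, `≤ 3` with equality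
exactly on `Lℤ³`. [folklore] -/
def latticeCos (L : ℝ) (y : Space) : ℝ := ∑ a : Fin 3, Real.cos (2 * Real.pi * y a / L)

/-- `c` is smooth. [folklore] -/
theorem contDiff_latticeCos (L : ℝ) {n : ℕ∞} : ContDiff ℝ n (latticeCos L) := by
  unfold latticeCos
  refine ContDiff.sum fun a _ => Real.contDiff_cos.comp ?_
  exact ((contDiff_const.mul (contDiff_piLp_apply (p := 2) (i := a))).div_const L)

/-- `c` is even. [folklore] -/
theorem latticeCos_neg (L : ℝ) (y : Space) : latticeCos L (-y) = latticeCos L y := by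
  unfold latticeCos
  refine Finset.sum_congr rfl fun a _ => ?_
  rw [PiLp.neg_apply, mul_neg, neg_div, Real.cos_neg]

/-- `c` is `Lℤ³`-periodic (generator form). [folklore] -/
theorem latticeCos_add_single (hL : L ≠ 0) (y : Space) (k : Fin 3) :
    latticeCos L (y + EuclideanSpace.single k L) = latticeCos L y := by
  unfold latticeCos
  refine Finset.sum_congr rfl fun a _ => ?_
  rw [PiLp.add_apply, PiLp.single_apply]
  split_ifs with h
  · have : 2 * Real.pi * (y a + L) / L = 2 * Real.pi * y a / L + (1 : ℤ) * (2 * Real.pi) := by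
      push_cast; field_simp
    rw [this, Real.cos_add_int_mul_two_pi]
  · rw [add_zero]

/-- Periodicity, subtractive form. [folklore] -/
theorem latticeCos_sub_single (hL : L ≠ 0) (y : Space) (k : Fin 3) :
    latticeCos L (y - EuclideanSpace.single k L) = latticeCos L y := by
  conv_rhs => rw [← sub_add_cancel y (EuclideanSpace.single k L)]
  rw [latticeCos_add_single hL]

/-! ### Distance to the nearest lattice point (`nearestLat`, `reduce` of `PeriodicBoseGasJastrow`) -/

/-- Each cosine only sees the offset from the nearest lattice point. [folklore] -/
theorem cos_coord_eq_cos_offset (hL : L ≠ 0) (y : Space) (a : Fin 3) :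
    Real.cos (2 * Real.pi * y a / L) = Real.cos (2 * Real.pi * reduce L y a / L) := by
  rw [reduce_apply]
  have : 2 * Real.pi * y a / L =
      2 * Real.pi * (y a - L * (round (y a / L) : ℝ)) / L + (round (y a / L) : ℤ) * (2 * Real.pi) := by
    field_simp
    ring
  rw [this, Real.cos_add_int_mul_two_pi]

/-- `3 − c(y) = ∑ₐ (1 − cos(2π dₐ/L))` with `d` the offset from the nearest lattice point. [folklore] -/
theorem three_sub_latticeCos_eq (hL : L ≠ 0) (y : Space) :
    3 - latticeCos L y = ∑ a : Fin 3, (1 - Real.cos (2 * Real.pi * reduce L y a / L)) := by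
  unfold latticeCos
  rw [Finset.sum_sub_distrib, Finset.sum_const, Finset.card_univ, Fintype.card_fin]
  simp only [nsmul_eq_mul, Nat.cast_ofNat, mul_one]
  congr 1
  exact Finset.sum_congr rfl fun a _ => cos_coord_eq_cos_offset hL y a

/-- **Upper trapping**: `3 − c(y) ≤ (2π²/L²) · d(y)²`. [folklore] -/
theorem three_sub_latticeCos_le (hL : L ≠ 0) (y : Space) :
    3 - latticeCos L y ≤ 2 * Real.pi ^ 2 / L ^ 2 * ‖reduce L y‖ ^ 2 := by
  rw [three_sub_latticeCos_eq hL, EuclideanSpace.real_norm_sq_eq, Finset.mul_sum]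
  refine Finset.sum_le_sum fun a _ => ?_
  have h := Real.one_sub_sq_div_two_le_cos (x := 2 * Real.pi * reduce L y a / L)
  have : (2 * Real.pi * reduce L y a / L) ^ 2 / 2 = 2 * Real.pi ^ 2 / L ^ 2 * reduce L y a ^ 2 := by
    ring
  linarith

/-- **Lower trapping** (Kober): `(8/L²) · d(y)² ≤ 3 − c(y)`. [folklore] -/
theorem le_three_sub_latticeCos (hL : 0 < L) (y : Space) :
    8 / L ^ 2 * ‖reduce L y‖ ^ 2 ≤ 3 - latticeCos L y := by
  rw [three_sub_latticeCos_eq hL.ne' y, EuclideanSpace.real_norm_sq_eq, Finset.mul_sum]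
  refine Finset.sum_le_sum fun a _ => ?_
  set d : ℝ := reduce L y a with hd
  have hda : |d| ≤ L / 2 := abs_reduce_apply_le hL y a
  have habs : |2 * Real.pi * d / L| ≤ Real.pi := by
    rw [abs_div, abs_of_pos hL, abs_mul, abs_of_pos (by positivity : (0 : ℝ) < 2 * Real.pi),
      div_le_iff₀ hL]
    nlinarith [Real.pi_pos]
  have h := Real.cos_le_one_sub_mul_cos_sq habs
  have hπ : Real.pi ≠ 0 := Real.pi_ne_zero
  have : 2 / Real.pi ^ 2 * (2 * Real.pi * d / L) ^ 2 = 8 / L ^ 2 * d ^ 2 := by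
    field_simp
    ring
  linarith

/-- **Other lattice points are far**: for `q ≠ nearestLat L y`, `‖y − Lq‖ ≥ L/2` (contrapositive
of `nearestLat_eq_of_norm_lt`). [folklore] -/
theorem half_le_norm_sub_latticeVec (hL : 0 < L) (y : Space) {q : Fin 3 → ℤ}
    (hq : q ≠ nearestLat L y) : L / 2 ≤ ‖y - latticeVec L q‖ := by
  by_contra h
  exact hq (nearestLat_eq_of_norm_lt hL (not_le.1 h)).symm

/-! ### Consequences of the trapping for the two indicator potentials -/

/-- **Inside the shell there is no core energy.** If `c(y) < 3 − 2π²r₀²/L²` and `2r₀ ≤ L`, every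
lattice image of `y` is at distance `≥ r₀`: the periodised core potential vanishes at `y`. [folklore] -/
theorem periodizedPotential_core_eq_zero (hL : 0 < L) {r₀ : ℝ} (hr₀L : 2 * r₀ ≤ L) (c : ℝ≥0∞)
    {y : Space} (hy : latticeCos L y < 3 - 2 * Real.pi ^ 2 * r₀ ^ 2 / L ^ 2) :
    periodizedPotential (Set.indicator (Set.Iio r₀) (fun _ : ℝ => c)) L y = 0 := by
  unfold periodizedPotential
  refine ENNReal.tsum_eq_zero.2 fun q => ?_
  refine Set.indicator_of_notMem ?_ _
  simp only [Set.mem_Iio, not_lt]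
  by_cases hq : q = nearestLat L y
  · subst hq
    change r₀ ≤ ‖reduce L y‖
    have h1 := three_sub_latticeCos_le hL.ne' y
    have h2 : 2 * Real.pi ^ 2 * r₀ ^ 2 / L ^ 2 < 2 * Real.pi ^ 2 / L ^ 2 * ‖reduce L y‖ ^ 2 := by
      linarith
    rw [div_mul_eq_mul_div, div_lt_div_iff_of_pos_right (by positivity)] at h2
    have h3 : r₀ ^ 2 < ‖reduce L y‖ ^ 2 := by
      nlinarith [Real.pi_pos, sq_nonneg Real.pi]
    by_cases hr : r₀ ≤ 0
    · exact hr.trans (norm_nonneg _)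
    · exact (abs_lt_of_sq_lt_sq' h3 (norm_nonneg _)).2.le
  · have := half_le_norm_sub_latticeVec hL y hq
    linarith

/-- **Inside the shell the pair is counted.** If `3 − 8R²/L² < c(y)` (`0 ≤ R`), the nearest image is
within `R`: the periodised counting indicator is `≥ 1` at `y`. [folklore] -/
theorem one_le_periodizedPotential_count (hL : 0 < L) {R : ℝ} (hR : 0 ≤ R) {y : Space}
    (hy : 3 - 8 * R ^ 2 / L ^ 2 < latticeCos L y) :
    1 ≤ periodizedPotential (Set.indicator (Set.Iic R) (fun _ : ℝ => (1 : ℝ≥0∞))) L y := by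
  unfold periodizedPotential
  refine le_trans (le_of_eq ?_)
    (ENNReal.le_tsum (f := fun q : Fin 3 → ℤ =>
      Set.indicator (Set.Iic R) (fun _ : ℝ => (1 : ℝ≥0∞)) ‖y - latticeVec L q‖) (nearestLat L y))
  symm
  refine Set.indicator_of_mem ?_ _
  simp only [Set.mem_Iic]
  change ‖reduce L y‖ ≤ R
  have h1 := le_three_sub_latticeCos hL y
  have h2 : 8 / L ^ 2 * ‖reduce L y‖ ^ 2 < 8 * R ^ 2 / L ^ 2 := by linarith
  rw [div_mul_eq_mul_div, div_lt_div_iff_of_pos_right (by positivity)] at h2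
  have h3 : ‖reduce L y‖ ^ 2 < R ^ 2 := by nlinarith
  exact (abs_lt_of_sq_lt_sq' h3 hR).2.le

/-- The flat glue is bounded by one. [folklore] -/
theorem expNegInvGlue_le_one (x : ℝ) : expNegInvGlue x ≤ 1 := by
  unfold expNegInvGlue
  split_ifs with h
  · exact zero_le_one
  · exact Real.exp_le_one_iff.2 (neg_nonpos.2 (inv_nonneg.2 (le_of_lt (not_le.1 h))))

/-! ### The shell state -/

/-- The (unnormalised, real) shell amplitude `g((c(x₀−x₁) − c₁)(c₂ − c(x₀−x₁)))`. [folklore] -/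
def shellAmp (L c₁ c₂ : ℝ) (X : Config 2) : ℝ :=
  expNegInvGlue ((latticeCos L (X 0 - X 1) - c₁) * (c₂ - latticeCos L (X 0 - X 1)))

/-- Where the shell amplitude is non-zero, `c₁ < c(x₀ − x₁) < c₂` (given `c₁ < c₂`). [folklore] -/
theorem levels_of_shellAmp_ne_zero {c₁ c₂ : ℝ} (h12 : c₁ < c₂) {X : Config 2}
    (hX : shellAmp L c₁ c₂ X ≠ 0) :
    c₁ < latticeCos L (X 0 - X 1) ∧ latticeCos L (X 0 - X 1) < c₂ := by
  have hpos : 0 < (latticeCos L (X 0 - X 1) - c₁) * (c₂ - latticeCos L (X 0 - X 1)) := by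
    by_contra h
    exact hX (expNegInvGlue.zero_of_nonpos (not_lt.1 h))
  rcases lt_or_ge c₁ (latticeCos L (X 0 - X 1)) with h1 | h1
  · refine ⟨h1, ?_⟩
    by_contra h2
    have : (latticeCos L (X 0 - X 1) - c₁) * (c₂ - latticeCos L (X 0 - X 1)) ≤ 0 :=
      mul_nonpos_of_nonneg_of_nonpos (by linarith) (by linarith [not_lt.1 h2])
    linarith
  · exfalso
    have : (latticeCos L (X 0 - X 1) - c₁) * (c₂ - latticeCos L (X 0 - X 1)) ≤ 0 :=
      mul_nonpos_of_nonpos_of_nonneg (by linarith) (by linarith)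
    linarith

/-- The shell amplitude is `C¹` (indeed smooth). [folklore] -/
theorem contDiff_shellAmp_real (L c₁ c₂ : ℝ) : ContDiff ℝ 1 (shellAmp L c₁ c₂) := by
  have hc : ContDiff ℝ 1 (fun X : Config 2 => latticeCos L (X 0 - X 1)) :=
    (contDiff_latticeCos L (n := 1)).comp ((contDiff_apply ℝ Space 0).sub (contDiff_apply ℝ Space 1))
  unfold shellAmp
  exact (expNegInvGlue.contDiff (n := 1)).comp ((hc.sub contDiff_const).mul (contDiff_const.sub hc))

/-- The complexified shell amplitude is `C¹`. [folklore] -/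
theorem contDiff_shellAmp (L c₁ c₂ : ℝ) :
    ContDiff ℝ 1 (fun X : Config 2 => (shellAmp L c₁ c₂ X : ℂ)) :=
  Complex.ofRealCLM.contDiff.comp (contDiff_shellAmp_real L c₁ c₂)

/-- The shell amplitude is `Lℤ³`-periodic in each particle. [folklore] -/
theorem shellAmp_periodic (hL : L ≠ 0) (c₁ c₂ : ℝ) (X : Config 2) (i : Fin 2) (a : Fin 3) :
    shellAmp L c₁ c₂ (X + Pi.single i (EuclideanSpace.single a L)) = shellAmp L c₁ c₂ X := by
  unfold shellAmp
  have : latticeCos L ((X + Pi.single i (EuclideanSpace.single a L) : Config 2) 0 -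
      (X + Pi.single i (EuclideanSpace.single a L) : Config 2) 1) = latticeCos L (X 0 - X 1) := by
    fin_cases i
    · simp only [Pi.add_apply, Fin.zero_eta, Pi.single_eq_same, Fin.isValue, ne_eq, one_ne_zero,
        not_false_eq_true, Pi.single_eq_of_ne, add_zero]
      rw [show X 0 + EuclideanSpace.single a L - X 1 = (X 0 - X 1) + EuclideanSpace.single a L by abel,
        latticeCos_add_single hL]
    · simp only [Pi.add_apply, Fin.mk_one, Fin.isValue, ne_eq, zero_ne_one, not_false_eq_true,
        Pi.single_eq_of_ne, add_zero, Pi.single_eq_same]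
      rw [show X 0 - (X 1 + EuclideanSpace.single a L) = (X 0 - X 1) - EuclideanSpace.single a L by abel,
        latticeCos_sub_single hL]
  rw [this]

/-- The shell amplitude is Bose-symmetric (`c` is even). [folklore] -/
theorem shellAmp_symm (c₁ c₂ : ℝ) (σ : Equiv.Perm (Fin 2)) (X : Config 2) :
    shellAmp L c₁ c₂ (X ∘ σ) = shellAmp L c₁ c₂ X := by
  unfold shellAmp
  have : latticeCos L ((X ∘ σ) 0 - (X ∘ σ) 1) = latticeCos L (X 0 - X 1) := by
    simp only [Function.comp_apply]
    by_cases h0 : σ 0 = 0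
    · have h1 : σ 1 = 1 := by
        refine Fin.eq_one_of_ne_zero _ fun h => ?_
        exact zero_ne_one (σ.injective (h0.trans h.symm))
      rw [h0, h1]
    · have h0' : σ 0 = 1 := Fin.eq_one_of_ne_zero _ h0
      have h1 : σ 1 = 0 := by
        by_contra h
        exact zero_ne_one (σ.injective (h0'.trans (Fin.eq_one_of_ne_zero _ h).symm))
      rw [h0', h1, ← latticeCos_neg L (X 1 - X 0), neg_sub]
  rw [this]

/-- A witness point in the open cell where the shell amplitude is non-zero, for the levels
`c₁ = 3 − 32/L²`, `c₂ = 3 − 2π²/L²` and `L ≥ 8`: `x₁ = (L/2,L/2,L/2)`, `x₀ = x₁ + s e₀` with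
`cos(2πs/L) = 1 − 26/L²`. [folklore] -/
theorem exists_shellAmp_ne_zero (hL : 8 ≤ L) :
    ∃ X₀ : Config 2, (∀ i a, X₀ i a ∈ Set.Ioo 0 L) ∧
      shellAmp L (3 - 32 / L ^ 2) (3 - 2 * Real.pi ^ 2 / L ^ 2) X₀ ≠ 0 := by
  have hL0 : 0 < L := by linarith
  have hL2 : (64 : ℝ) ≤ L ^ 2 := by nlinarith
  set u : ℝ := 1 - 26 / L ^ 2 with hu
  have h26 : 26 / L ^ 2 < 2 := by
    rw [div_lt_iff₀ (by positivity)]; linarith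
  have h26' : (0 : ℝ) ≤ 26 / L ^ 2 := by positivity
  have hu1 : -1 < u := by rw [hu]; linarith
  have hu2 : u ≤ 1 := by rw [hu]; linarith
  set s : ℝ := L / (2 * Real.pi) * Real.arccos u with hs
  have hs0 : 0 ≤ s := mul_nonneg (by positivity) (Real.arccos_nonneg u)
  have hsL : s < L / 2 := by
    have h := Real.arccos_lt_pi.2 hu1
    have : L / (2 * Real.pi) * Real.arccos u < L / (2 * Real.pi) * Real.pi :=
      mul_lt_mul_of_pos_left h (by positivity)
    calc s = L / (2 * Real.pi) * Real.arccos u := hs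
      _ < L / (2 * Real.pi) * Real.pi := this
      _ = L / 2 := by field_simp
  have hcos : Real.cos (2 * Real.pi * s / L) = u := by
    have : 2 * Real.pi * s / L = Real.arccos u := by
      rw [hs]; field_simp
    rw [this, Real.cos_arccos hu1.le hu2]
  set ctr : Space := EuclideanSpace.single 0 (L / 2) + EuclideanSpace.single 1 (L / 2) +
    EuclideanSpace.single 2 (L / 2) with hctr_def
  have hctr : ∀ a : Fin 3, ctr a = L / 2 := by
    intro a
    fin_cases a <;> simp [hctr_def]
  refine ⟨fun i => if i = 0 then ctr + EuclideanSpace.single 0 s else ctr, fun i a => ?_, ?_⟩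
  · fin_cases i
    · simp only [Fin.zero_eta, Fin.isValue, ↓reduceIte]
      rw [PiLp.add_apply, hctr, PiLp.single_apply]
      split_ifs <;> constructor <;> linarith
    · simp only [Fin.mk_one, Fin.isValue, one_ne_zero, ↓reduceIte]
      rw [hctr]; constructor <;> linarith
  · have hdiff : (fun i : Fin 2 => if i = 0 then ctr + EuclideanSpace.single 0 s else ctr) 0 -
        (fun i : Fin 2 => if i = 0 then ctr + EuclideanSpace.single 0 s else ctr) 1 =
        EuclideanSpace.single 0 s := by
      simp only [Fin.isValue, ↓reduceIte, one_ne_zero]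
      abel
    have hc : latticeCos L (EuclideanSpace.single (0 : Fin 3) s) = 3 - 26 / L ^ 2 := by
      rw [latticeCos, Fin.sum_univ_three]
      simp only [PiLp.single_apply, Fin.isValue, ↓reduceIte, one_ne_zero, Fin.reduceEq,
        mul_zero, zero_div, Real.cos_zero]
      rw [hcos, hu]; ring
    unfold shellAmp
    rw [hdiff, hc]
    refine (expNegInvGlue.pos_of_pos ?_).ne'
    have hπ : Real.pi ^ 2 < 13 := by nlinarith [Real.pi_lt_d2, Real.pi_pos]
    have h1 : (0 : ℝ) < 3 - 26 / L ^ 2 - (3 - 32 / L ^ 2) := by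
      rw [show (3 : ℝ) - 26 / L ^ 2 - (3 - 32 / L ^ 2) = 6 / L ^ 2 by ring]; positivity
    have h2 : (0 : ℝ) < 3 - 2 * Real.pi ^ 2 / L ^ 2 - (3 - 26 / L ^ 2) := by
      rw [show (3 : ℝ) - 2 * Real.pi ^ 2 / L ^ 2 - (3 - 26 / L ^ 2) = (26 - 2 * Real.pi ^ 2) / L ^ 2 by ring]
      exact div_pos (by linarith) (by positivity)
    exact mul_pos h1 h2

/-- **The shell state** on a torus of side `L ≥ 8`: the normalised smooth periodic Bose-symmetric
two-body state `Ψ ∝ g((c(x₀−x₁) − c₁)(c₂ − c(x₀−x₁)))` with `c₁ = 3 − 32/L²`, `c₂ = 3 − 2π²/L²`; its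
mass sits at periodic distance `∈ (1, 2)` from coincidence. [folklore] -/
def shellState (hL : 8 ≤ L) : PeriodicTrialState 2 L :=
  PeriodicTrialState.ofFun
    (fun X => (shellAmp L (3 - 32 / L ^ 2) (3 - 2 * Real.pi ^ 2 / L ^ 2) X : ℂ))
    (contDiff_shellAmp L _ _)
    (fun X i a => by rw [shellAmp_periodic (by linarith : L ≠ 0)])
    (fun σ X => by rw [shellAmp_symm])
    (by
      obtain ⟨X₀, hX₀, hne⟩ := exists_shellAmp_ne_zero hL
      exact (lintegral_cellN_pos (contDiff_shellAmp L _ _).continuous hX₀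
        (by exact_mod_cast hne)).ne')
    (by
      have hb : ∀ X : Config 2,
          (‖(shellAmp L (3 - 32 / L ^ 2) (3 - 2 * Real.pi ^ 2 / L ^ 2) X : ℂ)‖₊ : ℝ≥0∞) ^ 2 ≤ 1 := by
        intro X
        have h0 : 0 ≤ shellAmp L (3 - 32 / L ^ 2) (3 - 2 * Real.pi ^ 2 / L ^ 2) X :=
          expNegInvGlue.nonneg _
        have h1 : shellAmp L (3 - 32 / L ^ 2) (3 - 2 * Real.pi ^ 2 / L ^ 2) X ≤ 1 :=
          expNegInvGlue_le_one _
        have h2 : (‖(shellAmp L (3 - 32 / L ^ 2) (3 - 2 * Real.pi ^ 2 / L ^ 2) X : ℂ)‖₊ : ℝ≥0∞) ≤ 1 := by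
          rw [← ENNReal.coe_one, ENNReal.coe_le_coe, ← NNReal.coe_le_coe, coe_nnnorm,
            Complex.norm_real, Real.norm_of_nonneg h0, NNReal.coe_one]
          exact h1
        calc (‖(shellAmp L (3 - 32 / L ^ 2) (3 - 2 * Real.pi ^ 2 / L ^ 2) X : ℂ)‖₊ : ℝ≥0∞) ^ 2
            ≤ 1 ^ 2 := by gcongr
          _ = 1 := one_pow 2
      have hle : (∫⁻ X in cellN 2 L,
          (‖(shellAmp L (3 - 32 / L ^ 2) (3 - 2 * Real.pi ^ 2 / L ^ 2) X : ℂ)‖₊ : ℝ≥0∞) ^ 2) ≤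
          ∫⁻ _X in cellN 2 L, (1 : ℝ≥0∞) := lintegral_mono fun X => hb X
      rw [setLIntegral_const, one_mul, volume_cellN] at hle
      exact ne_top_of_le_ne_top (ENNReal.pow_ne_top (ENNReal.pow_ne_top ENNReal.ofReal_ne_top)) hle)

/-- The shell state is a constant multiple of the shell amplitude. [folklore] -/
theorem shellState_apply (hL : 8 ≤ L) (X : Config 2) : ∃ κ : ℂ, (shellState hL).ψ X =
    κ * (shellAmp L (3 - 32 / L ^ 2) (3 - 2 * Real.pi ^ 2 / L ^ 2) X : ℂ) :=
  ⟨_, PeriodicTrialState.ofFun_apply _ _ _ _ _ _ X⟩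

/-- On the support of the shell state: no core energy (`r₀ = 1`) and at least one counted pair
(`R = 2`). [folklore] -/
theorem shellState_support (hL : 8 ≤ L) {X : Config 2} (hX : (shellState hL).ψ X ≠ 0) :
    periodizedPotential (Set.indicator (Set.Iio 1) (fun _ : ℝ => ENNReal.ofReal 1)) L (X 0 - X 1) = 0 ∧
      1 ≤ periodizedPotential (Set.indicator (Set.Iic 2) (fun _ : ℝ => (1 : ℝ≥0∞))) L (X 0 - X 1) := by
  have hL0 : 0 < L := by linarith
  obtain ⟨κ, hκ⟩ := shellState_apply hL X
  have hamp : shellAmp L (3 - 32 / L ^ 2) (3 - 2 * Real.pi ^ 2 / L ^ 2) X ≠ 0 := by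
    intro h
    rw [hκ, h, Complex.ofReal_zero, mul_zero] at hX
    exact hX rfl
  have h12 : 3 - 32 / L ^ 2 < 3 - 2 * Real.pi ^ 2 / L ^ 2 := by
    have hπ : Real.pi ^ 2 < 13 := by nlinarith [Real.pi_lt_d2, Real.pi_pos]
    have : 2 * Real.pi ^ 2 / L ^ 2 < 32 / L ^ 2 := div_lt_div_of_pos_right (by linarith) (by positivity)
    linarith
  obtain ⟨hlo, hhi⟩ := levels_of_shellAmp_ne_zero h12 hamp
  constructor
  · refine periodizedPotential_core_eq_zero hL0 (r₀ := 1) (by linarith) _ ?_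
    simpa using hhi
  · refine one_le_periodizedPotential_count hL0 (R := 2) (by norm_num) ?_
    have : (3 : ℝ) - 8 * 2 ^ 2 / L ^ 2 = 3 - 32 / L ^ 2 := by norm_num
    rw [this]; exact hlo

/-! ### S1 without the kinetic term is false -/

/-- `stub_corePairDomination` with the KINETIC ENERGY DELETED from the right-hand side (only the
interaction energy of the core `c₀ 1_{[0,r₀)}` remains); everything else byte for byte. -/
def CorePairDominationWithoutKinetic : Prop :=
  ∀ c₀ r₀ R : ℝ, 0 < c₀ → 0 < r₀ → 0 < R →
    ∃ C L₀ : ℝ, 0 ≤ C ∧ 0 < L₀ ∧ ∀ N : ℕ, ∀ L : ℝ, L₀ ≤ L → ∀ Ψ : PeriodicTrialState N L,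
      (∫⁻ X in cellN N L,
          periodicInteraction (Set.indicator (Set.Iic R) (fun _ : ℝ => (1 : ℝ≥0∞))) L X *
            (‖Ψ.ψ X‖₊ : ℝ≥0∞) ^ 2) ≤
        ENNReal.ofReal C *
          ∫⁻ X in cellN N L,
            periodicInteraction (Set.indicator (Set.Iio r₀) (fun _ : ℝ => ENNReal.ofReal c₀)) L X *
              (‖Ψ.ψ X‖₊ : ℝ≥0∞) ^ 2

/-- Two particles: a single pair term. [folklore] -/
theorem periodicInteraction_two' (w : ℝ → ℝ≥0∞) (L : ℝ) (X : Config 2) :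
    periodicInteraction w L X = periodizedPotential w L (X 0 - X 1) := by
  have h0 : (Finset.univ.filter fun j : Fin 2 => (0 : Fin 2) < j) = {1} := by decide
  have h1 : (Finset.univ.filter fun j : Fin 2 => (1 : Fin 2) < j) = ∅ := by decide
  rw [periodicInteraction, Fin.sum_univ_two, h0, h1, Finset.sum_singleton, Finset.sum_empty, add_zero]

/-- **The kinetic term is load-bearing in S1.** With the kinetic energy deleted, the close-pair
domination fails at `(c₀, r₀, R) = (1, 1, 2)`: on any torus of side `L ≥ max L₀ 8` the shell state
has zero core interaction and one counted close pair (`1 ≤ C · 0` is false). [folklore] -/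
theorem corePairDomination_false_without_kinetic : ¬ CorePairDominationWithoutKinetic := by
  intro h
  obtain ⟨C, L₀, hC, hL₀, h⟩ := h 1 1 2 one_pos one_pos two_pos
  set L : ℝ := max L₀ 8 with hLdef
  have hL8 : 8 ≤ L := le_max_right _ _
  have key := h 2 L (le_max_left _ _) (shellState hL8)
  -- the right-hand side vanishes pointwise
  have hR : (∫⁻ X in cellN 2 L,
      periodicInteraction (Set.indicator (Set.Iio 1) (fun _ : ℝ => ENNReal.ofReal 1)) L X *
        (‖(shellState hL8).ψ X‖₊ : ℝ≥0∞) ^ 2) = 0 := by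
    have hzero : (fun X : Config 2 =>
        periodicInteraction (Set.indicator (Set.Iio 1) (fun _ : ℝ => ENNReal.ofReal 1)) L X *
          (‖(shellState hL8).ψ X‖₊ : ℝ≥0∞) ^ 2) = fun _ => 0 := by
      funext X
      by_cases hX : (shellState hL8).ψ X = 0
      · simp [hX]
      · rw [periodicInteraction_two', (shellState_support hL8 hX).1, zero_mul]
    rw [hzero, lintegral_zero]
  -- the left-hand side is at least the norm, `= 1`
  have hLhs : (1 : ℝ≥0∞) ≤ ∫⁻ X in cellN 2 L,
      periodicInteraction (Set.indicator (Set.Iic 2) (fun _ : ℝ => (1 : ℝ≥0∞))) L X *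
        (‖(shellState hL8).ψ X‖₊ : ℝ≥0∞) ^ 2 := by
    calc (1 : ℝ≥0∞) = ∫⁻ X in cellN 2 L, (‖(shellState hL8).ψ X‖₊ : ℝ≥0∞) ^ 2 :=
          (shellState hL8).norm_eq.symm
      _ ≤ _ := by
          refine lintegral_mono fun X => ?_
          by_cases hX : (shellState hL8).ψ X = 0
          · simp [hX]
          · calc (‖(shellState hL8).ψ X‖₊ : ℝ≥0∞) ^ 2
                = 1 * (‖(shellState hL8).ψ X‖₊ : ℝ≥0∞) ^ 2 := (one_mul _).symm
              _ ≤ _ := by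
                  refine mul_le_mul' ?_ le_rfl
                  rw [periodicInteraction_two']
                  exact (shellState_support hL8 hX).2
  rw [hR, mul_zero] at key
  exact absurd (hLhs.trans key) (by simp)

end Cycle3

/-! ## Cycle 4 (gen-4 seat, 2026-08-16)

### Targets — REGISTERED skeleton of line `coupling-slope-pocket` (lead reshape v2, sha b2ebe54f1b59, 7 stubs)

Audit of every stub as typed (signature read symbol by symbol; degenerate instances; hypothesis
mutation; junk hunting in the `ENNReal`/`Config`/`PeriodicTrialState` plumbing). Verdict: **no stub is
misstated**; S7 is the only gap between the line and the crux as typed. Per stub: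

* **S1 `stub_pocketClassicalStability`** — PROVED by the lead (04:49Z). Load-bearing analysis, FORMAL
  (below, landed copy `Negative/PocketInstability.lean`): (i) the positive core cannot be dropped —
  `pocketClassicalStability_false_without_core : ¬ PocketClassicalStabilityWithoutCore` (S1 with
  `0 < v 0` deleted, all else verbatim, is FALSE: hollow shell `hollowShell 1 2` + two coincident
  clusters at a pocket distance); (ii) `B > 0` is necessary for EVERY non-zero class member and every
  `t > 0` — `exists_pocket`: `v − tW` is negative somewhere (two particles there), so S1 is a statement
  about pair COUNTING against the core, never a pointwise inequality; (iii) the `t²` of `B t²` is not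
  consumed downstream (`pairMoment_of_positiveCore` hands S2 the constant `B t₁²`).
* **S2 `stub_noBindingOfStability`** (hardest) — SURVIVES; true (= Lee 2009 Thm 7). Typing audit:
  hypothesis = EUCLIDEAN `interaction` on `ℝ³`-configurations, conclusion = `periodicInteraction` on
  the torus — consistent with Lee's proof, which uses stability only inside Neumann cells of side
  `ℓ ≤ L/2`, where torus geometry is Euclidean and, for `L ≥ L₀ > 2R₀`, `W^per = W`, `v^per = v`
  (nearest image: `‖y − Lq‖ ≥ L/2 > R₀` for `q ≠ 0`, `|yₐ| ≤ L/2`); `∀ N ∀ L ≥ L₀` including HIGH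
  density is fine (the cell inequality `(1−δ)⌊k/2⌋E′ − δBk ≥ 0` is per occupation `k`, and
  `E(k,S,v) ≥ ⌊k/2⌋E(2,S,v)` by dropping cross-pair repulsion); `ofReal (B·N)` with `B < 0` clips to the
  `B = 0` case; `N = 0, 1`: left side `0`. FORMAL (below): on the coreless class the HYPOTHESIS of S2
  is unsatisfiable for every `t₁ > 0` and every `B`
  (`noBindingOfStability_hypothesis_false_of_coreless`), so S2 holds there vacuously and no choice
  of coupling redeploys Lee's lever on the `v 0 = 0` branch. Necessary scale (constant state, `N = 2`,
  informal): any admissible `t₀ ≤ ‖ṽ‖₁/‖W̃‖₁`. NUDGE (cycle 3, still valid for this form): `E′ > 0`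
  for the two-body Neumann cell problem is elementary after truncating the core to height
  `c ≤ π²/(2ℓ²)` (monotonicity in the profile + Neumann gap + `|α+φ|² ≥ ½α² − |φ|²`), no Dyson lemma.
* **S4a `stub_eulerLagrange`** — SURVIVES; true. The test function `η = −ΔΨ + V^perΨ − E₀Ψ` is `C¹`,
  periodic and symmetric (`Ψ ∈ C³`, `V^per ∈ C²` locally finite), so symmetric variations suffice;
  `n = 0`: `Ψ` constant (`T = E₀ = 0`), no pairs, `0 = 0`; `(E₀).toReal` is the right number since
  `E₀ ≤ E(const) < ⊤`. Mutation: `2R₀ < L` is possibly unnecessary (the lattice sum is locally finite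
  for every `L > 0`) — harmless, supplied eventually in `PuffFloor_of`.
* **S4b `stub_puffFeynmanFloor`** — SURVIVES; `c₁ = 12`, `c₂ = 2` (re-derived cycle 3; `N = 2` toys
  j011103/j012913). Minimality is consumed exactly once, through `q ≥ 0` on symmetric `C¹` states
  (`H − E₀ ≥ 0` ⇒ the two Cauchy–Schwarz steps); the Euler–Lagrange hypothesis supplies `m₁ = N|k|²`
  and `(H − E₀)GΨ = AΨ`. Mutation: "EL + nowhere-zero, minimality dropped" is NOT a weakening (a real
  nowhere-vanishing eigenfunction is the ground state), hence no refutable variant on this axis;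
  `n = 0` / `v ≡ 0`: `T = P = 0`, `Θ = 0` admissible, `S = 1 =` floor (equality: tight). Informal
  load-bearing remark on `c₂`: at weak coupling `λv` the kinetic energy per particle of the dilute
  minimiser is `O(λ²ρ)` (Born series) while the floor needs `Θ ≥ 16πaρ = O(λρ)`, so the `P`-term
  (`= O(λρ)`) carries the floor and `c₂ = 0` would fail in the thermodynamic limit — consistent with
  the `N = 2` toys where `P` dominates `Θ`; not a theorem (that minimiser is not computable).
* **S5 `stub_positiveMinimiser`** (= `PositiveMinimiser`, stmt-11787, by name) — SURVIVES; true for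
  the smooth class (`V^per ∈ C²_b` on the `3N`-torus ⇒ compact resolvent, simple positive ground state
  `ψ₀ ∈ C^{3,α}` by two Schauder steps with `V ∈ C^{1,1}`; the infimum over the `C¹` periodic Bose
  class is the operator ground-state energy (form core) and is attained at `ψ₀`; `n = 0`: the
  constant). Junk hunt: values `v r` at `r < 0` are never read; tiny `L` (many images) keeps `V^per`
  `C²` (locally finite sum); no smooth-class member with a non-`C³` minimiser (that needs a
  discontinuous `v`, excluded by `ContDiff ℝ 2 ṽ`). It is the line's — and the route's — heaviest
  FORMAL debt (Rellich/Schauder/Perron–Frobenius are not in Mathlib), not a truth risk.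
* **S6 `stub_positiveMinimiserUnique`** — SURVIVES; true for every measurable `v`
  (`PeriodicTrialState` = `ψ` + `Prop` fields, so `Ψ₁ = Ψ₂` IS `ψ`-equality; `Φ = √((Ψ₁²+Ψ₂²)/2)` is
  admissible, `E[Φ] = E₀ − ∫ |Ψ₂∇Ψ₁ − Ψ₁∇Ψ₂|²/(2(Ψ₁²+Ψ₂²))` with all quantities finite because
  `E[Ψ₂] = E₀ = E[Ψ₁] ≠ ⊤` — finiteness is stated once, correctly). Mutation: reality of BOTH states is
  load-bearing (`Ψ₂ = −Ψ₁`; trivial, not formalised); dropping `Ψᵢ ≠ 0` keeps the statement true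
  (Perron–Frobenius) but breaks the elementary proof (`Φ ∉ C¹` at common zeros) — keep as is.
* **S7 `stub_corelessPairMoment`** — OPEN residual (expected true, unchanged). New this cycle: (i) the
  positive-core lever is FORMALLY void here (S1 false, S2 vacuous — below), so S7 is not reachable by
  strengthening S1/S2; (ii) energy-window weakenings of S7 are not refutable by computable witnesses
  (a violating near-minimiser must certify `E ≤ E₀(v) + δ′` for an interacting `v`, and `E₀(v)` is
  unknown to that accuracy; at `v ≡ 0`, `W ≡ 0`); (iii) `N = 2` hollow-shell toy `kit j014616`
  (exact torus minimiser of `−2Δ + v^per`, `v = A·g((r²−1)(4−r²))`, `A ∈ {5,50,500}`, `L ∈ {6,8}`):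
  floor and Puff `Θ = 6T + P` check on the coreless branch, and `P·L³/4` = the `N = 2` value of
  `C_P` — numbers folded into the seat's evidence note / next version when the job returns.

JOINT SUFFICIENCY (`PuffFloor_of`, kernel-checked; composition re-read): `C = c₁C_E + c₂C_P`,
`C_P = C_E/t₀` on the core branch; S2 receives `B t₁²` from S1; `L ≥ L₀` and `2R₀ < L` are supplied
eventually in `n` by `tendsto_sideLength_succ`; S6 is applied with `hv.1 : Measurable v`; no stub is
used outside its hypotheses. The only distance between the line and the crux AS TYPED is S7
(disposition unchanged: tenure restatement `0 < v 0`, physically immaterial).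

### (a″) Load-bearing analysis of the registered S1/S2 — the pocket lemma and coreless instability
(landed copy: `Negative/PocketInstability.lean`, same names in namespace `…Theorems.PuffFloor.Negative`)
-/

section Cycle4
open Set Filter Metric
open scoped Topology

/-! ### The radial restriction `h(s) = ṽ(s e₀)` and the bound `|h''(s)| ≤ ‖D²ṽ(s e₀)‖` -/

/-- `ṽ(x) = v(|x|)` as a real function on `ℝ³`. [folklore] -/
def vtilde (v : ℝ → ℝ≥0∞) : Space → ℝ := fun x => (v ‖x‖).toReal

/-- The unit vector `e₀`. [folklore] -/
def e0 : Space := EuclideanSpace.single (0 : Fin 3) (1 : ℝ)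

/-- `‖e₀‖ = 1`. [folklore] -/
theorem norm_e0 : ‖e0‖ = 1 := by
  simp [e0]

/-- The line `s ↦ s e₀` as a continuous linear map. [folklore] -/
def lineMap0 : ℝ →L[ℝ] Space := ContinuousLinearMap.smulRight (1 : ℝ →L[ℝ] ℝ) e0

/-- `lineMap0 s = s • e₀`. [folklore] -/
theorem lineMap0_apply (s : ℝ) : lineMap0 s = s • e0 := by
  simp [lineMap0]

/-- The Puff pair-weight profile `W(r) = r² ‖D²ṽ(r e₀)‖` of the line `coupling-slope-pocket`
(verbatim the profile of stubs S1/S2/S4b/S7). [folklore] -/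
def puffWeight (v : ℝ → ℝ≥0∞) : ℝ → ℝ≥0∞ := fun r : ℝ => ENNReal.ofReal (r ^ 2 *
  ‖iteratedFDeriv ℝ 2 (fun x : Space => (v ‖x‖).toReal)
    (r • EuclideanSpace.single (0 : Fin 3) (1 : ℝ))‖)

/-- `W(0) = 0`. [folklore] -/
theorem puffWeight_zero (v : ℝ → ℝ≥0∞) : puffWeight v 0 = 0 := by
  simp [puffWeight]

/-- The radial restriction `h(s) = ṽ(s e₀) = v(|s|)`. [folklore] -/
def radial (v : ℝ → ℝ≥0∞) : ℝ → ℝ := fun s => vtilde v (s • e0)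

/-- `h = ṽ ∘ lineMap0`. [folklore] -/
theorem radial_eq_comp (v : ℝ → ℝ≥0∞) : radial v = vtilde v ∘ (lineMap0 : ℝ → Space) := by
  ext s
  simp [radial, Function.comp, lineMap0_apply]

/-- `h(s) = v(s)` for `s > 0`. [folklore] -/
theorem radial_apply_of_pos (v : ℝ → ℝ≥0∞) {s : ℝ} (hs : 0 < s) : radial v s = (v s).toReal := by
  simp [radial, vtilde, norm_smul, norm_e0, abs_of_pos hs]

/-- `h ≥ 0`. [folklore] -/
theorem radial_nonneg (v : ℝ → ℝ≥0∞) (s : ℝ) : 0 ≤ radial v s := ENNReal.toReal_nonneg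

/-- `h` is `C²` when `ṽ` is. [folklore] -/
theorem contDiff_radial {v : ℝ → ℝ≥0∞} (hC2 : ContDiff ℝ 2 (vtilde v)) : ContDiff ℝ 2 (radial v) := by
  rw [radial_eq_comp]
  exact hC2.comp lineMap0.contDiff

/-- **`|h''(s)| ≤ ‖D²ṽ(s e₀)‖`**: the second derivative of the radial restriction is the Hessian
of `ṽ` evaluated on `(e₀, e₀)`. [folklore] -/
theorem abs_deriv_deriv_radial_le {v : ℝ → ℝ≥0∞} (hC2 : ContDiff ℝ 2 (vtilde v)) (s : ℝ) :
    |deriv (deriv (radial v)) s| ≤ ‖iteratedFDeriv ℝ 2 (vtilde v) (s • e0)‖ := by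
  have h1 : deriv (deriv (radial v)) s = iteratedDeriv 2 (radial v) s := by
    rw [iteratedDeriv_succ, iteratedDeriv_one]
  have h2 : iteratedDeriv 2 (radial v) s =
      (iteratedFDeriv ℝ 2 (radial v) s : (Fin 2 → ℝ) → ℝ) fun _ => 1 :=
    iteratedDeriv_eq_iteratedFDeriv
  have h3 : iteratedFDeriv ℝ 2 (radial v) s =
      (iteratedFDeriv ℝ 2 (vtilde v) (lineMap0 s)).compContinuousLinearMap fun _ => lineMap0 := by
    rw [radial_eq_comp]
    exact ContinuousLinearMap.iteratedFDeriv_comp_right _ hC2 _ (by exact_mod_cast le_rfl)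
  rw [h1, h2, h3, ContinuousMultilinearMap.compContinuousLinearMap_apply, lineMap0_apply]
  simp only [lineMap0_apply, one_smul]
  calc |(iteratedFDeriv ℝ 2 (vtilde v) (s • e0)) fun _ => e0|
      = ‖(iteratedFDeriv ℝ 2 (vtilde v) (s • e0)) fun _ => e0‖ := (Real.norm_eq_abs _).symm
    _ ≤ ‖iteratedFDeriv ℝ 2 (vtilde v) (s • e0)‖ * ∏ _i : Fin 2, ‖e0‖ :=
        ContinuousMultilinearMap.le_opNorm _ _
    _ = ‖iteratedFDeriv ℝ 2 (vtilde v) (s • e0)‖ := by simp [norm_e0]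

/-! ### Every non-zero finite-range `C²` potential has a pocket -/

/-- **Pocket lemma.** If `v` is finite, of finite range, `C²` as `ṽ(x) = v(|x|)`, and not
identically zero on `(0, ∞)`, then for every `t > 0` there is `r > 0` with
`ṽ(r) < t · r² ‖D²ṽ(r e₀)‖` — i.e. `(v − tW)(r) < 0` for the Puff weight `W(r) = r²‖D²ṽ(r e₀)‖`.
Holds for solid and hollow cores alike (the pocket sits at the edge of the support). [folklore] -/
theorem exists_pocket {v : ℝ → ℝ≥0∞} (hv : IsRepulsiveFiniteRange v) (hfin : ∀ r, v r ≠ ⊤)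
    (hC2 : ContDiff ℝ 2 (vtilde v)) (hne : ∃ r, 0 < r ∧ v r ≠ 0) {t : ℝ} (ht : 0 < t) :
    ∃ r, 0 < r ∧ (v r).toReal < t * (r ^ 2 * ‖iteratedFDeriv ℝ 2 (vtilde v) (r • e0)‖) := by
  by_contra hcon
  push Not at hcon
  -- the radial restriction and its regularity
  set h := radial v with hh
  have hcont : ContDiff ℝ 2 h := contDiff_radial hC2
  have hdiff : Differentiable ℝ h := hcont.differentiable (by norm_num)
  have hdiff' : Differentiable ℝ (deriv h) := hcont.differentiable_deriv_two
  have hcontin : Continuous h := hdiff.continuous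
  have hpos_apply : ∀ s, 0 < s → h s = (v s).toReal := fun s hs => radial_apply_of_pos v hs
  have hnonneg : ∀ s, 0 ≤ h s := radial_nonneg v
  -- the support edge `b`
  obtain ⟨R₀, hR₀⟩ := hv.2
  set S : Set ℝ := {s | 0 < s ∧ h s ≠ 0} with hS
  obtain ⟨r, hr, hvr⟩ := hne
  have hrS : r ∈ S := by
    refine ⟨hr, ?_⟩
    rw [hpos_apply r hr]
    exact fun h0 => ((ENNReal.toReal_eq_zero_iff _).1 h0).elim hvr (hfin r)
  have hSne : S.Nonempty := ⟨r, hrS⟩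
  have hSbdd : BddAbove S := by
    refine ⟨R₀, fun s hs => le_of_not_gt fun hlt => hs.2 ?_⟩
    rw [hpos_apply s hs.1, hR₀ s hlt, ENNReal.toReal_zero]
  set b := sSup S with hb
  have hrb : r ≤ b := le_csSup hSbdd hrS
  have hb_pos : 0 < b := hr.trans_le hrb
  have h_above : ∀ s, b < s → h s = 0 := by
    intro s hs
    by_contra hs0
    exact absurd (le_csSup hSbdd ⟨hb_pos.trans hs, hs0⟩) (not_le.2 hs)
  have hb_zero : h b = 0 := by
    by_contra hb0
    have hev : ∀ᶠ z in 𝓝 b, h z ≠ 0 := hcontin.continuousAt.eventually_ne hb0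
    obtain ⟨ε, hε, hball⟩ := Metric.eventually_nhds_iff.1 hev
    have hmem : dist (b + ε / 2) b < ε := by
      rw [Real.dist_eq, show b + ε / 2 - b = ε / 2 by ring, abs_of_pos (by positivity)]
      linarith
    exact hball hmem (h_above _ (by linarith))
  have hderiv_b : deriv h b = 0 := by
    refine IsLocalMin.deriv_eq_zero ?_
    exact Filter.Eventually.of_forall fun s => by rw [hb_zero]; exact hnonneg s
  -- the differential inequality `|h''| ≤ K h` on `[b/2, ∞)`
  set K : ℝ := 4 / (t * b ^ 2) with hK
  have hKpos : 0 < K := by positivity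
  have hbound : ∀ s, b / 2 ≤ s → |deriv (deriv h) s| ≤ K * h s := by
    intro s hs
    have hs0 : 0 < s := by linarith
    have h1 := abs_deriv_deriv_radial_le hC2 s
    have h2 := hcon s hs0
    have hts : 0 < t * s ^ 2 := by positivity
    have h3 : ‖iteratedFDeriv ℝ 2 (vtilde v) (s • e0)‖ ≤ (v s).toReal / (t * s ^ 2) := by
      rw [le_div_iff₀ hts]
      linarith
    have h4 : (v s).toReal / (t * s ^ 2) ≤ K * h s := by
      rw [← hpos_apply s hs0, hK, div_le_iff₀ hts]
      have hh0 : 0 ≤ h s := hnonneg s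
      have hsb : b ^ 2 ≤ 4 * s ^ 2 := by nlinarith
      have : h s * (t * b ^ 2) ≤ h s * (4 * (t * s ^ 2)) := by
        apply mul_le_mul_of_nonneg_left _ hh0
        nlinarith
      calc h s = h s * (t * b ^ 2) / (t * b ^ 2) := by field_simp
        _ ≤ h s * (4 * (t * s ^ 2)) / (t * b ^ 2) := by gcongr
        _ = 4 / (t * b ^ 2) * h s * (t * s ^ 2) := by ring
    exact h1.trans (h3.trans h4)
  -- the window `[b - δ, b]`
  set δ : ℝ := min (b / 2) (b * min t 1 / 4) with hδ
  have hδpos : 0 < δ := by positivity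
  have hδle : δ ≤ b / 2 := min_le_left _ _
  have hKδ : K * δ ^ 2 ≤ 1 / 4 := by
    have hδ2 : δ ≤ b * min t 1 / 4 := min_le_right _ _
    have hmin1 : min t 1 ≤ 1 := min_le_right _ _
    have hmint : min t 1 ≤ t := min_le_left _ _
    have hmin0 : 0 < min t 1 := by positivity
    have hsq : δ ^ 2 ≤ (b * min t 1 / 4) ^ 2 := pow_le_pow_left₀ hδpos.le hδ2 2
    have hmm : (min t 1) ^ 2 ≤ t := by nlinarith
    rw [hK]
    rw [div_mul_eq_mul_div, div_le_iff₀ (by positivity)]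
    nlinarith [sq_nonneg b, hb_pos]
  -- a point of `S` in the window, and the maximum of `h` on the window
  obtain ⟨s₁, hs₁S, hs₁⟩ := exists_lt_of_lt_csSup hSne (show b - δ < b by linarith)
  have hs₁b : s₁ ≤ b := le_csSup hSbdd hs₁S
  obtain ⟨x₀, hx₀mem, hx₀max⟩ := (isCompact_Icc (a := b - δ) (b := b)).exists_isMaxOn
    (nonempty_Icc.2 (by linarith)) hcontin.continuousOn
  set M := h x₀ with hM
  have hs₁pos : 0 < h s₁ := lt_of_le_of_ne (hnonneg s₁) (Ne.symm hs₁S.2)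
  have hM_pos : 0 < M := hs₁pos.trans_le (hx₀max ⟨hs₁.le, hs₁b⟩)
  have hx₀_lt_b : x₀ < b := by
    rcases lt_or_eq_of_le hx₀mem.2 with hlt | heq
    · exact hlt
    · exact absurd (by rw [hM, heq, hb_zero]) hM_pos.ne
  -- two mean value steps
  obtain ⟨ξ₁, hξ₁mem, hξ₁⟩ := exists_deriv_eq_slope h hx₀_lt_b hcontin.continuousOn
    (hdiff.differentiableOn)
  obtain ⟨ξ₂, hξ₂mem, hξ₂⟩ := exists_deriv_eq_slope (deriv h) hξ₁mem.2
    hdiff'.continuous.continuousOn (hdiff'.differentiableOn)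
  have hgap1 : 0 < b - x₀ := by linarith
  have hgap1' : b - x₀ ≤ δ := by linarith [hx₀mem.1]
  have hgap2 : 0 < b - ξ₁ := by linarith [hξ₁mem.2]
  have hgap2' : b - ξ₁ ≤ δ := by linarith [hξ₁mem.1, hx₀mem.1]
  have hdd : deriv (deriv h) ξ₂ = M / ((b - x₀) * (b - ξ₁)) := by
    rw [hξ₂, hderiv_b, hξ₁, hb_zero, hM]
    field_simp
    ring
  have hlow : M / δ ^ 2 ≤ |deriv (deriv h) ξ₂| := by
    rw [hdd, abs_of_pos (by positivity)]
    apply div_le_div_of_nonneg_left hM_pos.le (by positivity)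
    rw [sq]
    exact mul_le_mul hgap1' hgap2' hgap2.le hδpos.le
  have hξ₂win : ξ₂ ∈ Icc (b - δ) b :=
    ⟨by linarith [hξ₂mem.1, hξ₁mem.1, hx₀mem.1], hξ₂mem.2.le⟩
  have hup : |deriv (deriv h) ξ₂| ≤ K * M := by
    refine (hbound ξ₂ (by linarith [hξ₂win.1])).trans ?_
    exact mul_le_mul_of_nonneg_left (hx₀max hξ₂win) hKpos.le
  have hfin' : M / δ ^ 2 ≤ K * M := hlow.trans hup
  rw [div_le_iff₀ (by positivity)] at hfin'
  nlinarith [hM_pos, hKδ, hfin']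

/-! ### Two coincident clusters: the interaction of `k + k` points -/

/-- Two coincident clusters: `k` points at the origin and `k` points at `y`. [folklore] -/
def twoCluster (k : ℕ) (y : Space) : Config (k + k) := fun i => if (i : ℕ) < k then 0 else y

/-- For a profile with `u(0) = 0`, the interaction of two coincident clusters is carried by the
`k²` cross pairs: `∑_{i<j} u(|xᵢ − xⱼ|) = k² u(‖y‖)`. [folklore] -/
theorem interaction_twoCluster {u : ℝ → ℝ≥0∞} (hu0 : u 0 = 0) (k : ℕ) (y : Space) :
    interaction u (twoCluster k y) = ((k * k : ℕ) : ℝ≥0∞) * u ‖y‖ := by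
  unfold interaction
  simp_rw [Finset.sum_filter]
  rw [Fin.sum_univ_add]
  simp_rw [Fin.sum_univ_add]
  have hA : ∀ a : Fin k, (twoCluster k y (Fin.castAdd k a)) = 0 := by
    intro a; simp [twoCluster]
  have hB : ∀ a : Fin k, (twoCluster k y (Fin.natAdd k a)) = y := by
    intro a; simp [twoCluster]
  have h1 : ∀ a b : Fin k, (if Fin.castAdd k a < Fin.castAdd k b then
      u (dist (twoCluster k y (Fin.castAdd k a)) (twoCluster k y (Fin.castAdd k b))) else 0) = 0 := by
    intro a b
    rw [hA, hA, dist_self, hu0]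
    simp
  have h2 : ∀ a b : Fin k, (if Fin.castAdd k a < Fin.natAdd k b then
      u (dist (twoCluster k y (Fin.castAdd k a)) (twoCluster k y (Fin.natAdd k b))) else 0) = u ‖y‖ := by
    intro a b
    rw [hA, hB, dist_zero_left, if_pos]
    rw [Fin.lt_def, Fin.val_castAdd, Fin.val_natAdd]
    omega
  have h3 : ∀ a b : Fin k, (if Fin.natAdd k a < Fin.castAdd k b then
      u (dist (twoCluster k y (Fin.natAdd k a)) (twoCluster k y (Fin.castAdd k b))) else 0) = 0 := by
    intro a b
    rw [if_neg]
    rw [Fin.lt_def, Fin.val_castAdd, Fin.val_natAdd]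
    omega
  have h4 : ∀ a b : Fin k, (if Fin.natAdd k a < Fin.natAdd k b then
      u (dist (twoCluster k y (Fin.natAdd k a)) (twoCluster k y (Fin.natAdd k b))) else 0) = 0 := by
    intro a b
    rw [hB, hB, dist_self, hu0]
    simp
  simp_rw [h1, h2, h3, h4]
  simp only [Finset.sum_const_zero, zero_add, add_zero, Finset.sum_const, Finset.card_univ,
    Fintype.card_fin, nsmul_eq_mul]
  push_cast
  ring

/-! ### Coreless pockets are classically unstable -/

/-- **Instability of the coreless pocket.** If `v(0) = 0` and `r > 0` is a pocket point of
`v − tW` (`ṽ(r) < t r² ‖D²ṽ(r e₀)‖`, `v r` finite), then for every real `c` some configuration has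
`∑_{i<j} v(|xᵢ−xⱼ|) + c·N < t ∑_{i<j} W(|xᵢ−xⱼ|)`: two coincident clusters of `k` points at
distance `r`, `k` large. [folklore] -/
theorem pocket_unstable_of_coreless {v : ℝ → ℝ≥0∞} (hv0 : v 0 = 0) {t r : ℝ} (ht : 0 < t)
    (hr : 0 < r) (hfin : v r ≠ ⊤)
    (hpocket : (v r).toReal < t * (r ^ 2 * ‖iteratedFDeriv ℝ 2 (vtilde v) (r • e0)‖)) (c : ℝ) :
    ∃ N : ℕ, ∃ X : Config N,
      interaction v X + ENNReal.ofReal (c * N) < ENNReal.ofReal t * interaction (puffWeight v) X := by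
  set w : ℝ := r ^ 2 * ‖iteratedFDeriv ℝ 2 (vtilde v) (r • e0)‖ with hw
  set a : ℝ := (v r).toReal with ha
  have ha0 : 0 ≤ a := ENNReal.toReal_nonneg
  have hw0 : 0 ≤ w := by positivity
  have hgap : 0 < t * w - a := by linarith
  -- cluster size
  obtain ⟨k, hk⟩ := exists_nat_gt (2 * |c| / (t * w - a))
  have hk1 : 2 * |c| < k * (t * w - a) := by
    rwa [div_lt_iff₀ hgap] at hk
  have hkpos : (0 : ℝ) < k := by
    have : (0 : ℝ) ≤ 2 * |c| / (t * w - a) := by positivity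
    linarith
  refine ⟨k + k, twoCluster k (r • e0), ?_⟩
  have hnorm : ‖r • e0‖ = r := by rw [norm_smul, norm_e0, mul_one, Real.norm_eq_abs, abs_of_pos hr]
  have hW0 : puffWeight v 0 = 0 := puffWeight_zero v
  rw [interaction_twoCluster hv0, interaction_twoCluster hW0, hnorm]
  have hvr : v r = ENNReal.ofReal a := by rw [ha, ENNReal.ofReal_toReal hfin]
  have hWr : puffWeight v r = ENNReal.ofReal w := rfl
  rw [hvr, hWr]
  have hkk : ((k * k : ℕ) : ℝ≥0∞) = ENNReal.ofReal ((k : ℝ) * k) := by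
    rw [← ENNReal.ofReal_natCast]; push_cast; rfl
  rw [hkk, ← ENNReal.ofReal_mul (by positivity), ← ENNReal.ofReal_mul (by positivity),
    ← ENNReal.ofReal_mul ht.le]
  have hN : (((k + k : ℕ) : ℕ) : ℝ) = (k : ℝ) + k := by push_cast; ring
  have hle : c * ((k + k : ℕ) : ℝ) ≤ |c| * ((k : ℝ) + k) := by
    rw [hN]
    exact mul_le_mul_of_nonneg_right (le_abs_self c) (by positivity)
  have hw_pos : 0 < w := by
    by_contra hw'
    have : w = 0 := le_antisymm (not_lt.1 hw') hw0
    rw [this, mul_zero] at hgap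
    linarith
  have hrhs : 0 < t * ((k : ℝ) * k * w) := mul_pos ht (mul_pos (mul_pos hkpos hkpos) hw_pos)
  calc ENNReal.ofReal ((k : ℝ) * k * a) + ENNReal.ofReal (c * ((k + k : ℕ) : ℝ))
      ≤ ENNReal.ofReal ((k : ℝ) * k * a) + ENNReal.ofReal (|c| * ((k : ℝ) + k)) :=
        add_le_add_right (ENNReal.ofReal_le_ofReal hle) _
    _ = ENNReal.ofReal ((k : ℝ) * k * a + |c| * ((k : ℝ) + k)) := by
        rw [ENNReal.ofReal_add (by positivity) (by positivity)]
    _ < ENNReal.ofReal (t * ((k : ℝ) * k * w)) := by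
        rw [ENNReal.ofReal_lt_ofReal_iff hrhs]
        nlinarith [hk1, hkpos]

/-- **The classical-stability hypothesis of S2 is unsatisfiable without a core.** For every finite,
finite-range `v` with `ṽ ∈ C²`, `v(0) = 0` and `v ≢ 0` on `(0,∞)`, the pocket potential `v − t₁W`
is classically UNSTABLE for EVERY `t₁ > 0`: no constant `B` gives
`t₁ ∑_{i<j} W ≤ ∑_{i<j} v + B·N` on all configurations. So on the coreless branch of
`PuffFloor_of` the stub `stub_noBindingOfStability` (Lee 2009, Thm 7) holds only vacuously and
delivers no pair-moment bound — the lever is void there, for every coupling. [folklore] -/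
theorem noBindingOfStability_hypothesis_false_of_coreless {v : ℝ → ℝ≥0∞}
    (hv : IsRepulsiveFiniteRange v) (hfin : ∀ r, v r ≠ ⊤)
    (hC2 : ContDiff ℝ 2 (fun x : Space => (v ‖x‖).toReal))
    (hv0 : v 0 = 0) (hne : ∃ r, 0 < r ∧ v r ≠ 0) {t₁ : ℝ} (ht₁ : 0 < t₁) (B : ℝ) :
    ¬ (∀ N : ℕ, ∀ X : Config N,
        ENNReal.ofReal t₁ *
            interaction (fun r : ℝ => ENNReal.ofReal (r ^ 2 *
              ‖iteratedFDeriv ℝ 2 (fun x : Space => (v ‖x‖).toReal)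
                (r • EuclideanSpace.single (0 : Fin 3) (1 : ℝ))‖)) X
          ≤ interaction v X + ENNReal.ofReal (B * N)) := by
  intro hstab
  obtain ⟨r, hr, hpocket⟩ := exists_pocket hv hfin hC2 hne ht₁
  obtain ⟨N, X, hlt⟩ := pocket_unstable_of_coreless hv0 ht₁ hr (hfin r) hpocket B
  exact absurd (hstab N X) (not_le.2 hlt)

/-! ### S1 without the positive core is false -/

/-- `stub_pocketClassicalStability` of `Lines/coupling-slope-pocket.lean` (registered skeleton,
lead reshape v2) with the hypothesis `0 < v 0` DELETED, everything else verbatim. [folklore] -/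
def PocketClassicalStabilityWithoutCore : Prop :=
  ∀ v : ℝ → ℝ≥0∞, IsRepulsiveFiniteRange v → (∀ r, v r ≠ ⊤) →
    ContDiff ℝ 2 (fun x : Space => (v ‖x‖).toReal) →
    (∃ Cₑ : ℝ, ∀ x : Space, ‖iteratedFDeriv ℝ 2 (fun x : Space => (v ‖x‖).toReal) x‖
        ≤ Cₑ * Real.sqrt ((v ‖x‖).toReal)) →
    ∀ R₀ : ℝ, 0 < R₀ → (∀ r, R₀ < r → v r = 0) →
    ∃ t₁ B : ℝ, 0 < t₁ ∧ 0 ≤ B ∧ ∀ t : ℝ, 0 < t → t ≤ t₁ → ∀ N : ℕ, ∀ X : Config N,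
      ENNReal.ofReal t *
          interaction (fun r : ℝ => ENNReal.ofReal (r ^ 2 *
            ‖iteratedFDeriv ℝ 2 (fun x : Space => (v ‖x‖).toReal)
              (r • EuclideanSpace.single (0 : Fin 3) (1 : ℝ))‖)) X
        ≤ interaction v X + ENNReal.ofReal (B * t ^ 2 * N)

/-- **S1 is false without the positive core** (`0 < v 0` is load-bearing in
`stub_pocketClassicalStability`): the hollow shell `v(r) = g((r² − 1)(4 − r²))` is a smooth-class
member with `v = 0` on `[0,1]` and `v ≠ 0`, and for it `v − tW` is classically unstable for every
`t > 0` (`noBindingOfStability_hypothesis_false_of_coreless`). [folklore] -/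
theorem pocketClassicalStability_false_without_core : ¬ PocketClassicalStabilityWithoutCore := by
  intro H
  obtain ⟨h1, h2, h3, h4, h5, h6⟩ := hollowShell_mem_smoothClass one_pos (one_lt_two : (1 : ℝ) < 2)
  -- a positive range parameter
  obtain ⟨R, hR⟩ := h1.2
  have hrange : ∀ r, max R 1 < r → hollowShell 1 2 r = 0 :=
    fun r hr => hR r (lt_of_le_of_lt (le_max_left R 1) hr)
  obtain ⟨t₁, B, ht₁, -, hstab⟩ := H (hollowShell 1 2) h1 h2 h3 h4 (max R 1)
    (lt_max_of_lt_right one_pos) hrange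
  have hv0 : hollowShell 1 2 0 = 0 := h5 0 (by simp)
  have hne : ∃ r, 0 < r ∧ hollowShell 1 2 r ≠ 0 :=
    ⟨Real.sqrt ((1 ^ 2 + 2 ^ 2) / 2), Real.sqrt_pos.2 (by norm_num), h6⟩
  exact noBindingOfStability_hypothesis_false_of_coreless h1 h2 h3 hv0 hne ht₁ (B * t₁ ^ 2)
    (fun N X => hstab t₁ ht₁ le_rfl N X)


end Cycle4

end Summit.AtomisticToContinuum.BoseEinsteinCondensation.Cruxes.PuffFloor.Disproof

end
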